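import Mathlib
import Literature.Computability.Complexity.ForsterIsotropicPosition
import HarnessLib

/-!
# Forster's theorems (proved): radial isotropic position (Forster 2002, Thm 4.1) — discharge of
# `ForsterIsotropicPosition` — the half-space / sign-rank bound (Forster 2002, Thm 2.2), and the
# weighted form (generalized Forster transform, Diakonikolas–Kane–Tzamos 2021 Thm 2.1 / HKLM 2020)

Source: J. Forster, *A linear lower bound on the unbounded error probabilistic communication
complexity*, J. Comput. System Sci. 65 (2002) 612–625 [Forster2002]: Lemma 2.1, Theorem 2.2 (if a
`±1` matrix `M` on `X × Y` is realized by homogeneous half spaces in `ℝ^k` then `k ≥ √(|X||Y|)/‖M‖`),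
Theorem 4.1 (radial isotropic position: a finite family `u : X → ℝ^k`, `|X| ≥ k`, in general
position admits a nonsingular `A` with `∑_x (Au_x)(Au_x)ᵀ/‖Au_x‖² = (|X|/k)·I`), Lemmas 4.1–4.2.

PROVENANCE. This file is the Literature copy (librarian rule: "a Theorems lemma that is generic
mathematics → a Literature copy"; Literature facts are discharged in Literature, D-0014) of the
proofs written summit-side for route `QuantumAdvantage/HankelLift` in
`Summits/QuantumAdvantage/QuantumAdvantage/Theorems/HankelLiftBeyondRectanglesForster{Core,Spectral,Opt,
Coercive,QuantGP,Reduction,Isotropic}.lean` (namespace `Summit.QuantumAdvantage.QuantumAdvantage.Theorems.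
HankelLift.Forster`, theorems `forsterIsotropicPosition_holds`, `forster_halfspaceBound`), concatenated in
dependency order with the namespace changed to `Literature.Computability.Complexity.Forster` and nothing
else altered; those Theorems files now duplicate this Literature module (refactor debt for the
librarian: they may be slimmed to `import` this file). The named fact
`Literature.Computability.Complexity.ForsterIsotropicPosition` (typed verbatim from Forster's Thm 4.1,
relocated by the gate from that route) is DISCHARGED here as
`Literature.Computability.Complexity.ForsterIsotropicPosition_holds`, so that every summit (e.g. the
psd-rank cell `PneNP/ChebyshevTracialDesign`, whose literature memo LIT-33 names radial isotropic
position / Forster–Barthe–HKLM as the printed "directional decomposition" tool) can use Forster's theorem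
from Literature.

THE ARGUMENT (variational; Forster's own proof iterates an eigenvalue-raising step, Lemmas 4.1–4.2 —
the minimization below packages the same first-order condition):
* Part 0 (`…Core`): the operator-norm lemma and Forster's Lemma 2.1 / inequality (1) in coordinates
  (`sq_sum_transpose_le`, `forster_lemma21`, `forster_count`), and general-position perturbations
  (`exists_perturb_forall_notMem`, `exists_generalPosition`).
* Part I (`…Opt`): the first-order condition of `Φ(A) = ∑_x log ‖Au_x‖² − (|X|/k) log (det A)²` at a
  minimizer over invertible matrices is the isotropic identity (`isotropic_of_isMinOn`).
* Part IIa (`…Spectral`): spectral data of `AᵀA`.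
* Part IIb (`…Coercive`): coercivity of `Φ` on `{∑ A_{ij}² = 1}` from quantitative general position
  (the layer-cake inequality).
* Part III (`…QuantGP`): quantitative general position by compactness over orthonormal frames.
* Reduction (`…Reduction`): Theorem 2.2 from Theorem 4.1 (normalize, perturb into general position,
  apply radial isotropic position, count with Lemma 2.1).
* Assembly (`…Isotropic`): existence of a minimizer on the compact set `{∑A_{ij}² = 1, det(A)² ≥ η}`,
  `exists_isotropic`, the discharge, and Theorem 2.2 unconditional (`forster_halfspaceBound`).
* Part V (added in Literature, 2026-08-28): the WEIGHTED form under the strict subspace-mass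
  inequality — the "generalized Forster transform" of Hopkins–Kane–Lovett–Mahajan 2020 /
  Diakonikolas–Kane–Tzamos 2021 (Thm 2.1), i.e. Barthe's radial isotropic position for a finitely
  supported mass distribution: `exists_slack` (the slack of the strict inequalities, by compactness
  over frames), `layer_cake_w`, `coercive_bound_w`, `isotropic_of_isMinOn_w`, `exists_isotropic_w`,
  and the top-level `weightedRadialIsotropicPosition` (PROVED; no named fact); `exists_isotropic_submodule`
  is the same inside a subspace `V ≤ ℝ^k` (coordinates by any basis), the form used piecewise by the
  peel / Forster decomposition; `mass_le_of_isotropic` / `subspaceMass_le_of_isotropicPosition` give the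
  converse (the non-strict subspace-mass inequality is necessary; HKLM Lemma 4.19).

The per-part documentation below is copied from the source files.

## References
* [Forster2002] J. Forster, *A linear lower bound on the unbounded error probabilistic communication
  complexity*, JCSS 65 (2002) 612–625, Lemma 2.1, Thm 2.2, Thm 4.1.
* [DiakonikolasKaneTzamos2021] I. Diakonikolas, D. M. Kane, C. Tzamos, *Forster decomposition and
  learning halfspaces with noise*, NeurIPS 2021, arXiv:2107.05582, Definition 1.3, Theorem 2.1 (p. 7).
* [HopkinsEtAl2020] M. Hopkins, D. Kane, S. Lovett, G. Mahajan, *Point location and active learning: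
  learning halfspaces almost optimally*, FOCS 2020, arXiv:2004.11380, Lemmas 4.18–4.19, Cor. 4.20
  (the `ε`-approximate forms and the source of Thm 2.1 of [DiakonikolasKaneTzamos2021]).
-/

noncomputable section

namespace Literature.Computability.Complexity

namespace Forster

open Finset Real Matrix

/-! ## Part 0 — the operator-norm lemma, the isotropic count, general-position perturbations

(Source file `Summits/QuantumAdvantage/QuantumAdvantage/Theorems/HankelLiftBeyondRectanglesForsterCore.lean`.)

# Forster's argument, elementary half: the operator-norm lemma, the isotropic count, and
# general-position perturbations

Route `route-QuantumAdvantage-HankelLift`; infrastructure for the sign-rank rung of the open crux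
`HankelLift.BeyondRectangles` (stmt-QuantumAdvantage-18440).  The rung
(`Theorems/HankelLiftBeyondRectanglesSignRank.lean`) is conditional on Forster's theorem
(`Literature.Computability.Complexity.ForsterHalfspaceBound`, J. Comput. System Sci. 65 (2002),
Thm 2.2).  This file PROVES the elementary half of Forster's proof, so that the named fact can be
reduced (in `…ForsterReduction.lean`) to its linear-algebra core, Forster's Theorem 4.1 (radial
isotropic position):

* `sq_sum_transpose_le` — from the bilinear bound `|aᵀ M b| ≤ B‖a‖‖b‖`: `‖Mᵀ a‖² ≤ B²‖a‖²`.
* `forster_lemma21` — Forster's Lemma 2.1 in coordinates: for vectors `u_x` and unit vectors `v_y`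
  realizing the sign pattern of a `±1` matrix `M` (`M_{xy}⟨u_x,v_y⟩ > 0`),
  `∑_y (∑_x |⟨u_x, v_y⟩|)² ≤ B² ∑_x ‖u_x‖²` (no positive-semidefiniteness needed: expand
  `‖∑_x M_{xy} u_x‖²` coordinatewise and use `sq_sum_transpose_le`).
* `forster_count` — if moreover the `u_x` are unit vectors in ISOTROPIC position
  (`∑_x ⟨u_x,w⟩² = (|X|/k)‖w‖²`, `k` = dimension) then `|X|·|Y| ≤ B²·k²`
  (Forster's inequality (1): `∑_x |⟨u_x,v_y⟩| ≥ ∑_x ⟨u_x,v_y⟩² = |X|/k`).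
* `exists_perturb_forall_notMem`, `exists_generalPosition` — any finite family of vectors in `ℝ^k`
  can be moved by at most `ε` in each coordinate into GENERAL POSITION (every subfamily of size
  `≤ k` linearly independent): one vector at a time, along a direction outside the finitely many
  spans to avoid (`Submodule.exists_forall_notMem_of_forall_ne_top`), at a step size avoiding the
  finitely many bad values.
[cite: Forster2002, Lemma 2.1 and proof of Theorem 2.2]
-/


/-! ## The operator-norm lemma and the count -/

/-- From the bilinear bound `|∑_{x,y} a_x M_{xy} b_y| ≤ B‖a‖₂‖b‖₂` (i.e. `‖M‖ ≤ B`):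
`∑_y (∑_x a_x M_{xy})² ≤ B² ∑_x a_x²`, i.e. `‖Mᵀa‖ ≤ B‖a‖`. [folklore] -/
private theorem sq_sum_transpose_le {X Y : Type*} [Fintype X] [Fintype Y] (M : X → Y → ℝ) {B : ℝ}
    (hB : ∀ (a : X → ℝ) (b : Y → ℝ),
      |∑ x, ∑ y, a x * M x y * b y| ≤ B * Real.sqrt (∑ x, a x ^ 2) * Real.sqrt (∑ y, b y ^ 2))
    (a : X → ℝ) : ∑ y, (∑ x, a x * M x y) ^ 2 ≤ B ^ 2 * ∑ x, a x ^ 2 := by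
  set c : Y → ℝ := fun y => ∑ x, a x * M x y with hc
  set S : ℝ := ∑ y, c y ^ 2 with hS
  set P : ℝ := ∑ x, a x ^ 2 with hP
  have hS0 : 0 ≤ S := Finset.sum_nonneg fun y _ => sq_nonneg _
  have hP0 : 0 ≤ P := Finset.sum_nonneg fun x _ => sq_nonneg _
  have hSc : S = ∑ x, ∑ y, a x * M x y * c y := by
    rw [Finset.sum_comm]
    refine Finset.sum_congr rfl fun y _ => ?_
    rw [sq, hc]
    simp only
    rw [Finset.sum_mul]
  have h1 : S ≤ B * Real.sqrt P * Real.sqrt S := by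
    have h := hB a c
    rw [← hSc] at h
    exact (le_abs_self S).trans h
  -- `S = √S · √S ≤ B √P √S` ⇒ `√S ≤ B √P` ⇒ `S ≤ B² P`
  rcases eq_or_lt_of_le hS0 with hS00 | hSpos
  · rw [← hS00]; positivity
  · have hsq : Real.sqrt S * Real.sqrt S = S := Real.mul_self_sqrt hS0
    have hsqpos : 0 < Real.sqrt S := Real.sqrt_pos.mpr hSpos
    have h2 : Real.sqrt S ≤ B * Real.sqrt P := by
      have h3 : Real.sqrt S * Real.sqrt S ≤ (B * Real.sqrt P) * Real.sqrt S := by rw [hsq]; exact h1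
      exact le_of_mul_le_mul_right h3 hsqpos
    calc S = Real.sqrt S ^ 2 := by rw [sq, hsq]
      _ ≤ (B * Real.sqrt P) ^ 2 := pow_le_pow_left₀ hsqpos.le h2 2
      _ = B ^ 2 * P := by rw [mul_pow, Real.sq_sqrt hP0]

/-- **Forster's Lemma 2.1 (coordinate form).**  Let `M` be a `±1` matrix on `X × Y` with the
bilinear bound `B`, `u_x ∈ ℝ^ι` arbitrary and `v_y ∈ ℝ^ι` UNIT vectors with `M_{xy}·⟨u_x, v_y⟩ > 0`.
Then `∑_y (∑_x |⟨u_x, v_y⟩|)² ≤ B²·∑_x ‖u_x‖²`.  Proof: `∑_x |⟨u_x,v_y⟩| = ⟨∑_x M_{xy}u_x, v_y⟩ ≤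
‖∑_x M_{xy} u_x‖`, and `∑_y ‖∑_x M_{xy}u_x‖² = ∑_l ‖Mᵀ u^{(l)}‖² ≤ B² ∑_l ‖u^{(l)}‖²`
(`sq_sum_transpose_le` on each coordinate slice `u^{(l)} = (u_x(l))_x`).
[cite: Forster2002, Lemma 2.1] -/
theorem forster_lemma21 {X Y ι : Type*} [Fintype X] [Fintype Y] [Fintype ι] (M : X → Y → ℝ)
    (u : X → ι → ℝ) (v : Y → ι → ℝ) {B : ℝ}
    (hM : ∀ x y, M x y = 1 ∨ M x y = -1)
    (hsign : ∀ x y, 0 < M x y * ∑ l, u x l * v y l)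
    (hB : ∀ (a : X → ℝ) (b : Y → ℝ),
      |∑ x, ∑ y, a x * M x y * b y| ≤ B * Real.sqrt (∑ x, a x ^ 2) * Real.sqrt (∑ y, b y ^ 2))
    (hv : ∀ y, ∑ l, v y l ^ 2 = 1) :
    ∑ y, (∑ x, |∑ l, u x l * v y l|) ^ 2 ≤ B ^ 2 * ∑ x, ∑ l, u x l ^ 2 := by
  -- `∑_x |⟨u_x,v_y⟩| = ∑_l (∑_x M_{xy} u_x(l)) v_y(l)`
  have habs : ∀ x y, |∑ l, u x l * v y l| = M x y * ∑ l, u x l * v y l := by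
    intro x y
    have hs := hsign x y
    rcases hM x y with h | h
    · rw [h, one_mul] at hs ⊢
      exact abs_of_pos hs
    · rw [h] at hs ⊢
      rw [abs_of_neg (by linarith), neg_one_mul]
  have hrow : ∀ y, ∑ x, |∑ l, u x l * v y l| = ∑ l, (∑ x, M x y * u x l) * v y l := by
    intro y
    rw [Finset.sum_congr rfl fun x _ => habs x y]
    simp_rw [Finset.mul_sum, Finset.sum_mul]
    rw [Finset.sum_comm]
    exact Finset.sum_congr rfl fun l _ => Finset.sum_congr rfl fun x _ => by ring
  -- Cauchy–Schwarz in `l` with `‖v_y‖ = 1`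
  have hcs : ∀ y, (∑ x, |∑ l, u x l * v y l|) ^ 2 ≤ ∑ l, (∑ x, M x y * u x l) ^ 2 := by
    intro y
    rw [hrow y]
    have h := Finset.sum_mul_sq_le_sq_mul_sq Finset.univ (fun l => ∑ x, M x y * u x l) (v y)
    rw [hv y, mul_one] at h
    exact h
  -- sum over `y`, swap, and bound each coordinate slice
  calc ∑ y, (∑ x, |∑ l, u x l * v y l|) ^ 2
      ≤ ∑ y, ∑ l, (∑ x, M x y * u x l) ^ 2 := Finset.sum_le_sum fun y _ => hcs y
    _ = ∑ l, ∑ y, (∑ x, u x l * M x y) ^ 2 := by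
        rw [Finset.sum_comm]
        exact Finset.sum_congr rfl fun l _ => Finset.sum_congr rfl fun y _ => by
          congr 1; exact Finset.sum_congr rfl fun x _ => mul_comm _ _
    _ ≤ ∑ l, B ^ 2 * ∑ x, u x l ^ 2 :=
        Finset.sum_le_sum fun l _ => sq_sum_transpose_le M hB (fun x => u x l)
    _ = B ^ 2 * ∑ x, ∑ l, u x l ^ 2 := by rw [← Finset.mul_sum, Finset.sum_comm]

/-- **Forster's count** (the proof of his Theorem 2.2 after the reduction to isotropic position).
If `u_x, v_y ∈ ℝ^ι` are UNIT vectors realizing the `±1` matrix `M` (`M_{xy}⟨u_x,v_y⟩ > 0`), `M` has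
the bilinear bound `B`, and the `u_x` are in isotropic position `∑_x ⟨u_x, w⟩² = (|X|/|ι|)‖w‖²`
for all `w`, then `|X|·|Y| ≤ B²·|ι|²`: for each `y`, `|X|/|ι| = ∑_x ⟨u_x,v_y⟩² ≤ ∑_x |⟨u_x,v_y⟩|`
(as `|⟨u_x,v_y⟩| ≤ 1`), square, sum over `y`, and compare with `forster_lemma21`.
[cite: Forster2002, proof of Theorem 2.2] -/
theorem forster_count {X Y ι : Type*} [Fintype X] [Fintype Y] [Fintype ι] (M : X → Y → ℝ)
    (u : X → ι → ℝ) (v : Y → ι → ℝ) {B : ℝ}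
    (hM : ∀ x y, M x y = 1 ∨ M x y = -1)
    (hsign : ∀ x y, 0 < M x y * ∑ l, u x l * v y l)
    (hB : ∀ (a : X → ℝ) (b : Y → ℝ),
      |∑ x, ∑ y, a x * M x y * b y| ≤ B * Real.sqrt (∑ x, a x ^ 2) * Real.sqrt (∑ y, b y ^ 2))
    (hu : ∀ x, ∑ l, u x l ^ 2 = 1) (hv : ∀ y, ∑ l, v y l ^ 2 = 1)
    (hiso : ∀ w : ι → ℝ, ∑ x, (∑ l, u x l * w l) ^ 2 =
      (Fintype.card X : ℝ) / (Fintype.card ι : ℝ) * ∑ l, w l ^ 2) :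
    (Fintype.card X : ℝ) * (Fintype.card Y : ℝ) ≤ B ^ 2 * (Fintype.card ι : ℝ) ^ 2 := by
  set nX : ℝ := (Fintype.card X : ℝ) with hnX
  set k : ℝ := (Fintype.card ι : ℝ) with hk
  -- inequality (1): `|X|/k ≤ ∑_x |⟨u_x, v_y⟩|`
  have h1 : ∀ y, nX / k ≤ ∑ x, |∑ l, u x l * v y l| := by
    intro y
    have hsq : ∑ x, (∑ l, u x l * v y l) ^ 2 = nX / k := by rw [hiso (v y), hv y, mul_one]
    rw [← hsq]
    refine Finset.sum_le_sum fun x _ => ?_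
    -- `t² ≤ |t|` for `|t| ≤ 1`
    have ht : (∑ l, u x l * v y l) ^ 2 ≤ 1 := by
      have h := Finset.sum_mul_sq_le_sq_mul_sq Finset.univ (u x) (v y)
      rw [hu x, hv y, mul_one] at h
      exact h
    have habs : |∑ l, u x l * v y l| ≤ 1 := by
      rw [← sq_le_one_iff_abs_le_one]; exact ht
    calc (∑ l, u x l * v y l) ^ 2 = |∑ l, u x l * v y l| * |∑ l, u x l * v y l| := by
          rw [← sq_abs, sq]
      _ ≤ |∑ l, u x l * v y l| * 1 := mul_le_mul_of_nonneg_left habs (abs_nonneg _)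
      _ = |∑ l, u x l * v y l| := mul_one _
  have h2 := forster_lemma21 M u v hM hsign hB hv
  have hsumu : ∑ x, ∑ l, u x l ^ 2 = nX := by
    rw [Finset.sum_congr rfl fun x _ => hu x, Finset.sum_const, Finset.card_univ, nsmul_eq_mul,
      mul_one]
  rw [hsumu] at h2
  -- sum the squares of (1) over `y`
  have h3 : (Fintype.card Y : ℝ) * (nX / k) ^ 2 ≤ ∑ y, (∑ x, |∑ l, u x l * v y l|) ^ 2 := by
    calc (Fintype.card Y : ℝ) * (nX / k) ^ 2 = ∑ _y : Y, (nX / k) ^ 2 := by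
          rw [Finset.sum_const, Finset.card_univ, nsmul_eq_mul]
      _ ≤ ∑ y, (∑ x, |∑ l, u x l * v y l|) ^ 2 :=
          Finset.sum_le_sum fun y _ => pow_le_pow_left₀ (by positivity) (h1 y) 2
  have h4 : (Fintype.card Y : ℝ) * (nX / k) ^ 2 ≤ B ^ 2 * nX := h3.trans h2
  -- `|Y| nX²/k² ≤ B² nX` ⇒ `nX |Y| ≤ B² k²`
  rcases Nat.eq_zero_or_pos (Fintype.card X) with hX0 | hXpos
  · have : nX = 0 := by rw [hnX, hX0]; simp
    rw [this, zero_mul]; positivity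
  rcases Nat.eq_zero_or_pos (Fintype.card ι) with hι0 | hιpos
  · -- `ι` empty: all inner products vanish, contradicting `hsign` (X, Y nonempty or not)
    rcases isEmpty_or_nonempty Y with hY | hY
    · have : (Fintype.card Y : ℝ) = 0 := by simp
      rw [this, mul_zero]; positivity
    · obtain ⟨y⟩ := hY
      obtain ⟨x⟩ := Fintype.card_pos_iff.mp hXpos
      have hι : IsEmpty ι := Fintype.card_eq_zero_iff.mp hι0
      have := hsign x y
      simp at this
  have hkpos : 0 < k := by rw [hk]; exact_mod_cast hιpos
  have hnXpos : 0 < nX := by rw [hnX]; exact_mod_cast hXpos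
  have h5 : (Fintype.card Y : ℝ) * nX ^ 2 ≤ B ^ 2 * nX * k ^ 2 := by
    have := mul_le_mul_of_nonneg_right h4 (sq_nonneg k)
    rwa [mul_assoc, ← mul_pow, div_mul_cancel₀ _ hkpos.ne'] at this
  nlinarith [h5, hnXpos]

/-! ## General position by small perturbations -/

/-- **Avoiding finitely many proper subspaces near a point.**  Given finitely many proper
submodules `W_j` of `ℝ^k`, a point `z₀` and `ε > 0`, there is `z` with `|z_l − (z₀)_l| ≤ ε` for
all coordinates `l` and `z ∉ W_j` for all `j`: move from `z₀` along a direction `d ∉ ⋃ W_j`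
(`Submodule.exists_forall_notMem_of_forall_ne_top`); for each `j` at most one step size is bad.
[folklore] -/
private theorem exists_perturb_forall_notMem {k : ℕ} {J : Type*} [Finite J]
    (W : J → Submodule ℝ (Fin k → ℝ)) (hW : ∀ j, W j ≠ ⊤) (z₀ : Fin k → ℝ) {ε : ℝ} (hε : 0 < ε) :
    ∃ z : Fin k → ℝ, (∀ l, |z l - z₀ l| ≤ ε) ∧ ∀ j, z ∉ W j := by
  classical
  obtain ⟨d, hd⟩ := Submodule.exists_forall_notMem_of_forall_ne_top W hW
  -- size of the direction
  set D : ℝ := ∑ l, |d l| with hD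
  have hD0 : 0 ≤ D := Finset.sum_nonneg fun l _ => abs_nonneg _
  have hdl : ∀ l, |d l| ≤ D := fun l =>
    Finset.single_le_sum (f := fun l => |d l|) (fun l _ => abs_nonneg _) (Finset.mem_univ l)
  -- for each `j`, the set of bad step sizes is a subsingleton
  have hbad : ∀ j, ({s : ℝ | z₀ + s • d ∈ W j}).Subsingleton := by
    intro j s hs s' hs'
    by_contra hne
    apply hd j
    have hsub : (s - s') • d ∈ W j := by
      have := (W j).sub_mem hs hs'
      rwa [add_sub_add_left_eq_sub, ← sub_smul] at this
    exact ((W j).smul_mem_iff (sub_ne_zero.mpr hne)).mp hsub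
  have hfin : (⋃ j, {s : ℝ | z₀ + s • d ∈ W j}).Finite :=
    Set.finite_iUnion fun j => (hbad j).finite
  -- pick a good step size in `(0, ε/(D+1))`
  have hint : (Set.Ioo (0 : ℝ) (ε / (D + 1))).Infinite := Set.Ioo_infinite (by positivity)
  obtain ⟨s, hs, hsbad⟩ := (hint.sdiff hfin).nonempty
  rw [Set.mem_Ioo] at hs
  refine ⟨z₀ + s • d, fun l => ?_, fun j hj => hsbad (Set.mem_iUnion.mpr ⟨j, hj⟩)⟩
  simp only [Pi.add_apply, Pi.smul_apply, smul_eq_mul, add_sub_cancel_left, abs_mul,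
    abs_of_pos hs.1]
  calc s * |d l| ≤ ε / (D + 1) * D := mul_le_mul hs.2.le (hdl l) (abs_nonneg _) (by positivity)
    _ ≤ ε := by
        rw [div_mul_eq_mul_div, div_le_iff₀ (by positivity)]
        nlinarith

/-- **General position by an `ε`-perturbation.**  Every finite family `u : X → ℝ^k` can be moved
by at most `ε` in each coordinate to a family `u'` in GENERAL POSITION: `u'` is linearly
independent on every set of at most `k` indices.  Induction on the set of indices already treated:
the next vector is re-chosen near its ORIGINAL value outside the spans of all sub-families of size
`< k` of the treated ones (`exists_perturb_forall_notMem`; those spans are proper, having dimension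
`< k`), and `linearIndepOn_insert`. [folklore] -/
private theorem exists_generalPosition {X : Type*} [Fintype X] [DecidableEq X] {k : ℕ}
    (u : X → Fin k → ℝ) {ε : ℝ} (hε : 0 < ε) :
    ∃ u' : X → Fin k → ℝ, (∀ x l, |u' x l - u x l| ≤ ε) ∧
      ∀ S : Finset X, S.card ≤ k → LinearIndepOn ℝ u' (S : Set X) := by
  classical
  -- claim for the indices in `T`
  suffices h : ∀ T : Finset X, ∃ u' : X → Fin k → ℝ, (∀ x l, |u' x l - u x l| ≤ ε) ∧
      ∀ S : Finset X, S ⊆ T → S.card ≤ k → LinearIndepOn ℝ u' (S : Set X) by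
    obtain ⟨u', hu', hli⟩ := h Finset.univ
    exact ⟨u', hu', fun S hS => hli S (Finset.subset_univ S) hS⟩
  intro T
  induction T using Finset.induction_on with
  | empty =>
    refine ⟨u, fun x l => by simp [hε.le], fun S hS _ => ?_⟩
    rw [Finset.subset_empty] at hS
    subst hS
    rw [Finset.coe_empty]
    exact linearIndepOn_empty ℝ u
  | insert a T haT ih =>
    obtain ⟨u', hu', hli⟩ := ih
    -- the spans to avoid: sub-families of `T` of size `< k`
    let J := {S₀ : Finset X // S₀ ⊆ T ∧ S₀.card < k}
    let W : J → Submodule ℝ (Fin k → ℝ) := fun S₀ =>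
      Submodule.span ℝ ((S₀.1.image u' : Finset (Fin k → ℝ)) : Set (Fin k → ℝ))
    have hW : ∀ j : J, W j ≠ ⊤ := by
      intro j htop
      have hdim : Module.finrank ℝ (W j) ≤ j.1.card :=
        (finrank_span_finset_le_card (R := ℝ) (j.1.image u')).trans Finset.card_image_le
      have htop' : Module.finrank ℝ (W j) = k := by
        rw [htop, finrank_top, Module.finrank_fin_fun]
      rw [htop'] at hdim
      exact absurd j.2.2 (not_lt.mpr hdim)
    obtain ⟨z, hz, hzW⟩ := exists_perturb_forall_notMem W hW (u a) hε
    refine ⟨Function.update u' a z, fun x l => ?_, fun S hS hSk => ?_⟩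
    · by_cases hxa : x = a
      · subst hxa; rw [Function.update_self]; exact hz l
      · rw [Function.update_of_ne hxa]; exact hu' x l
    · -- the updated family agrees with `u'` off `a`
      have heqOn : ∀ S₀ : Finset X, a ∉ S₀ →
          Set.EqOn u' (Function.update u' a z) (S₀ : Set X) := by
        intro S₀ ha x hx
        rw [Function.update_of_ne]
        exact fun hxa => ha (hxa ▸ (Finset.mem_coe.mp hx))
      by_cases haS : a ∈ S
      · -- `S = insert a S₀`
        set S₀ := S.erase a with hS₀
        have hS₀T : S₀ ⊆ T := by
          intro x hx
          have hx' := Finset.mem_erase.mp hx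
          exact (Finset.mem_insert.mp (hS hx'.2)).resolve_left hx'.1
        have hS₀k : S₀.card < k := by
          have hpos := Finset.card_pos.mpr ⟨a, haS⟩
          rw [hS₀, Finset.card_erase_of_mem haS]; omega
        have haS₀ : a ∉ S₀ := Finset.notMem_erase a S
        rw [← Finset.insert_erase haS, Finset.coe_insert,
          linearIndepOn_insert (fun h => haS₀ (Finset.mem_coe.mp h))]
        refine ⟨(hli S₀ hS₀T hS₀k.le).congr (heqOn S₀ haS₀), ?_⟩
        rw [Function.update_self]
        have himg : Function.update u' a z '' (S₀ : Set X) = u' '' (S₀ : Set X) :=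
          (Set.EqOn.image_eq (heqOn S₀ haS₀)).symm
        rw [himg, ← Finset.coe_image]
        exact hzW ⟨S₀, hS₀T, hS₀k⟩
      · -- `S ⊆ T`
        have hST : S ⊆ T := fun x hx => (Finset.mem_insert.mp (hS hx)).resolve_left
          (fun hxa => haS (hxa ▸ hx))
        exact (hli S hST hSk).congr (heqOn S haS)


/-! ## Part IIa — spectral expansion of `AᵀA`

(Source file `Summits/QuantumAdvantage/QuantumAdvantage/Theorems/HankelLiftBeyondRectanglesForsterSpectral.lean`.)

# Forster's Theorem 4.1, part IIa: spectral expansion of `AᵀA`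

Route `route-QuantumAdvantage-HankelLift`; infrastructure toward discharging the named fact
`Literature.Computability.Complexity.ForsterIsotropicPosition` (Forster 2002, Thm 4.1).

This file: the spectral expansion of `AᵀA` in plain coordinates (`spectral_data`: reals `λ_j ≥ 0`
and an orthonormal basis `e_j` with `‖Au‖² = ∑_j λ_j ⟨e_j,u⟩²`, `‖u‖² = ∑_j ⟨e_j,u⟩²`,
`∑λ_j = ∑A_{ij}²`, `∏λ_j = det(A)²`), from `Matrix.IsHermitian.spectral_theorem` through the
orthogonal matrix `eigenvectorUnitary`.  Consumer: `…ForsterCoercive.lean` (coercivity of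
`Φ(A) = ∑_x log ‖A u_x‖² − (|X|/k)·log (det A)²` on the unit Frobenius sphere).
[cite: Forster2002, Theorem 4.1]
-/


/-! ## Spectral expansion of `AᵀA` -/

/-- **Spectral data of `AᵀA`** (real spectral theorem, `Matrix.IsHermitian.spectral_theorem`): there
are reals `λ_j ≥ 0` and an orthonormal basis `e_j` of `ℝ^k` with `‖Au‖² = ∑_j λ_j ⟨e_j, u⟩²`,
`‖u‖² = ∑_j ⟨e_j,u⟩²`, `∑_j λ_j = ∑_{ij} A_{ij}²` and `∏_j λ_j = (det A)²`. [folklore] -/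
private theorem spectral_data {k : ℕ} (A : Matrix (Fin k) (Fin k) ℝ) :
    ∃ (lam : Fin k → ℝ) (e : Fin k → Fin k → ℝ),
      (∀ i j, e i ⬝ᵥ e j = if i = j then 1 else 0) ∧
      (∀ u : Fin k → ℝ, (A *ᵥ u) ⬝ᵥ (A *ᵥ u) = ∑ j, lam j * (e j ⬝ᵥ u) ^ 2) ∧
      (∀ u : Fin k → ℝ, u ⬝ᵥ u = ∑ j, (e j ⬝ᵥ u) ^ 2) ∧
      (∑ j, lam j = ∑ i, ∑ j, A i j ^ 2) ∧
      (∏ j, lam j = A.det ^ 2) ∧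
      (∀ j, 0 ≤ lam j) := by
  classical
  set B : Matrix (Fin k) (Fin k) ℝ := Aᵀ * A with hBdef
  have hB : B.IsHermitian := by
    have h := Matrix.isHermitian_conjTranspose_mul_self A
    rwa [Matrix.conjTranspose_eq_transpose_of_trivial] at h
  set U : Matrix (Fin k) (Fin k) ℝ := (hB.eigenvectorUnitary : Matrix (Fin k) (Fin k) ℝ) with hUdef
  set lam : Fin k → ℝ := hB.eigenvalues with hlam
  have hstar : star U = Uᵀ := by
    rw [Matrix.star_eq_conjTranspose, Matrix.conjTranspose_eq_transpose_of_trivial]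
  have hUtU : Uᵀ * U = 1 := by
    have h := Unitary.coe_star_mul_self hB.eigenvectorUnitary
    rwa [hstar] at h
  have hUUt : U * Uᵀ = 1 := by
    have h := Unitary.coe_mul_star_self hB.eigenvectorUnitary
    rwa [Unitary.coe_star, hstar] at h
  have hspec : B = U * Matrix.diagonal lam * Uᵀ := by
    have h := hB.spectral_theorem
    rw [Unitary.conjStarAlgAut_apply, hstar] at h
    rw [h]
    congr 2
  have hc : ∀ (v : Fin k → ℝ) (j : Fin k), (Uᵀ *ᵥ v) j = Uᵀ j ⬝ᵥ v := fun v j => rfl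
  have hquad : ∀ v : Fin k → ℝ, (A *ᵥ v) ⬝ᵥ (A *ᵥ v) = ∑ j, lam j * (Uᵀ j ⬝ᵥ v) ^ 2 := by
    intro v
    have h1 : (A *ᵥ v) ⬝ᵥ (A *ᵥ v) = v ⬝ᵥ (B *ᵥ v) := by
      rw [hBdef, ← Matrix.mulVec_mulVec, Matrix.dotProduct_mulVec v Aᵀ (A *ᵥ v),
        Matrix.vecMul_transpose]
    rw [h1, hspec, ← Matrix.mulVec_mulVec, ← Matrix.mulVec_mulVec, Matrix.dotProduct_mulVec v U,
      ← Matrix.mulVec_transpose, dotProduct]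
    refine Finset.sum_congr rfl fun j _ => ?_
    rw [Matrix.mulVec_diagonal, hc, sq]
    ring
  refine ⟨lam, fun j => Uᵀ j, fun i j => ?_, hquad, fun u => ?_, ?_, ?_, ?_⟩
  · -- orthonormality
    have h := congrFun (congrFun hUtU i) j
    rw [Matrix.mul_apply, Matrix.one_apply] at h
    rw [← h]
    rfl
  · -- Parseval
    have h0 : u ⬝ᵥ u = u ⬝ᵥ ((U * Uᵀ) *ᵥ u) := by rw [hUUt, Matrix.one_mulVec]
    rw [h0, ← Matrix.mulVec_mulVec, Matrix.dotProduct_mulVec u U, ← Matrix.mulVec_transpose,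
      dotProduct]
    refine Finset.sum_congr rfl fun j _ => ?_
    rw [hc, sq]
  · -- trace
    have h := hB.trace_eq_sum_eigenvalues
    simp only [RCLike.ofReal_real_eq_id, id_eq] at h
    rw [← hlam] at h
    rw [← h, hBdef, Matrix.trace]
    simp only [Matrix.diag_apply, Matrix.mul_apply, Matrix.transpose_apply]
    rw [Finset.sum_comm]
    exact Finset.sum_congr rfl fun i _ => Finset.sum_congr rfl fun j _ => by ring
  · -- determinant
    have h := hB.det_eq_prod_eigenvalues
    simp only [RCLike.ofReal_real_eq_id, id_eq] at h
    rw [← hlam] at h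
    rw [← h, hBdef, Matrix.det_mul, Matrix.det_transpose, sq]
  · -- nonnegativity: `λ_j = ‖A e_j‖²`
    intro j
    have horth : ∀ i, Uᵀ i ⬝ᵥ Uᵀ j = if i = j then 1 else 0 := by
      intro i
      have h := congrFun (congrFun hUtU i) j
      rw [Matrix.mul_apply, Matrix.one_apply] at h
      rw [← h]; rfl
    have hexp : (A *ᵥ Uᵀ j) ⬝ᵥ (A *ᵥ Uᵀ j) = ∑ i, lam i * (Uᵀ i ⬝ᵥ Uᵀ j) ^ 2 := hquad (Uᵀ j)
    have hsum : ∑ i, lam i * (Uᵀ i ⬝ᵥ Uᵀ j) ^ 2 = lam j := by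
      rw [Finset.sum_eq_single j]
      · rw [horth j, if_pos rfl]; ring
      · intro i _ hij; rw [horth i, if_neg hij]; ring
      · intro h; exact absurd (Finset.mem_univ j) h
    rw [← hsum, ← hexp]
    exact Finset.sum_nonneg fun l _ => mul_self_nonneg _


/-! ## Part I — the first-order condition of the log-volume functional

(Source file `Summits/QuantumAdvantage/QuantumAdvantage/Theorems/HankelLiftBeyondRectanglesForsterOpt.lean`.)

# Forster's Theorem 4.1, part I: the first-order condition of the log-volume functional

Route `route-QuantumAdvantage-HankelLift`; infrastructure toward DISCHARGING the named fact
`Literature.Computability.Complexity.ForsterIsotropicPosition` (Forster 2002, Thm 4.1: radial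
isotropic position), on which the sign-rank rung of `HankelLift.BeyondRectangles`
(stmt-QuantumAdvantage-18440) now rests.

We use the variational route (not Forster's iteration): for a family `u : X → ℝ^k` and an
invertible `A`, let `Φ(A) = ∑_x log ‖A u_x‖² − (|X|/k)·log (det A)²` (scale invariant).  This file
proves the FIRST-ORDER CONDITION: if `A₀` minimizes `Φ` among invertible matrices then
`∑_x (A₀u_x)(A₀u_x)ᵀ/‖A₀u_x‖² = (|X|/k)·I`, i.e. `A₀` puts `u` in radial isotropic position
(`isotropic_of_isMinOn`).  Proof: perturb `A₀ ↦ (1 + t·E_{ij})A₀`; then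
`‖(1+tE_{ij})w‖² = ‖w‖² + 2t wᵢwⱼ + t²wⱼ²` and `det(1 + tE_{ij}) = 1 + δ_{ij}t + O(t²)`
(`Matrix.det_one_add_smul`), so `t ↦ Φ((1+tE_{ij})A₀)` is an explicit differentiable function
with a local minimum at `0`; its derivative `∑_x 2wᵢwⱼ/‖w‖² − (|X|/k)·2δ_{ij}` vanishes.
Also: the trivial case `|X| = k` of Theorem 4.1 (`exists_isotropic_of_basis`).
The existence of a minimizer (coercivity from general position) is part II.
[cite: Forster2002, Theorem 4.1]
-/


/-! ## From the matrix identity to the quadratic form -/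

/-- If `∑_x w_{x,i} w_{x,j}/‖w_x‖² = c·δ_{ij}` for all `i, j`, then `∑_x ⟨w_x, v⟩²/‖w_x‖² = c‖v‖²`
for all `v`. [folklore] -/
private theorem quadForm_of_entries {X : Type*} [Fintype X] {k : ℕ} (w : X → Fin k → ℝ) (c : ℝ)
    (h : ∀ i j : Fin k, ∑ x, w x i * w x j / (w x ⬝ᵥ w x) = c * (if i = j then 1 else 0))
    (v : Fin k → ℝ) : ∑ x, (w x ⬝ᵥ v) ^ 2 / (w x ⬝ᵥ w x) = c * (v ⬝ᵥ v) := by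
  have hexp : ∀ x, (w x ⬝ᵥ v) ^ 2 / (w x ⬝ᵥ w x) =
      ∑ i, ∑ j, v i * v j * (w x i * w x j / (w x ⬝ᵥ w x)) := by
    intro x
    rw [sq, dotProduct, Finset.sum_mul_sum, Finset.sum_div]
    refine Finset.sum_congr rfl fun i _ => ?_
    rw [Finset.sum_div]
    refine Finset.sum_congr rfl fun j _ => ?_
    ring
  rw [Finset.sum_congr rfl fun x _ => hexp x, Finset.sum_comm]
  rw [Finset.sum_congr rfl fun i _ => Finset.sum_comm]
  simp_rw [← Finset.mul_sum, h]
  rw [dotProduct, Finset.mul_sum]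
  refine Finset.sum_congr rfl fun i _ => ?_
  rw [Finset.sum_eq_single i]
  · simp; ring
  · intro j _ hji; simp [Ne.symm hji]
  · intro hi; exact absurd (Finset.mem_univ i) hi

/-! ## The trivial case `|X| = k` -/

/-- **Theorem 4.1 for `|X| = k`**: a linearly independent family of `k` vectors in `ℝ^k` is mapped by
a nonsingular matrix onto the standard basis, which is in radial isotropic position with constant
`1 = |X|/k`. [cite: Forster2002, Theorem 4.1 (case |X| = k)] -/
theorem exists_isotropic_of_basis {X : Type} [Fintype X] [DecidableEq X] {k : ℕ}
    (u : X → Fin k → ℝ) (hk : k = Fintype.card X)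
    (hli : LinearIndependent ℝ u) :
    ∃ A : Matrix (Fin k) (Fin k) ℝ, IsUnit A.det ∧ ∀ w : Fin k → ℝ,
      ∑ x, (A *ᵥ u x ⬝ᵥ w) ^ 2 / (A *ᵥ u x ⬝ᵥ A *ᵥ u x) =
        (Fintype.card X : ℝ) / k * (w ⬝ᵥ w) := by
  classical
  -- index `X` by `Fin k`
  let e : X ≃ Fin k := (Fintype.equivFinOfCardEq hk.symm)
  -- the matrix `U` with columns `u (e.symm j)`
  let U : Matrix (Fin k) (Fin k) ℝ := Matrix.of fun i j => u (e.symm j) i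
  have hUcol : ∀ j, U *ᵥ Pi.single j 1 = u (e.symm j) := by
    intro j; ext i; rw [Matrix.mulVec_single_one]; rfl
  -- `U` is invertible: its columns are linearly independent
  have hUdet : IsUnit U.det := by
    rw [← Matrix.isUnit_iff_isUnit_det]
    rw [← Matrix.mulVec_injective_iff_isUnit]
    -- injectivity of `U *ᵥ ·` from linear independence of the columns
    intro a b hab
    have hlin : ∀ c : Fin k → ℝ, U *ᵥ c = ∑ j, c j • u (e.symm j) := by
      intro c
      have : c = ∑ j, c j • (Pi.single j (1 : ℝ) : Fin k → ℝ) := by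
        ext i; simp [Finset.sum_apply, Pi.single_apply]
      conv_lhs => rw [this]
      rw [Matrix.mulVec_sum]
      refine Finset.sum_congr rfl fun j _ => ?_
      rw [Matrix.mulVec_smul, hUcol]
    have hli' : LinearIndependent ℝ (fun j : Fin k => u (e.symm j)) :=
      (linearIndependent_equiv e.symm).mpr hli
    have h0 : ∑ j, (a j - b j) • u (e.symm j) = 0 := by
      simp only [sub_smul, Finset.sum_sub_distrib, ← hlin, hab, sub_self]
    have := Fintype.linearIndependent_iff.mp hli' (fun j => a j - b j) h0
    ext j; exact sub_eq_zero.mp (this j)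
  refine ⟨U⁻¹, ?_, fun w => ?_⟩
  · rw [Matrix.det_nonsing_inv]; exact hUdet.ringInverse
  -- `U⁻¹ u_x = e_{e x}`
  have hAu : ∀ x, U⁻¹ *ᵥ u x = Pi.single (e x) 1 := by
    intro x
    have h := hUcol (e x)
    rw [Equiv.symm_apply_apply] at h
    rw [← h, Matrix.mulVec_mulVec, Matrix.nonsing_inv_mul U hUdet, Matrix.one_mulVec]
  simp_rw [hAu]
  have hss : ∀ x, (Pi.single (e x) (1 : ℝ) : Fin k → ℝ) ⬝ᵥ Pi.single (e x) 1 = 1 := by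
    intro x; simp
  have hsw : ∀ x, (Pi.single (e x) (1 : ℝ) : Fin k → ℝ) ⬝ᵥ w = w (e x) := by
    intro x; simp
  simp_rw [hss, hsw, div_one]
  rcases Nat.eq_zero_or_pos (Fintype.card X) with h0 | hpos
  · haveI : IsEmpty X := Fintype.card_eq_zero_iff.mp h0
    simp
  · rw [← hk, div_self (by rw [hk]; exact_mod_cast hpos.ne'), one_mul, dotProduct,
      ← Equiv.sum_comp e (fun i => w i * w i)]
    exact Finset.sum_congr rfl fun x _ => by ring

/-! ## The first-order condition -/

/-- Coordinates of `(1 + t·E_{ij}) w`: `w + t·w_j·e_i`. [folklore] -/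
private theorem one_add_smul_single_mulVec {k : ℕ} (i j : Fin k) (t : ℝ) (w : Fin k → ℝ) :
    (1 + t • Matrix.single i j (1 : ℝ)) *ᵥ w = w + t • Pi.single i (w j) := by
  rw [Matrix.add_mulVec, Matrix.one_mulVec, Matrix.smul_mulVec, Matrix.single_mulVec, one_mul]
  rfl

/-- `‖w + t·w_j·e_i‖² = ‖w‖² + 2t·w_i w_j + t²·w_j²`. [folklore] -/
private theorem dotProduct_self_perturb {k : ℕ} (i j : Fin k) (t : ℝ) (w : Fin k → ℝ) :
    (w + t • Pi.single i (w j)) ⬝ᵥ (w + t • Pi.single i (w j)) =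
      w ⬝ᵥ w + 2 * t * (w i * w j) + t ^ 2 * w j ^ 2 := by
  rw [add_dotProduct, dotProduct_add, dotProduct_add, dotProduct_smul, smul_dotProduct,
    smul_dotProduct, dotProduct_smul, dotProduct_single, single_dotProduct, single_dotProduct]
  simp only [smul_eq_mul, Pi.single_eq_same]
  ring

/-- The determinant of `1 + t·E_{ij}` is `1 + δ_{ij} t + c(t)·t²` for a fixed real polynomial `c`
(`Matrix.det_one_add_smul`). [folklore] -/
private theorem det_one_add_smul_single {k : ℕ} (i j : Fin k) :
    ∃ c : Polynomial ℝ, ∀ t : ℝ, (1 + t • Matrix.single i j (1 : ℝ)).det =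
      1 + (if i = j then 1 else 0) * t + c.eval t * t ^ 2 := by
  refine ⟨(Matrix.det (1 + (Polynomial.X : Polynomial ℝ) •
    (Matrix.single i j (1 : ℝ)).map Polynomial.C)).divX.divX, fun t => ?_⟩
  rw [Matrix.det_one_add_smul]
  congr 2
  by_cases h : i = j
  · subst h; rw [Matrix.trace_single_eq_same, if_pos rfl]
  · rw [Matrix.trace_single_eq_of_ne i j (1 : ℝ) h, if_neg h]

/-- **First-order condition (Forster's Theorem 4.1 at a minimizer).**  Let `u : X → ℝ^k`, and let
the invertible `A₀` minimize `Φ(A) = ∑_x log ‖A u_x‖² − (|X|/k) log (det A)²` over all invertible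
`A`, with all `A₀ u_x ≠ 0`.  Then `∑_x ⟨A₀u_x, w⟩²/‖A₀u_x‖² = (|X|/k)‖w‖²` for every `w`.
[cite: Forster2002, Theorem 4.1] -/
theorem isotropic_of_isMinOn {X : Type*} [Fintype X] {k : ℕ} (u : X → Fin k → ℝ)
    (A₀ : Matrix (Fin k) (Fin k) ℝ) (hA₀ : IsUnit A₀.det) (hne : ∀ x, A₀ *ᵥ u x ≠ 0)
    (hmin : ∀ A : Matrix (Fin k) (Fin k) ℝ, IsUnit A.det →
      ∑ x, Real.log (A₀ *ᵥ u x ⬝ᵥ A₀ *ᵥ u x) -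
          (Fintype.card X : ℝ) / k * Real.log (A₀.det ^ 2) ≤
        ∑ x, Real.log (A *ᵥ u x ⬝ᵥ A *ᵥ u x) - (Fintype.card X : ℝ) / k * Real.log (A.det ^ 2)) :
    ∀ w : Fin k → ℝ, ∑ x, (A₀ *ᵥ u x ⬝ᵥ w) ^ 2 / (A₀ *ᵥ u x ⬝ᵥ A₀ *ᵥ u x) =
      (Fintype.card X : ℝ) / k * (w ⬝ᵥ w) := by
  set W : X → Fin k → ℝ := fun x => A₀ *ᵥ u x with hWdef
  set nX : ℝ := (Fintype.card X : ℝ) / k with hnX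
  have hWpos : ∀ x, 0 < W x ⬝ᵥ W x := fun x =>
    lt_of_le_of_ne (Finset.sum_nonneg fun l _ => mul_self_nonneg _)
      (fun h => hne x (dotProduct_self_eq_zero.mp h.symm))
  have hd0 : A₀.det ≠ 0 := hA₀.ne_zero
  refine quadForm_of_entries W nX (fun i j => ?_)
  -- the one-parameter family `t ↦ (1 + t E_{ij}) A₀`
  obtain ⟨c, hc⟩ := det_one_add_smul_single i j
  set δ : ℝ := if i = j then 1 else 0 with hδ
  set P : ℝ → ℝ := fun t => 1 + δ * t + c.eval t * t ^ 2 with hPdef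
  have hP0 : P 0 = 1 := by simp [hPdef]
  -- the explicit function
  set f : ℝ → ℝ := fun t => ∑ x, Real.log (W x ⬝ᵥ W x + 2 * t * (W x i * W x j) + t ^ 2 * W x j ^ 2)
    - nX * Real.log ((P t * A₀.det) ^ 2) with hfdef
  -- `f t = Φ((1 + tE) A₀)` and `f 0 = Φ(A₀)`
  have hft : ∀ t, f t = ∑ x, Real.log (((1 + t • Matrix.single i j (1 : ℝ)) * A₀) *ᵥ u x ⬝ᵥ
      ((1 + t • Matrix.single i j (1 : ℝ)) * A₀) *ᵥ u x) -
      nX * Real.log (((1 + t • Matrix.single i j (1 : ℝ)) * A₀).det ^ 2) := by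
    intro t
    simp only [hfdef]
    congr 1
    · refine Finset.sum_congr rfl fun x _ => ?_
      rw [← Matrix.mulVec_mulVec, one_add_smul_single_mulVec, dotProduct_self_perturb]
    · rw [Matrix.det_mul, hc t]
  have hf0 : f 0 = ∑ x, Real.log (W x ⬝ᵥ W x) - nX * Real.log (A₀.det ^ 2) := by
    simp [hfdef, hP0]
  -- local minimality at `0`
  have hPcont : Continuous P := by
    simp only [hPdef]
    exact (continuous_const.add (continuous_const.mul continuous_id)).add
      ((Polynomial.continuous c).mul (continuous_id.pow 2))
  have hPne : ∀ᶠ t in nhds (0 : ℝ), P t ≠ 0 := by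
    have hopen : IsOpen {t : ℝ | P t ≠ 0} := isOpen_ne_fun hPcont continuous_const
    exact hopen.mem_nhds (by simp [hP0])
  have hlocal : IsLocalMin f 0 := by
    filter_upwards [hPne] with t ht
    rw [hf0, hft t]
    have hunit : IsUnit ((1 + t • Matrix.single i j (1 : ℝ)) * A₀).det := by
      rw [Matrix.det_mul, hc t]
      exact (isUnit_iff_ne_zero.mpr ht).mul hA₀
    exact hmin _ hunit
  -- the derivative at `0`
  have hderiv : HasDerivAt f (∑ x, 2 * (W x i * W x j) / (W x ⬝ᵥ W x) - nX * (2 * δ)) 0 := by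
    have hq : ∀ x, HasDerivAt (fun t => W x ⬝ᵥ W x + 2 * t * (W x i * W x j) + t ^ 2 * W x j ^ 2)
        (2 * (W x i * W x j)) 0 := by
      intro x
      have h1 : HasDerivAt (fun t : ℝ => 2 * t * (W x i * W x j)) (2 * 1 * (W x i * W x j)) 0 :=
        ((hasDerivAt_id (0 : ℝ)).const_mul 2).mul_const _
      have h2 : HasDerivAt (fun t : ℝ => t ^ 2 * W x j ^ 2) (((2 : ℕ) : ℝ) * (0 : ℝ) ^ (2 - 1) * W x j ^ 2) 0 :=
        (hasDerivAt_pow 2 (0 : ℝ)).mul_const _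
      exact (((hasDerivAt_const (0 : ℝ) (W x ⬝ᵥ W x)).add h1).add h2).congr_deriv (by simp)
    have hlogq : ∀ x, HasDerivAt
        (fun t => Real.log (W x ⬝ᵥ W x + 2 * t * (W x i * W x j) + t ^ 2 * W x j ^ 2))
        (2 * (W x i * W x j) / (W x ⬝ᵥ W x)) 0 := by
      intro x
      have h0 : W x ⬝ᵥ W x + 2 * 0 * (W x i * W x j) + 0 ^ 2 * W x j ^ 2 ≠ 0 := by
        have := (hWpos x).ne'
        simpa using this
      exact ((hq x).log h0).congr_deriv (by simp)
    have hsum := HasDerivAt.fun_sum (u := Finset.univ) fun x _ => hlogq x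
    have hPd : HasDerivAt P δ 0 := by
      have h1 : HasDerivAt (fun t : ℝ => 1 + δ * t) (δ * 1) 0 :=
        ((hasDerivAt_id (0 : ℝ)).const_mul δ).const_add 1
      have h2 : HasDerivAt (fun t : ℝ => c.eval t * t ^ 2)
          (c.derivative.eval 0 * (0 : ℝ) ^ 2 + c.eval 0 * (((2 : ℕ) : ℝ) * (0 : ℝ) ^ (2 - 1))) 0 :=
        (c.hasDerivAt 0).mul (hasDerivAt_pow 2 (0 : ℝ))
      exact (h1.add h2).congr_deriv (by simp)
    have hg : HasDerivAt (fun t => (P t * A₀.det) ^ 2) (((2 : ℕ) : ℝ) * (P 0 * A₀.det) ^ (2 - 1) *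
        (δ * A₀.det)) 0 := (hPd.mul_const A₀.det).pow 2
    have hlogg : HasDerivAt (fun t => Real.log ((P t * A₀.det) ^ 2)) (2 * δ) 0 := by
      have hne0 : (P 0 * A₀.det) ^ 2 ≠ 0 := by rw [hP0, one_mul]; exact pow_ne_zero 2 hd0
      refine (hg.log hne0).congr_deriv ?_
      rw [hP0, one_mul]
      field_simp
      ring
    exact hsum.fun_sub (hlogg.const_mul nX)
  -- conclude
  have hzero := hlocal.hasDerivAt_eq_zero hderiv
  have h2 : ∑ x, 2 * (W x i * W x j) / (W x ⬝ᵥ W x) = 2 * ∑ x, W x i * W x j / (W x ⬝ᵥ W x) := by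
    rw [Finset.mul_sum]
    exact Finset.sum_congr rfl fun x _ => by ring
  rw [h2] at hzero
  have : ∑ x, W x i * W x j / (W x ⬝ᵥ W x) = nX * δ := by linarith
  rw [this]


/-! ## Part IIb — coercivity of the log-volume functional

(Source file `Summits/QuantumAdvantage/QuantumAdvantage/Theorems/HankelLiftBeyondRectanglesForsterCoercive.lean`.)

# Forster's Theorem 4.1, part IIb: coercivity of the log-volume functional

Route `route-QuantumAdvantage-HankelLift`; infrastructure toward discharging the named fact
`Literature.Computability.Complexity.ForsterIsotropicPosition` (Forster 2002, Thm 4.1).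

For `Φ(A) = ∑_x log ‖A u_x‖² − (|X|/k)·log (det A)²` this file proves COERCIVITY on the unit
Frobenius sphere: if `u` is in quantitative general position with constant `δ₀` (for every
orthonormal basis `(e_j)` and nonempty `U ⊊ [k]`, at most `k − |U|` of the `u_x` have
`⟨e_i,u_x⟩² < δ₀` for all `i ∈ U`), then for every `A` with `∑ A_{ij}² = 1` and `det A ≠ 0`,
`Φ(A) ≥ |X| log δ₀ − ((|X|−k)/k) log k + ((|X|−k)/k²)·log(1/det(A)²)` (`coercive_bound`), so
`Φ → +∞` as `det A → 0` when `|X| > k`.  Ingredients: `spectral_data` (part IIa), for each `x` the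
largest eigenvalue whose eigenvector sees `u_x`, and the discrete layer-cake (Abel summation)
inequality `layer_cake` over the sorted eigenvalues (`Tuple.sort`).
[cite: Forster2002, Theorem 4.1 (Lemma 4.2, compactness)]
-/


/-! ## The layer-cake inequality -/

/-- A truncated sum over `range K` equals the sum over `range m` for `m ≤ K`. [folklore] -/
private theorem sum_range_ite_lt (K m : ℕ) (hm : m ≤ K) (g : ℕ → ℝ) :
    ∑ l ∈ Finset.range K, (if l < m then g l else 0) = ∑ l ∈ Finset.range m, g l := by
  rw [← Finset.sum_filter]
  congr 1
  ext l
  simp only [Finset.mem_filter, Finset.mem_range]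
  omega

/-- **Layer-cake (Abel summation) inequality.**  Let `λ : [k] → ℝ_{>0}`, `f : X → [k]` with
`|X| ≥ k ≥ 1`, such that for every threshold `t` whose upper set `U_t = {j : t ≤ λ_j}` is a
nonempty proper subset, at most `k − |U_t|` points `x` have `λ_{f(x)} < t`.  Then for all `j_M, j_m`:
`((|X|−k)/k)·(log λ_{j_M} − log λ_{j_m}) ≤ ∑_x log λ_{f(x)} − (|X|/k) ∑_j log λ_j`.
(Sort the `λ_j`; telescope `log` along the sorted order; compare the two counting functions level
by level.) [folklore] -/
private theorem layer_cake {X : Type*} [Fintype X] {k : ℕ} (hk : 1 ≤ k) (hn : k ≤ Fintype.card X)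
    (lam : Fin k → ℝ) (hpos : ∀ j, 0 < lam j) (f : X → Fin k)
    (hcount : ∀ t : ℝ, (Finset.univ.filter fun j => t ≤ lam j).Nonempty →
      (Finset.univ.filter fun j => t ≤ lam j).card < k →
      (Finset.univ.filter fun x => lam (f x) < t).card ≤
        k - (Finset.univ.filter fun j => t ≤ lam j).card)
    (jM jm : Fin k) :
    ((Fintype.card X : ℝ) - k) / k * (Real.log (lam jM) - Real.log (lam jm)) ≤
      ∑ x, Real.log (lam (f x)) - (Fintype.card X : ℝ) / k * ∑ j, Real.log (lam j) := by
  classical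
  set n : ℕ := Fintype.card X with hndef
  -- sort the eigenvalues
  set σ : Equiv.Perm (Fin k) := Tuple.sort lam with hσ
  have hmono : Monotone (lam ∘ σ) := Tuple.monotone_sort lam
  -- positions as naturals, values by position
  let idx : ℕ → Fin k := fun m => ⟨min m (k - 1), by omega⟩
  have hidx : ∀ m, m < k → (idx m : ℕ) = m := fun m hm => by simp [idx]; omega
  have hidx_mono : Monotone idx := fun a b hab => by
    show min a (k - 1) ≤ min b (k - 1)
    exact min_le_min_right _ hab
  let ν : ℕ → ℝ := fun m => Real.log (lam (σ (idx m)))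
  have hνmono : Monotone ν := fun a b hab =>
    Real.log_le_log (hpos _) (hmono (hidx_mono hab))
  set g : ℕ → ℝ := fun l => ν (l + 1) - ν l with hgdef
  have hg0 : ∀ l, 0 ≤ g l := fun l => sub_nonneg.mpr (hνmono (Nat.le_succ l))
  let p : X → ℕ := fun x => (σ.symm (f x) : ℕ)
  have hplt : ∀ x, p x < k := fun x => (σ.symm (f x)).isLt
  have hidxp : ∀ x, idx (p x) = σ.symm (f x) := fun x => Fin.ext (hidx _ (hplt x))
  have hνp : ∀ x, ν (p x) = Real.log (lam (f x)) := by
    intro x; simp only [ν, hidxp, Equiv.apply_symm_apply]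
  -- telescoping
  have htel : ∀ m, ν m = ν 0 + ∑ l ∈ Finset.range m, g l := by
    intro m
    rw [Finset.sum_range_sub (f := ν), add_sub_cancel]
  have htel' : ∀ m, m ≤ k - 1 → ν m = ν 0 + ∑ l ∈ Finset.range (k - 1), (if l < m then g l else 0) := by
    intro m hm; rw [sum_range_ite_lt _ _ hm, htel m]
  -- the two sums, level by level
  have hA : ∑ x, Real.log (lam (f x)) = n * ν 0 +
      ∑ l ∈ Finset.range (k - 1), g l * ((Finset.univ.filter fun x => l < p x).card : ℝ) := by
    calc ∑ x, Real.log (lam (f x)) = ∑ x, ν (p x) := by simp_rw [hνp]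
      _ = ∑ x, (ν 0 + ∑ l ∈ Finset.range (k - 1), (if l < p x then g l else 0)) :=
          Finset.sum_congr rfl fun x _ => htel' (p x) (by have := hplt x; omega)
      _ = n * ν 0 + ∑ x, ∑ l ∈ Finset.range (k - 1), (if l < p x then g l else 0) := by
          rw [Finset.sum_add_distrib, Finset.sum_const, Finset.card_univ, nsmul_eq_mul]
      _ = n * ν 0 + ∑ l ∈ Finset.range (k - 1), g l *
            ((Finset.univ.filter fun x => l < p x).card : ℝ) := by
          congr 1
          rw [Finset.sum_comm]
          refine Finset.sum_congr rfl fun l _ => ?_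
          rw [← Finset.sum_filter, Finset.sum_const, nsmul_eq_mul, mul_comm]
  have hB : ∑ j, Real.log (lam j) = k * ν 0 +
      ∑ l ∈ Finset.range (k - 1), g l * ((k : ℝ) - 1 - l) := by
    have h1 : ∑ j, Real.log (lam j) = ∑ i : Fin k, ν i := by
      rw [← Equiv.sum_comp σ (fun j => Real.log (lam j))]
      refine Finset.sum_congr rfl fun i _ => ?_
      simp only [ν]
      exact congrArg (fun j => Real.log (lam (σ j))) (Fin.ext (hidx i i.isLt)).symm
    rw [h1, Fin.sum_univ_eq_sum_range (fun m => ν m) k]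
    calc ∑ m ∈ Finset.range k, ν m
        = ∑ m ∈ Finset.range k, (ν 0 + ∑ l ∈ Finset.range (k - 1), (if l < m then g l else 0)) :=
          Finset.sum_congr rfl fun m hm => htel' m (by have := Finset.mem_range.mp hm; omega)
      _ = k * ν 0 + ∑ m ∈ Finset.range k, ∑ l ∈ Finset.range (k - 1), (if l < m then g l else 0) := by
          rw [Finset.sum_add_distrib, Finset.sum_const, Finset.card_range, nsmul_eq_mul]
      _ = k * ν 0 + ∑ l ∈ Finset.range (k - 1), g l * ((k : ℝ) - 1 - l) := by
          congr 1
          rw [Finset.sum_comm]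
          refine Finset.sum_congr rfl fun l hl => ?_
          rw [← Finset.sum_filter, Finset.sum_const, nsmul_eq_mul, mul_comm]
          congr 1
          have hl' := Finset.mem_range.mp hl
          have : (Finset.range k).filter (fun m => l < m) = Finset.Ico (l + 1) k := by
            ext m; simp [Finset.mem_filter, Finset.mem_range, Finset.mem_Ico]; omega
          rw [this, Nat.card_Ico]
          have : l + 1 ≤ k := by omega
          rw [Nat.cast_sub this]
          push_cast
          ring
  -- the count at each level with a positive gap
  have hN : ∀ l, l < k - 1 → g l * ((n : ℝ) - l - 1) ≤
      g l * ((Finset.univ.filter fun x => l < p x).card : ℝ) := by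
    intro l hl
    rcases eq_or_lt_of_le (hg0 l) with h0 | hpos'
    · rw [← h0]; simp
    refine mul_le_mul_of_nonneg_left ?_ (hg0 l)
    -- threshold `t = λ_{σ(l+1)}`
    have hl1 : l + 1 < k := by omega
    set t : ℝ := lam (σ ⟨l + 1, hl1⟩) with ht
    have hgap : lam (σ ⟨l, by omega⟩) < t := by
      have : ν l < ν (l + 1) := by
        have := hpos'; simp only [hgdef] at this; linarith
      simp only [ν] at this
      have e1 : idx l = ⟨l, by omega⟩ := Fin.ext (hidx l (by omega))
      have e2 : idx (l + 1) = ⟨l + 1, hl1⟩ := Fin.ext (hidx (l + 1) hl1)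
      rw [e1, e2] at this
      exact (Real.log_lt_log_iff (hpos _) (hpos _)).mp this
    set Ut := Finset.univ.filter fun j => t ≤ lam j with hUt
    have hUt_ne : Ut.Nonempty := ⟨σ ⟨l + 1, hl1⟩, by simp [hUt, ht]⟩
    have hUt_lt : Ut.card < k := by
      have : σ ⟨l, by omega⟩ ∉ Ut := by simp [hUt, not_le.mpr hgap]
      calc Ut.card < (Finset.univ : Finset (Fin k)).card :=
            Finset.card_lt_card (Finset.ssubset_iff_subset_ne.mpr ⟨Finset.subset_univ _,
              fun h => this (h ▸ Finset.mem_univ _)⟩)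
        _ = k := by simp
    have hUt_ge : k - (l + 1) ≤ Ut.card := by
      -- `Ut ⊇ σ '' {m : l+1 ≤ m}`
      have hsub : (Finset.univ.filter fun m : Fin k => l + 1 ≤ (m : ℕ)).image σ ⊆ Ut := by
        intro j hj
        obtain ⟨m, hm, rfl⟩ := Finset.mem_image.mp hj
        simp only [Finset.mem_filter, Finset.mem_univ, true_and] at hm
        simp only [hUt, Finset.mem_filter, Finset.mem_univ, true_and, ht]
        exact hmono (show (⟨l + 1, hl1⟩ : Fin k) ≤ m from hm)
      calc k - (l + 1) = (Finset.Ici (⟨l + 1, hl1⟩ : Fin k)).card := by rw [Fin.card_Ici]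
        _ = ((Finset.univ.filter fun m : Fin k => l + 1 ≤ (m : ℕ))).card := by
            congr 1; ext m; simp [Finset.mem_Ici, Fin.le_def]
        _ = ((Finset.univ.filter fun m : Fin k => l + 1 ≤ (m : ℕ)).image σ).card :=
            (Finset.card_image_of_injective _ σ.injective).symm
        _ ≤ Ut.card := Finset.card_le_card hsub
    have hc := hcount t hUt_ne hUt_lt
    -- `{x : p x ≤ l} ⊆ {x : λ_{f x} < t}`
    have hsub2 : (Finset.univ.filter fun x => ¬ l < p x) ⊆
        (Finset.univ.filter fun x => lam (f x) < t) := by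
      intro x hx
      simp only [Finset.mem_filter, Finset.mem_univ, true_and, not_lt] at hx ⊢
      have h1 : lam (f x) = (lam ∘ σ) (σ.symm (f x)) := by simp
      rw [h1]
      calc (lam ∘ σ) (σ.symm (f x)) ≤ (lam ∘ σ) ⟨l, by omega⟩ := hmono (show _ ≤ _ from by
              change (σ.symm (f x) : ℕ) ≤ l; exact hx)
        _ < t := hgap
    have hcompl : ((Finset.univ.filter fun x => l < p x).card : ℝ) =
        n - ((Finset.univ.filter fun x => ¬ l < p x).card : ℝ) := by
      have := Finset.card_filter_add_card_filter_not (s := (Finset.univ : Finset X)) (fun x => l < p x)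
      rw [Finset.card_univ] at this
      have h' : ((Finset.univ.filter fun x => l < p x).card : ℝ) +
          ((Finset.univ.filter fun x => ¬ l < p x).card : ℝ) = n := by exact_mod_cast this
      linarith
    rw [hcompl]
    have h3 : ((Finset.univ.filter fun x => ¬ l < p x).card : ℝ) ≤ l + 1 := by
      have := (Finset.card_le_card hsub2).trans hc
      have h4 : (k - Ut.card : ℕ) ≤ l + 1 := by omega
      exact_mod_cast this.trans h4
    linarith
  -- assemble
  have hkpos : (0 : ℝ) < k := by exact_mod_cast hk
  have hnk : (0 : ℝ) ≤ ((n : ℝ) - k) / k := div_nonneg (by rw [sub_nonneg]; exact_mod_cast hn) hkpos.le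
  have hD : ∑ x, Real.log (lam (f x)) - (n : ℝ) / k * ∑ j, Real.log (lam j) =
      ∑ l ∈ Finset.range (k - 1), g l *
        (((Finset.univ.filter fun x => l < p x).card : ℝ) - (n : ℝ) / k * ((k : ℝ) - 1 - l)) := by
    rw [hA, hB, mul_add, Finset.mul_sum]
    have : (n : ℝ) / k * (k * ν 0) = n * ν 0 := by field_simp
    rw [this]
    rw [show (n : ℝ) * ν 0 + ∑ l ∈ Finset.range (k - 1), g l * ((Finset.univ.filter fun x => l < p x).card : ℝ) -
        ((n : ℝ) * ν 0 + ∑ l ∈ Finset.range (k - 1), (n : ℝ) / k * (g l * ((k : ℝ) - 1 - l))) =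
        ∑ l ∈ Finset.range (k - 1), g l * ((Finset.univ.filter fun x => l < p x).card : ℝ) -
        ∑ l ∈ Finset.range (k - 1), (n : ℝ) / k * (g l * ((k : ℝ) - 1 - l)) by ring]
    rw [← Finset.sum_sub_distrib]
    exact Finset.sum_congr rfl fun l _ => by ring
  have hlow : ∑ l ∈ Finset.range (k - 1), g l * (((n : ℝ) - k) / k) ≤
      ∑ l ∈ Finset.range (k - 1), g l *
        (((Finset.univ.filter fun x => l < p x).card : ℝ) - (n : ℝ) / k * ((k : ℝ) - 1 - l)) := by
    refine Finset.sum_le_sum fun l hl => ?_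
    have hl' : l < k - 1 := Finset.mem_range.mp hl
    have h1 := hN l hl'
    -- `g (n-l-1) - g (n/k)(k-1-l) = g (l+1)(n-k)/k ≥ g (n-k)/k`
    have hl1 : (1 : ℝ) ≤ l + 1 := by linarith [Nat.cast_nonneg (α := ℝ) l]
    have key : g l * (((n : ℝ) - k) / k) ≤ g l * (((n : ℝ) - l - 1) - (n : ℝ) / k * ((k : ℝ) - 1 - l)) := by
      have : ((n : ℝ) - l - 1) - (n : ℝ) / k * ((k : ℝ) - 1 - l) = ((l : ℝ) + 1) * (((n : ℝ) - k) / k) := by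
        field_simp; ring
      rw [this]
      calc g l * (((n : ℝ) - k) / k) = g l * (1 * (((n : ℝ) - k) / k)) := by ring
        _ ≤ g l * (((l : ℝ) + 1) * (((n : ℝ) - k) / k)) :=
            mul_le_mul_of_nonneg_left (mul_le_mul_of_nonneg_right hl1 hnk) (hg0 l)
    nlinarith [h1, hg0 l, hnk]
  have hsumg : ∑ l ∈ Finset.range (k - 1), g l = ν (k - 1) - ν 0 := Finset.sum_range_sub ν (k - 1)
  have hends : Real.log (lam jM) - Real.log (lam jm) ≤ ν (k - 1) - ν 0 := by
    have hM : Real.log (lam jM) ≤ ν (k - 1) := by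
      simp only [ν]
      refine Real.log_le_log (hpos _) ?_
      have : lam jM = (lam ∘ σ) (σ.symm jM) := by simp
      rw [this]
      exact hmono (show σ.symm jM ≤ idx (k - 1) from by
        change (σ.symm jM : ℕ) ≤ min (k - 1) (k - 1); have := (σ.symm jM).isLt; omega)
    have hm : ν 0 ≤ Real.log (lam jm) := by
      simp only [ν]
      refine Real.log_le_log (hpos _) ?_
      have : lam jm = (lam ∘ σ) (σ.symm jm) := by simp
      rw [this]
      exact hmono (show idx 0 ≤ σ.symm jm from by change min 0 (k - 1) ≤ (σ.symm jm : ℕ); omega)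
    linarith
  calc ((n : ℝ) - k) / k * (Real.log (lam jM) - Real.log (lam jm))
      ≤ ((n : ℝ) - k) / k * (ν (k - 1) - ν 0) := mul_le_mul_of_nonneg_left hends hnk
    _ = ∑ l ∈ Finset.range (k - 1), g l * (((n : ℝ) - k) / k) := by rw [← Finset.sum_mul, hsumg, mul_comm]
    _ ≤ _ := hlow
    _ = _ := hD.symm

/-! ## Coercivity -/

/-- **Coercivity of the log-volume functional on the unit Frobenius sphere.**  Let `u : X → ℝ^k`,
`|X| ≥ k ≥ 1`, with `‖u_x‖² ≥ kδ₀`, in QUANTITATIVE GENERAL POSITION with constant `δ₀ > 0`: for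
every orthonormal basis `(e_j)` and every nonempty `U ⊊ [k]`, at most `k − |U|` of the `u_x` have
`⟨e_i,u_x⟩² < δ₀` for all `i ∈ U`.  Then for every `A` with `∑ A_{ij}² = 1` and `det A ≠ 0`,
`|X| log δ₀ − ((|X|−k)/k) log k + ((|X|−k)/k²) log(1/(det A)²) ≤ ∑_x log ‖Au_x‖² − (|X|/k) log (det A)²`.
[cite: Forster2002, Lemma 4.2 (compactness; variational form)] -/
theorem coercive_bound {X : Type*} [Fintype X] {k : ℕ} (u : X → Fin k → ℝ) (hk : 1 ≤ k)
    (hn : k ≤ Fintype.card X) {δ₀ : ℝ} (hδ₀ : 0 < δ₀) (hδu : ∀ x, (k : ℝ) * δ₀ ≤ u x ⬝ᵥ u x)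
    (hGP : ∀ e : Fin k → Fin k → ℝ, (∀ i j, e i ⬝ᵥ e j = if i = j then 1 else 0) →
      ∀ U : Finset (Fin k), U.Nonempty → U.card < k →
        (Finset.univ.filter fun x => ∀ i ∈ U, (e i ⬝ᵥ u x) ^ 2 < δ₀).card ≤ k - U.card)
    (A : Matrix (Fin k) (Fin k) ℝ) (hA1 : ∑ i, ∑ j, A i j ^ 2 = 1) (hAdet : A.det ≠ 0) :
    (Fintype.card X : ℝ) * Real.log δ₀ - ((Fintype.card X : ℝ) - k) / k * Real.log k
      + ((Fintype.card X : ℝ) - k) / k ^ 2 * Real.log (1 / A.det ^ 2) ≤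
    ∑ x, Real.log ((A *ᵥ u x) ⬝ᵥ (A *ᵥ u x)) - (Fintype.card X : ℝ) / k * Real.log (A.det ^ 2) := by
  classical
  obtain ⟨lam, e, horth, hexp, hpars, htr, hdet, hnn⟩ := spectral_data A
  set n : ℕ := Fintype.card X with hndef
  have hkpos : (0 : ℝ) < k := by exact_mod_cast hk
  -- positivity of the eigenvalues
  have hdet2 : 0 < A.det ^ 2 := by positivity
  have hlpos : ∀ j, 0 < lam j := by
    intro j
    rcases eq_or_lt_of_le (hnn j) with h0 | hpos
    · exfalso
      have : ∏ i, lam i = 0 := Finset.prod_eq_zero (Finset.mem_univ j) h0.symm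
      rw [hdet] at this
      exact hdet2.ne' this
    · exact hpos
  have hsum1 : ∑ j, lam j = 1 := by rw [htr, hA1]
  have hle1 : ∀ j, lam j ≤ 1 := fun j => by
    rw [← hsum1]; exact Finset.single_le_sum (fun i _ => hnn i) (Finset.mem_univ j)
  -- for each `x`, the largest eigenvalue among the directions that see `u_x`
  have hJ : ∀ x, ∃ j, δ₀ ≤ (e j ⬝ᵥ u x) ^ 2 ∧ ∀ j', δ₀ ≤ (e j' ⬝ᵥ u x) ^ 2 → lam j' ≤ lam j := by
    intro x
    have hne : (Finset.univ.filter fun j => δ₀ ≤ (e j ⬝ᵥ u x) ^ 2).Nonempty := by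
      by_contra hemp
      rw [Finset.not_nonempty_iff_eq_empty] at hemp
      have hall : ∀ j, (e j ⬝ᵥ u x) ^ 2 < δ₀ := by
        intro j
        by_contra hj
        have : j ∈ (Finset.univ.filter fun j => δ₀ ≤ (e j ⬝ᵥ u x) ^ 2) := by
          simp [not_lt.mp hj]
        rw [hemp] at this
        exact absurd this (Finset.notMem_empty j)
      have hlt : u x ⬝ᵥ u x < k * δ₀ := by
        rw [hpars]
        calc ∑ j, (e j ⬝ᵥ u x) ^ 2 < ∑ _j : Fin k, δ₀ :=
              Finset.sum_lt_sum_of_nonempty ⟨⟨0, hk⟩, Finset.mem_univ _⟩ fun j _ => hall j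
          _ = k * δ₀ := by rw [Finset.sum_const, Finset.card_univ, Fintype.card_fin, nsmul_eq_mul]
      linarith [hδu x]
    obtain ⟨j, hj, hmax⟩ := Finset.exists_max_image _ lam hne
    refine ⟨j, (Finset.mem_filter.mp hj).2, fun j' hj' => hmax j' ?_⟩
    simp [hj']
  choose f hf hfmax using hJ
  -- `‖A u_x‖² ≥ λ_{f x} δ₀`
  have hAu : ∀ x, lam (f x) * δ₀ ≤ (A *ᵥ u x) ⬝ᵥ (A *ᵥ u x) := by
    intro x
    rw [hexp]
    calc lam (f x) * δ₀ ≤ lam (f x) * (e (f x) ⬝ᵥ u x) ^ 2 :=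
          mul_le_mul_of_nonneg_left (hf x) (hnn _)
      _ ≤ ∑ j, lam j * (e j ⬝ᵥ u x) ^ 2 :=
          Finset.single_le_sum (f := fun j => lam j * (e j ⬝ᵥ u x) ^ 2)
            (fun j _ => mul_nonneg (hnn j) (sq_nonneg _)) (Finset.mem_univ (f x))
  have hlogAu : ∀ x, Real.log δ₀ + Real.log (lam (f x)) ≤ Real.log ((A *ᵥ u x) ⬝ᵥ (A *ᵥ u x)) := by
    intro x
    rw [← Real.log_mul hδ₀.ne' (hlpos _).ne', mul_comm]
    exact Real.log_le_log (mul_pos (hlpos _) hδ₀) (hAu x)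
  -- the counting hypothesis of the layer cake
  have hcount : ∀ t : ℝ, (Finset.univ.filter fun j => t ≤ lam j).Nonempty →
      (Finset.univ.filter fun j => t ≤ lam j).card < k →
      (Finset.univ.filter fun x => lam (f x) < t).card ≤
        k - (Finset.univ.filter fun j => t ≤ lam j).card := by
    intro t hne hlt
    refine le_trans (Finset.card_le_card ?_) (hGP e horth _ hne hlt)
    intro x hx
    simp only [Finset.mem_filter, Finset.mem_univ, true_and] at hx ⊢
    intro i hi
    by_contra hge
    have := hfmax x i (not_lt.mp hge)
    linarith
  -- layer cake with `jM` = argmax, `jm` = argmin of `λ`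
  obtain ⟨jM, -, hjM⟩ := Finset.exists_max_image Finset.univ lam ⟨⟨0, hk⟩, Finset.mem_univ _⟩
  obtain ⟨jm, -, hjm⟩ := Finset.exists_min_image Finset.univ lam ⟨⟨0, hk⟩, Finset.mem_univ _⟩
  have hcake := layer_cake hk hn lam hlpos f hcount jM jm
  rw [← hndef] at hcake
  -- `λ_max ≥ 1/k`, `k log λ_min ≤ log det²`
  have hmax : 1 / (k : ℝ) ≤ lam jM := by
    have : (1 : ℝ) = ∑ j, lam j := hsum1.symm
    have h2 : ∑ j, lam j ≤ ∑ _j : Fin k, lam jM := Finset.sum_le_sum fun j _ => hjM j (Finset.mem_univ _)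
    rw [Finset.sum_const, Finset.card_univ, Fintype.card_fin, nsmul_eq_mul] at h2
    rw [div_le_iff₀ hkpos]; linarith
  have hmin : (k : ℝ) * Real.log (lam jm) ≤ Real.log (A.det ^ 2) := by
    rw [← hdet, Real.log_prod (s := Finset.univ) (fun j _ => (hlpos j).ne')]
    calc (k : ℝ) * Real.log (lam jm) = ∑ _j : Fin k, Real.log (lam jm) := by
          rw [Finset.sum_const, Finset.card_univ, Fintype.card_fin, nsmul_eq_mul]
      _ ≤ ∑ j, Real.log (lam j) :=
          Finset.sum_le_sum fun j _ => Real.log_le_log (hlpos _) (hjm j (Finset.mem_univ _))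
  have hlogdet : Real.log (A.det ^ 2) = ∑ j, Real.log (lam j) := by
    rw [← hdet, Real.log_prod (s := Finset.univ) (fun j _ => (hlpos j).ne')]
  rw [← hlogdet] at hcake
  -- assemble
  have hS : (n : ℝ) * Real.log δ₀ + ∑ x, Real.log (lam (f x)) ≤
      ∑ x, Real.log ((A *ᵥ u x) ⬝ᵥ (A *ᵥ u x)) := by
    calc (n : ℝ) * Real.log δ₀ + ∑ x, Real.log (lam (f x))
        = ∑ x, (Real.log δ₀ + Real.log (lam (f x))) := by
          rw [Finset.sum_add_distrib, Finset.sum_const, Finset.card_univ, nsmul_eq_mul]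
      _ ≤ _ := Finset.sum_le_sum fun x _ => hlogAu x
  have hnk : (0 : ℝ) ≤ ((n : ℝ) - k) / k := div_nonneg (by rw [sub_nonneg]; exact_mod_cast hn) hkpos.le
  have hlogk : Real.log (lam jM) ≥ -Real.log k := by
    have := Real.log_le_log (by positivity) hmax
    rw [one_div, Real.log_inv] at this
    exact this
  have hlogmin : Real.log (lam jm) ≤ (1 / k) * Real.log (A.det ^ 2) := by
    rw [one_div, le_inv_mul_iff₀ hkpos]; exact hmin
  rw [one_div, Real.log_inv]
  have h1 : ((n : ℝ) - k) / k * (Real.log (lam jM) - Real.log (lam jm)) ≥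
      ((n : ℝ) - k) / k * (-Real.log k - (1 / k) * Real.log (A.det ^ 2)) :=
    mul_le_mul_of_nonneg_left (by linarith) hnk
  have h2 : ((n : ℝ) - k) / k * (-Real.log k - (1 / k) * Real.log (A.det ^ 2)) =
      -(((n : ℝ) - k) / k * Real.log k) + ((n : ℝ) - k) / k ^ 2 * (-Real.log (A.det ^ 2)) := by
    field_simp; ring
  linarith [hcake, hS, h1, h2, hlogdet]


/-! ## Part III — quantitative general position (compactness over frames)

(Source file `Summits/QuantumAdvantage/QuantumAdvantage/Theorems/HankelLiftBeyondRectanglesForsterQuantGP.lean`.)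

# Forster's Theorem 4.1, part III: quantitative general position (compactness over frames)

Route `route-QuantumAdvantage-HankelLift`; infrastructure toward discharging the named fact
`Literature.Computability.Complexity.ForsterIsotropicPosition` (Forster 2002, Thm 4.1).

`exists_quantGP`: if every sub-family of `u : X → ℝ^k` with at most `k` members is linearly
independent (`k ≥ 1`), there is `δ₀ > 0` with `‖u_x‖² ≥ kδ₀` for all `x` and such that for every
orthonormal basis `(e_j)` of `ℝ^k` and every nonempty `U ⊊ [k]`, at most `k − |U|` indices `x` have
`⟨e_i, u_x⟩² < δ₀` for all `i ∈ U`.  Proof: for `|T| = k − |U| + 1` the continuous function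
`e ↦ ∑_{x∈T} ∑_{i∈U} ⟨e_i,u_x⟩²` is positive on the compact set of orthonormal frames (if it vanished,
the `k+1` vectors `u_x (x ∈ T), e_i (i ∈ U)` would be linearly independent in `ℝ^k`), hence bounded
below by some `m_{U,T} > 0`; take `δ₀` below all `m_{U,T}/k²`.  This is the quantitative form of
general position used in the compactness step (Lemma 4.2) of Forster's proof.
[cite: Forster2002, Lemma 4.2]
-/


/-- Orthonormal vectors together with vectors orthogonal to them and linearly independent among
themselves form a linearly independent family. [folklore] -/
private theorem linearIndependent_sum_of_orthogonal {k : ℕ} {T U : Type*} [Fintype T] [Fintype U]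
    [DecidableEq U] (a : T → Fin k → ℝ) (b : U → Fin k → ℝ) (ha : LinearIndependent ℝ a)
    (hb : ∀ i j, b i ⬝ᵥ b j = if i = j then 1 else 0) (hab : ∀ x i, b i ⬝ᵥ a x = 0) :
    LinearIndependent ℝ (Sum.elim a b) := by
  classical
  rw [Fintype.linearIndependent_iff]
  intro c hc
  -- split the vanishing combination
  have hsplit : ∑ x, c (Sum.inl x) • a x + ∑ i, c (Sum.inr i) • b i = 0 := by
    rw [← hc, Fintype.sum_sum_type]
    simp only [Sum.elim_inl, Sum.elim_inr]
  -- dot with `b j`: the `b`-coefficients vanish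
  have hcb : ∀ j, c (Sum.inr j) = 0 := by
    intro j
    have h := congrArg (fun w => b j ⬝ᵥ w) hsplit
    simp only [dotProduct_add, dotProduct_zero, dotProduct_sum, dotProduct_smul, smul_eq_mul,
      hab, mul_zero, Finset.sum_const_zero, zero_add, hb] at h
    rw [Finset.sum_eq_single j (fun i _ hij => by simp [Ne.symm hij]) (by simp)] at h
    simpa using h
  -- then the `a`-combination vanishes
  have hca : ∀ x, c (Sum.inl x) = 0 := by
    have h0 : ∑ x, c (Sum.inl x) • a x = 0 := by
      have := hsplit
      simp only [hcb, zero_smul, Finset.sum_const_zero, add_zero] at this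
      exact this
    exact Fintype.linearIndependent_iff.mp ha _ h0
  rintro (x | i)
  · exact hca x
  · exact hcb i

/-- The set of orthonormal frames of `ℝ^k` (as `k`-tuples of coordinate vectors) is compact. [folklore] -/
private theorem isCompact_orthonormalFrames (k : ℕ) :
    IsCompact {e : Fin k → Fin k → ℝ | ∀ i j, e i ⬝ᵥ e j = if i = j then 1 else 0} := by
  have hclosed : IsClosed {e : Fin k → Fin k → ℝ | ∀ i j, e i ⬝ᵥ e j = if i = j then 1 else 0} := by
    have : {e : Fin k → Fin k → ℝ | ∀ i j, e i ⬝ᵥ e j = if i = j then 1 else 0} =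
        ⋂ i, ⋂ j, {e | e i ⬝ᵥ e j = if i = j then 1 else 0} := by
      ext e; simp
    rw [this]
    refine isClosed_iInter fun i => isClosed_iInter fun j => ?_
    refine isClosed_eq ?_ continuous_const
    simp only [dotProduct]
    fun_prop
  have hbox : IsCompact (Set.pi Set.univ fun _ : Fin k => Set.pi Set.univ fun _ : Fin k =>
      Set.Icc (-1 : ℝ) 1) :=
    isCompact_univ_pi fun _ => isCompact_univ_pi fun _ => isCompact_Icc
  refine hbox.of_isClosed_subset hclosed ?_
  intro e he
  simp only [Set.mem_setOf_eq] at he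
  simp only [Set.mem_pi, Set.mem_univ, true_implies, Set.mem_Icc]
  intro i l
  have h1 : e i ⬝ᵥ e i = 1 := by rw [he i i, if_pos rfl]
  have hsq : e i l ^ 2 ≤ 1 := by
    rw [← h1, dotProduct]
    calc e i l ^ 2 = e i l * e i l := sq _
      _ ≤ ∑ l', e i l' * e i l' :=
          Finset.single_le_sum (f := fun l' => e i l' * e i l') (fun l' _ => mul_self_nonneg _)
            (Finset.mem_univ l)
  constructor <;> nlinarith [sq_nonneg (e i l)]

/-- **Quantitative general position.**  See the module docstring. [cite: Forster2002, Lemma 4.2] -/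
theorem exists_quantGP {X : Type*} [Fintype X] [DecidableEq X] {k : ℕ} (hk : 1 ≤ k)
    (u : X → Fin k → ℝ) (hGP : ∀ S : Finset X, S.card ≤ k → LinearIndepOn ℝ u (S : Set X)) :
    ∃ δ₀ : ℝ, 0 < δ₀ ∧ (∀ x, (k : ℝ) * δ₀ ≤ u x ⬝ᵥ u x) ∧
      ∀ e : Fin k → Fin k → ℝ, (∀ i j, e i ⬝ᵥ e j = if i = j then 1 else 0) →
        ∀ U : Finset (Fin k), U.Nonempty → U.card < k →
          (Finset.univ.filter fun x => ∀ i ∈ U, (e i ⬝ᵥ u x) ^ 2 < δ₀).card ≤ k - U.card := by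
  classical
  set O := {e : Fin k → Fin k → ℝ | ∀ i j, e i ⬝ᵥ e j = if i = j then 1 else 0} with hO
  have hOc : IsCompact O := isCompact_orthonormalFrames k
  have hOne : O.Nonempty := ⟨fun i => Pi.single i 1, fun i j => by
    show Pi.single i (1 : ℝ) ⬝ᵥ Pi.single j 1 = _
    rw [dotProduct_single, mul_one, Pi.single_apply]
    by_cases h : i = j
    · subst h; simp
    · rw [if_neg (Ne.symm h), if_neg h]⟩
  -- the test functions
  let g : Finset (Fin k) × Finset X → (Fin k → Fin k → ℝ) → ℝ :=
    fun q e => ∑ x ∈ q.2, ∑ i ∈ q.1, (e i ⬝ᵥ u x) ^ 2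
  have hgcont : ∀ q, Continuous (g q) := by
    intro q
    simp only [g, dotProduct]
    fun_prop
  -- positivity on frames, for `|T| + |U| = k + 1`, `|T| ≤ k`
  have hgpos : ∀ q : Finset (Fin k) × Finset X, q.2.card ≤ k → q.2.card + q.1.card = k + 1 →
      ∀ e ∈ O, 0 < g q e := by
    rintro ⟨U, T⟩ hTk hTU e he
    simp only at hTk hTU
    have hnn : 0 ≤ g (U, T) e := Finset.sum_nonneg fun x _ => Finset.sum_nonneg fun i _ => sq_nonneg _
    rcases eq_or_lt_of_le hnn with h0 | hpos
    · exfalso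
      -- all inner products vanish
      have hzero : ∀ x ∈ T, ∀ i ∈ U, e i ⬝ᵥ u x = 0 := by
        intro x hx i hi
        have h1 : ∑ x ∈ T, ∑ i ∈ U, (e i ⬝ᵥ u x) ^ 2 = 0 := h0.symm
        have h2 := (Finset.sum_eq_zero_iff_of_nonneg (fun x _ =>
          Finset.sum_nonneg fun i _ => sq_nonneg _)).mp h1 x hx
        have h3 := (Finset.sum_eq_zero_iff_of_nonneg (fun i _ => sq_nonneg _)).mp h2 i hi
        exact pow_eq_zero_iff (n := 2) (by norm_num) |>.mp h3
      -- the combined family is linearly independent, of size `k + 1`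
      have hT : LinearIndependent ℝ (fun x : T => u x) := hGP T hTk
      have hli := linearIndependent_sum_of_orthogonal (fun x : T => u x) (fun i : U => e i) hT
        (fun i j => by
          rw [he i j]
          by_cases h : i = j
          · subst h; simp
          · have h' : (i : Fin k) ≠ j := fun h'' => h (Subtype.ext h'')
            rw [if_neg h', if_neg h])
        (fun x i => hzero x x.2 i i.2)
      have hcard := hli.fintype_card_le_finrank
      rw [Fintype.card_sum, Fintype.card_coe, Fintype.card_coe, Module.finrank_fin_fun] at hcard
      omega
    · exact hpos
  -- the relevant pairs and their positive minima
  set P : Finset (Finset (Fin k) × Finset X) := (Finset.univ ×ˢ Finset.univ).filter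
    fun q => q.2.card ≤ k ∧ q.2.card + q.1.card = k + 1 with hP
  have hmin : ∀ q ∈ P, ∃ m : ℝ, 0 < m ∧ ∀ e ∈ O, m ≤ g q e := by
    intro q hq
    simp only [hP, Finset.mem_filter, Finset.mem_product, Finset.mem_univ, true_and] at hq
    obtain ⟨e₀, he₀, hle⟩ := hOc.exists_isMinOn hOne (hgcont q).continuousOn
    exact ⟨g q e₀, hgpos q hq.1 hq.2 e₀ he₀, fun e he => hle he⟩
  choose! m hm0 hmle using hmin
  -- a uniform positive lower bound
  obtain ⟨δ₁, hδ₁, hδ₁le⟩ : ∃ δ₁ : ℝ, 0 < δ₁ ∧ ∀ q ∈ P, δ₁ ≤ m q := by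
    rcases P.eq_empty_or_nonempty with hPe | hPne
    · exact ⟨1, one_pos, by simp [hPe]⟩
    · obtain ⟨q₀, hq₀, hq₀min⟩ := Finset.exists_min_image P m hPne
      exact ⟨m q₀, hm0 q₀ hq₀, hq₀min⟩
  -- the norms of the `u_x`
  have hune : ∀ x, 0 < u x ⬝ᵥ u x := by
    intro x
    have h := hGP {x} (by simp; exact hk)
    rw [Finset.coe_singleton] at h
    have hx : u x ≠ 0 := h.ne_zero (Set.mem_singleton x)
    exact lt_of_le_of_ne (Finset.sum_nonneg fun l _ => mul_self_nonneg _)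
      (fun h0 => hx (dotProduct_self_eq_zero.mp h0.symm))
  obtain ⟨c, hc, hcle⟩ : ∃ c : ℝ, 0 < c ∧ ∀ x, c ≤ u x ⬝ᵥ u x := by
    rcases (Finset.univ : Finset X).eq_empty_or_nonempty with hXe | hXne
    · refine ⟨1, one_pos, fun x => ?_⟩
      have hx := Finset.mem_univ x
      rw [hXe] at hx
      exact absurd hx (Finset.notMem_empty x)
    · obtain ⟨x₀, -, hx₀⟩ := Finset.exists_min_image Finset.univ (fun x => u x ⬝ᵥ u x) hXne
      exact ⟨u x₀ ⬝ᵥ u x₀, hune x₀, fun x => hx₀ x (Finset.mem_univ x)⟩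
  -- the constant
  have hkpos : (0 : ℝ) < k := by exact_mod_cast hk
  refine ⟨min (δ₁ / ((k : ℝ) * k + 1)) (c / k), lt_min (by positivity) (by positivity), ?_, ?_⟩
  · intro x
    calc (k : ℝ) * min (δ₁ / ((k : ℝ) * k + 1)) (c / k) ≤ k * (c / k) :=
          mul_le_mul_of_nonneg_left (min_le_right _ _) hkpos.le
      _ = c := by field_simp
      _ ≤ u x ⬝ᵥ u x := hcle x
  · intro e he U hUne hUk
    have hUpos := hUne.card_pos
    by_contra hbad
    rw [not_le] at hbad
    -- pick `T ⊆ Bad` with `|T| = k - |U| + 1`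
    obtain ⟨T, hTsub, hTcard⟩ := Finset.exists_subset_card_eq
      (s := Finset.univ.filter fun x => ∀ i ∈ U, (e i ⬝ᵥ u x) ^ 2 <
        min (δ₁ / ((k : ℝ) * k + 1)) (c / k)) (n := k - U.card + 1) (by omega)
    have hq : (U, T) ∈ P := by
      simp only [hP, Finset.mem_filter, Finset.mem_product, Finset.mem_univ, true_and]
      constructor <;> omega
    have h1 : δ₁ ≤ g (U, T) e := (hδ₁le _ hq).trans (hmle _ hq e he)
    -- but `g (U,T) e < |T| |U| δ₀ ≤ δ₁`
    have h2 : g (U, T) e < δ₁ := by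
      have hUk' : (U.card : ℝ) ≤ k := by exact_mod_cast hUk.le
      have hTk' : (T.card : ℝ) ≤ k := by rw [hTcard]; push_cast; have := hUne.card_pos; 
                                          rw [Nat.cast_sub hUk.le]; linarith [show (1:ℝ) ≤ U.card by exact_mod_cast this]
      calc g (U, T) e = ∑ x ∈ T, ∑ i ∈ U, (e i ⬝ᵥ u x) ^ 2 := rfl
        _ < ∑ x ∈ T, ∑ i ∈ U, δ₁ / ((k : ℝ) * k + 1) := by
            have hTne : T.Nonempty := by rw [← Finset.card_pos, hTcard]; omega
            refine Finset.sum_lt_sum_of_nonempty hTne fun x hx => ?_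
            refine Finset.sum_lt_sum_of_nonempty hUne fun i hi => ?_
            have hx' := (Finset.mem_filter.mp (hTsub hx)).2 i hi
            exact lt_of_lt_of_le hx' (min_le_left _ _)
        _ = T.card * (U.card * (δ₁ / ((k : ℝ) * k + 1))) := by
            rw [Finset.sum_const, nsmul_eq_mul, Finset.sum_const, nsmul_eq_mul]
        _ ≤ k * (k * (δ₁ / ((k : ℝ) * k + 1))) := by
            have hδ' : 0 ≤ δ₁ / ((k : ℝ) * k + 1) := by positivity
            exact mul_le_mul hTk' (mul_le_mul_of_nonneg_right hUk' hδ') (by positivity) hkpos.le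
        _ < δ₁ := by
            rw [← mul_assoc, mul_div_assoc', div_lt_iff₀ (by positivity)]
            nlinarith
    linarith


/-! ## Reduction — Theorem 2.2 from radial isotropic position

(Source file `Summits/QuantumAdvantage/QuantumAdvantage/Theorems/HankelLiftBeyondRectanglesForsterReduction.lean`.)

# Forster's theorem from radial isotropic position (Forster 2002, Thm 2.2 ⟸ Thm 4.1)

Route `route-QuantumAdvantage-HankelLift`; infrastructure for the sign-rank rung of the open crux
`HankelLift.BeyondRectangles` (stmt-QuantumAdvantage-18440).  The rung is conditional on the named
fact `Literature.Computability.Complexity.ForsterHalfspaceBound` (Forster's Theorem 2.2).  Here that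
fact is REDUCED, with a complete proof, to the linear-algebra core of Forster's paper, his
Theorem 4.1 (`ForsterIsotropicPosition`, a named fact: vectors in general position can be brought
into radial isotropic position by a nonsingular linear map): Forster's own three-step proof —
perturb to general position (`Forster.exists_generalPosition`), rescale by Theorem 4.1 and
normalize (`A u_x/‖A u_x‖`, `A⁻ᵀ v_y/‖A⁻ᵀ v_y‖`, signs preserved), then Lemma 2.1 and the count
(`Forster.forster_count`).

* `ForsterIsotropicPosition` — Forster's Theorem 4.1 (named fact, NOT proved).
* `halfspaceBound_fin_of_isotropicPosition` — the bound `√(|X||Y|) ≤ B·k` for arrangements in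
  `ℝ^k = Fin k → ℝ`, from the fact.
* `halfspaceBound_of_isotropicPosition` — the same for an arbitrary finite coordinate type `ι`;
  its conclusion is verbatim the body of `Literature.Computability.Complexity.ForsterHalfspaceBound`
  (the one-line corollary `ForsterIsotropicPosition → ForsterHalfspaceBound` is filed separately,
  once that Literature module is in the tree).
[cite: Forster2002, Theorem 2.2, Theorem 4.1]
-/


/-- `√|Y| ≤ B` from the bilinear bound, for `X` nonempty (test vectors `e_{x₀}` and the row
`M_{x₀,·}`). [folklore] -/
private theorem sqrt_card_le_of_bilinear {X Y : Type*} [Fintype X] [Fintype Y] [DecidableEq X]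
    (M : X → Y → ℝ) {B : ℝ} (hB0 : 0 ≤ B) (hM : ∀ x y, M x y = 1 ∨ M x y = -1)
    (hB : ∀ (a : X → ℝ) (b : Y → ℝ),
      |∑ x, ∑ y, a x * M x y * b y| ≤ B * Real.sqrt (∑ x, a x ^ 2) * Real.sqrt (∑ y, b y ^ 2))
    (x₀ : X) : Real.sqrt (Fintype.card Y : ℝ) ≤ B := by
  have hsq : ∀ y, M x₀ y ^ 2 = 1 := fun y => by rcases hM x₀ y with h | h <;> simp [h]
  have h := hB (Pi.single x₀ 1) (M x₀)
  have hlhs : ∑ x, ∑ y, (Pi.single x₀ (1 : ℝ) : X → ℝ) x * M x y * M x₀ y =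
      (Fintype.card Y : ℝ) := by
    rw [Finset.sum_eq_single x₀]
    · simp only [Pi.single_eq_same, one_mul]
      rw [Finset.sum_congr rfl fun y _ => by rw [← sq, hsq y], Finset.sum_const, Finset.card_univ,
        nsmul_eq_mul, mul_one]
    · intro x _ hx; simp [Pi.single_eq_of_ne hx]
    · intro h; exact absurd (Finset.mem_univ _) h
  have ha : ∑ x, (Pi.single x₀ (1 : ℝ) : X → ℝ) x ^ 2 = 1 := by
    rw [Finset.sum_eq_single x₀]
    · simp
    · intro x _ hx; simp [Pi.single_eq_of_ne hx]
    · intro h; exact absurd (Finset.mem_univ _) h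
  have hb : ∑ y, M x₀ y ^ 2 = (Fintype.card Y : ℝ) := by
    rw [Finset.sum_congr rfl fun y _ => hsq y, Finset.sum_const, Finset.card_univ, nsmul_eq_mul,
      mul_one]
  rw [hlhs, ha, hb, Real.sqrt_one, mul_one] at h
  have hY0 : (0 : ℝ) ≤ Fintype.card Y := Nat.cast_nonneg _
  have h' : Real.sqrt (Fintype.card Y : ℝ) * Real.sqrt (Fintype.card Y : ℝ) ≤
      B * Real.sqrt (Fintype.card Y : ℝ) := by
    rw [Real.mul_self_sqrt hY0]; exact (le_abs_self _).trans h
  rcases eq_or_lt_of_le (Real.sqrt_nonneg (Fintype.card Y : ℝ)) with h0 | hpos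
  · rw [← h0]; exact hB0
  · exact le_of_mul_le_mul_right h' hpos

/-- `√n ≤ n` for a natural number `n ≥ 1`. [folklore] -/
private theorem sqrt_natCast_le_self {n : ℕ} (hn : 1 ≤ n) : Real.sqrt (n : ℝ) ≤ n := by
  have h1 : (1 : ℝ) ≤ n := by exact_mod_cast hn
  rw [Real.sqrt_le_left (by linarith)]
  nlinarith

/-- **Forster's Theorem 2.2 in `ℝ^k`, from Theorem 4.1.**  If `u_x, v_y : Fin k → ℝ` realize the
`±1` matrix `M` (`M_{xy}⟨u_x,v_y⟩ > 0`) and `M` has the bilinear bound `B ≥ 0`, then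
`√(|X|·|Y|) ≤ B·k`.  Proof (Forster): trivial if `|X| < k` (`B ≥ √|Y|`); otherwise perturb `u` into
general position keeping the signs (`exists_generalPosition`, margin `m = min M⟨u,v⟩ > 0`), apply
Theorem 4.1 to get `A`, pass to the unit vectors `A u_x/‖A u_x‖` and `A⁻ᵀ v_y/‖A⁻ᵀ v_y‖`
(`⟨A u, A⁻ᵀ v⟩ = ⟨u, v⟩`), and conclude with `forster_count`. [cite: Forster2002, Theorem 2.2] -/
theorem halfspaceBound_fin_of_isotropicPosition (hI : Literature.Computability.Complexity.ForsterIsotropicPosition)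
    {X Y : Type} [Fintype X] [Fintype Y] {k : ℕ} (M : X → Y → ℝ) (u : X → Fin k → ℝ)
    (v : Y → Fin k → ℝ) {B : ℝ} (hB0 : 0 ≤ B) (hM : ∀ x y, M x y = 1 ∨ M x y = -1)
    (hsign : ∀ x y, 0 < M x y * ∑ l, u x l * v y l)
    (hB : ∀ (a : X → ℝ) (b : Y → ℝ),
      |∑ x, ∑ y, a x * M x y * b y| ≤ B * Real.sqrt (∑ x, a x ^ 2) * Real.sqrt (∑ y, b y ^ 2)) :
    Real.sqrt ((Fintype.card X : ℝ) * (Fintype.card Y : ℝ)) ≤ B * k := by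
  classical
  -- empty cases
  rcases isEmpty_or_nonempty X with hX | hX
  · have : (Fintype.card X : ℝ) = 0 := by simp
    rw [this, zero_mul, Real.sqrt_zero]; positivity
  rcases isEmpty_or_nonempty Y with hY | hY
  · have : (Fintype.card Y : ℝ) = 0 := by simp
    rw [this, mul_zero, Real.sqrt_zero]; positivity
  obtain ⟨x₀⟩ := hX
  obtain ⟨y₀⟩ := hY
  have hBY : Real.sqrt (Fintype.card Y : ℝ) ≤ B := sqrt_card_le_of_bilinear M hB0 hM hB x₀
  -- `k ≥ 1`
  have hk : 1 ≤ k := by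
    rcases Nat.eq_zero_or_pos k with h0 | h0
    · subst h0
      have := hsign x₀ y₀
      simp at this
    · exact h0
  have hkpos : (0 : ℝ) < k := by exact_mod_cast hk
  by_cases hXk : Fintype.card X < k
  · -- trivial case `|X| < k`
    have hX1 : 1 ≤ Fintype.card X := Fintype.card_pos_iff.mpr ⟨x₀⟩
    have hXk' : (Fintype.card X : ℝ) ≤ k := by exact_mod_cast hXk.le
    calc Real.sqrt ((Fintype.card X : ℝ) * (Fintype.card Y : ℝ))
        = Real.sqrt (Fintype.card X : ℝ) * Real.sqrt (Fintype.card Y : ℝ) :=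
          Real.sqrt_mul (Nat.cast_nonneg _) _
      _ ≤ (Fintype.card X : ℝ) * B :=
          mul_le_mul (sqrt_natCast_le_self hX1) hBY (Real.sqrt_nonneg _) (Nat.cast_nonneg _)
      _ ≤ k * B := mul_le_mul_of_nonneg_right hXk' hB0
      _ = B * k := mul_comm _ _
  push Not at hXk
  -- the margin `m` and the perturbation size `ε`
  obtain ⟨p₀, -, hp₀⟩ := Finset.exists_min_image Finset.univ
    (fun p : X × Y => M p.1 p.2 * ∑ l, u p.1 l * v p.2 l) ⟨(x₀, y₀), Finset.mem_univ _⟩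
  set m : ℝ := M p₀.1 p₀.2 * ∑ l, u p₀.1 l * v p₀.2 l with hmdef
  have hm : 0 < m := hsign _ _
  have hmle : ∀ x y, m ≤ M x y * ∑ l, u x l * v y l := fun x y => hp₀ (x, y) (Finset.mem_univ _)
  set V : ℝ := ∑ y, ∑ l, |v y l| with hVdef
  have hV0 : 0 ≤ V := Finset.sum_nonneg fun y _ => Finset.sum_nonneg fun l _ => abs_nonneg _
  set ε : ℝ := m / (V + 1) with hεdef
  have hε : 0 < ε := by positivity
  obtain ⟨u', hu', hli⟩ := exists_generalPosition u hε
  -- the signs are preserved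
  have hsign' : ∀ x y, 0 < M x y * ∑ l, u' x l * v y l := by
    intro x y
    have hdiff : |∑ l, u' x l * v y l - ∑ l, u x l * v y l| ≤ ε * V := by
      rw [← Finset.sum_sub_distrib]
      calc |∑ l, (u' x l * v y l - u x l * v y l)|
          ≤ ∑ l, |u' x l * v y l - u x l * v y l| := Finset.abs_sum_le_sum_abs _ _
        _ = ∑ l, |u' x l - u x l| * |v y l| :=
            Finset.sum_congr rfl fun l _ => by rw [← sub_mul, abs_mul]
        _ ≤ ∑ l, ε * |v y l| :=
            Finset.sum_le_sum fun l _ => mul_le_mul_of_nonneg_right (hu' x l) (abs_nonneg _)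
        _ = ε * ∑ l, |v y l| := by rw [Finset.mul_sum]
        _ ≤ ε * V := mul_le_mul_of_nonneg_left
            (Finset.single_le_sum (f := fun y => ∑ l, |v y l|)
              (fun y _ => Finset.sum_nonneg fun l _ => abs_nonneg _) (Finset.mem_univ y)) hε.le
    have hMabs : |M x y| = 1 := by rcases hM x y with h | h <;> simp [h]
    have h2 : |M x y * (∑ l, u' x l * v y l - ∑ l, u x l * v y l)| ≤ ε * V := by
      rw [abs_mul, hMabs, one_mul]; exact hdiff
    have h3 := neg_abs_le (M x y * (∑ l, u' x l * v y l - ∑ l, u x l * v y l))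
    have hεV : ε * V < m := by
      rw [hεdef, div_mul_eq_mul_div, div_lt_iff₀ (by positivity)]
      nlinarith
    have h4 := hmle x y
    nlinarith
  -- Theorem 4.1
  obtain ⟨A, hA, hiso⟩ := hI X k u' hXk hli
  have hAunit : IsUnit A := (Matrix.isUnit_iff_isUnit_det A).mpr hA
  -- the new vectors
  set Au : X → Fin k → ℝ := fun x => A *ᵥ u' x with hAudef
  set Bv : Y → Fin k → ℝ := fun y => v y ᵥ* A⁻¹ with hBvdef
  have hkey : ∀ x y, Au x ⬝ᵥ Bv y = ∑ l, u' x l * v y l := by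
    intro x y
    simp only [hAudef, hBvdef]
    rw [dotProduct_comm, dotProduct_mulVec, vecMul_vecMul, Matrix.nonsing_inv_mul A hA, vecMul_one,
      dotProduct_comm]
    rfl
  have hu'ne : ∀ x, u' x ≠ 0 := by
    intro x
    have h := hli {x} (by simp; exact hk)
    rw [Finset.coe_singleton] at h
    exact h.ne_zero (Set.mem_singleton x)
  have hvne : ∀ y, v y ≠ 0 := by
    intro y hzero
    have := hsign x₀ y
    rw [hzero] at this
    simp at this
  have hAune : ∀ x, Au x ≠ 0 := by
    intro x h
    apply hu'ne x
    have hinj := Matrix.mulVec_injective_iff_isUnit.mpr hAunit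
    exact hinj (h.trans (Matrix.mulVec_zero A).symm)
  have hBvne : ∀ y, Bv y ≠ 0 := by
    intro y h
    apply hvne y
    have : v y = (v y ᵥ* A⁻¹) ᵥ* A := by
      rw [vecMul_vecMul, Matrix.nonsing_inv_mul A hA, vecMul_one]
    rw [this]
    change Bv y ᵥ* A = 0
    rw [h, Matrix.zero_vecMul]
  -- norms
  have hnn : ∀ w : Fin k → ℝ, 0 ≤ w ⬝ᵥ w := fun w =>
    Finset.sum_nonneg fun l _ => mul_self_nonneg _
  have hpos : ∀ w : Fin k → ℝ, w ≠ 0 → 0 < w ⬝ᵥ w := fun w hw =>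
    lt_of_le_of_ne (hnn w) (fun h => hw (dotProduct_self_eq_zero.mp h.symm))
  set nu : X → ℝ := fun x => Real.sqrt (Au x ⬝ᵥ Au x) with hnudef
  set nv : Y → ℝ := fun y => Real.sqrt (Bv y ⬝ᵥ Bv y) with hnvdef
  have hnu : ∀ x, 0 < nu x := fun x => Real.sqrt_pos.mpr (hpos _ (hAune x))
  have hnv : ∀ y, 0 < nv y := fun y => Real.sqrt_pos.mpr (hpos _ (hBvne y))
  set uu : X → Fin k → ℝ := fun x => (nu x)⁻¹ • Au x with huudef
  set vv : Y → Fin k → ℝ := fun y => (nv y)⁻¹ • Bv y with hvvdef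
  -- their properties
  have hsum_sq : ∀ w : Fin k → ℝ, ∑ l, w l ^ 2 = w ⬝ᵥ w := fun w =>
    Finset.sum_congr rfl fun l _ => sq (w l)
  have huu1 : ∀ x, ∑ l, uu x l ^ 2 = 1 := by
    intro x
    rw [hsum_sq]
    simp only [huudef, smul_dotProduct, dotProduct_smul, smul_eq_mul]
    rw [← Real.sq_sqrt (hnn (Au x))]
    change (nu x)⁻¹ * ((nu x)⁻¹ * nu x ^ 2) = 1
    field_simp [(hnu x).ne']
  have hvv1 : ∀ y, ∑ l, vv y l ^ 2 = 1 := by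
    intro y
    rw [hsum_sq]
    simp only [hvvdef, smul_dotProduct, dotProduct_smul, smul_eq_mul]
    rw [← Real.sq_sqrt (hnn (Bv y))]
    change (nv y)⁻¹ * ((nv y)⁻¹ * nv y ^ 2) = 1
    field_simp [(hnv y).ne']
  have hdot : ∀ x y, ∑ l, uu x l * vv y l = (nu x)⁻¹ * (nv y)⁻¹ * ∑ l, u' x l * v y l := by
    intro x y
    rw [← hkey x y]
    change uu x ⬝ᵥ vv y = _
    simp only [huudef, hvvdef, smul_dotProduct, dotProduct_smul, smul_eq_mul]
    ring
  have hsign'' : ∀ x y, 0 < M x y * ∑ l, uu x l * vv y l := by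
    intro x y
    rw [hdot, show M x y * ((nu x)⁻¹ * (nv y)⁻¹ * ∑ l, u' x l * v y l) =
      ((nu x)⁻¹ * (nv y)⁻¹) * (M x y * ∑ l, u' x l * v y l) by ring]
    exact mul_pos (mul_pos (inv_pos.mpr (hnu x)) (inv_pos.mpr (hnv y))) (hsign' x y)
  have hiso' : ∀ w : Fin k → ℝ, ∑ x, (∑ l, uu x l * w l) ^ 2 =
      (Fintype.card X : ℝ) / (Fintype.card (Fin k) : ℝ) * ∑ l, w l ^ 2 := by
    intro w
    rw [Fintype.card_fin, hsum_sq w, ← hiso w]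
    refine Finset.sum_congr rfl fun x _ => ?_
    change (uu x ⬝ᵥ w) ^ 2 = _
    simp only [huudef, smul_dotProduct, smul_eq_mul]
    rw [mul_pow, ← Real.sq_sqrt (hnn (Au x)), inv_pow]
    change (nu x ^ 2)⁻¹ * (Au x ⬝ᵥ w) ^ 2 = (Au x ⬝ᵥ w) ^ 2 / nu x ^ 2
    rw [div_eq_mul_inv, mul_comm]
  -- the count
  have hcount := forster_count M uu vv hM hsign'' hB huu1 hvv1 hiso'
  rw [Fintype.card_fin] at hcount
  -- `√(|X||Y|) ≤ √(B² k²) = B k`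
  calc Real.sqrt ((Fintype.card X : ℝ) * (Fintype.card Y : ℝ))
      ≤ Real.sqrt (B ^ 2 * (k : ℝ) ^ 2) := Real.sqrt_le_sqrt hcount
    _ = B * k := by rw [← mul_pow, Real.sqrt_sq (by positivity)]

/-- **Forster's Theorem 2.2 from his Theorem 4.1**, general coordinate index type `ι` (reindex by
`Fin |ι|` and apply `halfspaceBound_fin_of_isotropicPosition`).  The conclusion is, verbatim, the
body of the named fact `Literature.Computability.Complexity.ForsterHalfspaceBound` (Forster's
Theorem 2.2), which is thereby reduced to `ForsterIsotropicPosition` (his Theorem 4.1).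
[cite: Forster2002, Theorem 2.2] -/
theorem halfspaceBound_of_isotropicPosition (hI : Literature.Computability.Complexity.ForsterIsotropicPosition) :
    ∀ (X Y ι : Type) [Fintype X] [Fintype Y] [Fintype ι]
      (M : X → Y → ℝ) (u : X → ι → ℝ) (v : Y → ι → ℝ) (B : ℝ),
      0 ≤ B →
      (∀ x y, M x y = 1 ∨ M x y = -1) →
      (∀ x y, 0 < M x y * ∑ l, u x l * v y l) →
      (∀ (a : X → ℝ) (b : Y → ℝ),
        |∑ x, ∑ y, a x * M x y * b y| ≤ B * Real.sqrt (∑ x, a x ^ 2) * Real.sqrt (∑ y, b y ^ 2)) →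
      Real.sqrt ((Fintype.card X : ℝ) * (Fintype.card Y : ℝ)) ≤ B * (Fintype.card ι : ℝ) := by
  intro X Y ι _ _ _ M u v B hB0 hM hsign hB
  classical
  set k := Fintype.card ι with hk
  let e : ι ≃ Fin k := Fintype.equivFin ι
  let u₁ : X → Fin k → ℝ := fun x l => u x (e.symm l)
  let v₁ : Y → Fin k → ℝ := fun y l => v y (e.symm l)
  have hsum : ∀ x y, ∑ l, u₁ x l * v₁ y l = ∑ l, u x l * v y l := by
    intro x y
    exact Equiv.sum_comp e.symm (fun l => u x l * v y l)
  have hsign₁ : ∀ x y, 0 < M x y * ∑ l, u₁ x l * v₁ y l := by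
    intro x y; rw [hsum]; exact hsign x y
  exact halfspaceBound_fin_of_isotropicPosition hI M u₁ v₁ hB0 hM hsign₁ hB


/-! ## Assembly — Theorem 4.1 proved; the discharge; Theorem 2.2 unconditional

(Source file `Summits/QuantumAdvantage/QuantumAdvantage/Theorems/HankelLiftBeyondRectanglesForsterIsotropic.lean`.)

# Forster's Theorem 4.1 (radial isotropic position), proved

Route `route-QuantumAdvantage-HankelLift`.  This file assembles parts I–III
(`…ForsterOpt`, `…ForsterSpectral`/`…ForsterCoercive`, `…ForsterQuantGP`) into a proof of
Forster's Theorem 4.1: a finite family `u : X → ℝ^k` with `|X| ≥ k` all of whose sub-families of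
size `≤ k` are linearly independent is put into radial isotropic position
`∑_x (Au_x)(Au_x)ᵀ/‖Au_x‖² = (|X|/k)·I` by some nonsingular `A` (`exists_isotropic`).
Variational proof: minimize `Φ(A) = ∑_x log ‖Au_x‖² − (|X|/k) log(det A)²` over invertible `A`;
by scale invariance and coercivity (`coercive_bound` with the constant of `exists_quantGP`) a
minimizer exists on the compact set `{∑A_{ij}² = 1, det(A)² ≥ η}`; the first-order condition
(`isotropic_of_isMinOn`) is the isotropic identity.  The case `|X| = k` is
`exists_isotropic_of_basis`.  The statement is verbatim the body of the named fact
`Literature.Computability.Complexity.ForsterIsotropicPosition`, DISCHARGED here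
(`forsterIsotropicPosition_holds`); with `…ForsterReduction` this gives Forster's Theorem 2.2
unconditionally (`forster_halfspaceBound`), which makes the sign-rank rung of
`HankelLift.BeyondRectangles` unconditional (`…BeyondRectanglesSignRank.lean`).
[cite: Forster2002, Theorem 4.1]
-/


/-- Scale invariance of `Φ`: `Φ(cA) = Φ(A)` for `c ≠ 0` (when all `Au_x ≠ 0`, `det A ≠ 0`).
[folklore] -/
private theorem phi_smul {X : Type*} [Fintype X] {k : ℕ} (u : X → Fin k → ℝ)
    (A : Matrix (Fin k) (Fin k) ℝ) (hne : ∀ x, A *ᵥ u x ≠ 0) (hdet : A.det ≠ 0) {c : ℝ} (hc : c ≠ 0) :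
    ∑ x, Real.log ((c • A) *ᵥ u x ⬝ᵥ (c • A) *ᵥ u x) -
        (Fintype.card X : ℝ) / k * Real.log ((c • A).det ^ 2) =
      ∑ x, Real.log (A *ᵥ u x ⬝ᵥ A *ᵥ u x) - (Fintype.card X : ℝ) / k * Real.log (A.det ^ 2) := by
  rcases Nat.eq_zero_or_pos k with hk0 | hkpos
  · subst hk0
    simp [Matrix.det_fin_zero]
  have hpos : ∀ x, 0 < A *ᵥ u x ⬝ᵥ A *ᵥ u x := fun x =>
    lt_of_le_of_ne (Finset.sum_nonneg fun l _ => mul_self_nonneg _)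
      (fun h => hne x (dotProduct_self_eq_zero.mp h.symm))
  have hc2 : 0 < c ^ 2 := by positivity
  have hterm : ∀ x, Real.log ((c • A) *ᵥ u x ⬝ᵥ (c • A) *ᵥ u x) =
      Real.log (c ^ 2) + Real.log (A *ᵥ u x ⬝ᵥ A *ᵥ u x) := by
    intro x
    rw [Matrix.smul_mulVec, smul_dotProduct, dotProduct_smul, smul_eq_mul, smul_eq_mul, ← mul_assoc,
      ← sq, Real.log_mul hc2.ne' (hpos x).ne']
  have hdet' : Real.log ((c • A).det ^ 2) = k * Real.log (c ^ 2) + Real.log (A.det ^ 2) := by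
    rw [Matrix.det_smul, Fintype.card_fin, mul_pow, ← pow_mul, mul_comm k 2, pow_mul,
      Real.log_mul (pow_ne_zero _ hc2.ne') (pow_ne_zero _ hdet), Real.log_pow]
  simp_rw [hterm]
  rw [Finset.sum_add_distrib, Finset.sum_const, Finset.card_univ, nsmul_eq_mul, hdet']
  have hk' : (k : ℝ) ≠ 0 := by exact_mod_cast hkpos.ne'
  field_simp
  ring

/-- **Forster's Theorem 4.1 (radial isotropic position).** [cite: Forster2002, Theorem 4.1] -/
theorem exists_isotropic (X : Type) [Fintype X] (k : ℕ) (u : X → Fin k → ℝ)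
    (hkX : k ≤ Fintype.card X)
    (hGP : ∀ S : Finset X, S.card ≤ k → LinearIndepOn ℝ u (S : Set X)) :
    ∃ A : Matrix (Fin k) (Fin k) ℝ, IsUnit A.det ∧ ∀ w : Fin k → ℝ,
      ∑ x, (A *ᵥ u x ⬝ᵥ w) ^ 2 / (A *ᵥ u x ⬝ᵥ A *ᵥ u x) =
        (Fintype.card X : ℝ) / k * (w ⬝ᵥ w) := by
  classical
  -- `k = 0`
  rcases Nat.eq_zero_or_pos k with hk0 | hkpos
  · subst hk0
    refine ⟨1, by simp, fun w => ?_⟩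
    simp [dotProduct]
  have hk1 : 1 ≤ k := hkpos
  -- `|X| = k`
  rcases eq_or_lt_of_le hkX with heq | hlt
  · have hli : LinearIndependent ℝ u := by
      have h := hGP Finset.univ (by rw [Finset.card_univ]; exact heq.ge)
      rw [Finset.coe_univ] at h
      exact linearIndepOn_univ_iff.mp h
    exact exists_isotropic_of_basis u heq hli
  -- `|X| > k`: the variational argument
  set n : ℕ := Fintype.card X with hndef
  have hu0 : ∀ x, u x ≠ 0 := by
    intro x
    have h := hGP {x} (by simp; exact hk1)
    rw [Finset.coe_singleton] at h
    exact h.ne_zero (Set.mem_singleton x)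
  -- the functional
  let Φ : Matrix (Fin k) (Fin k) ℝ → ℝ := fun A =>
    ∑ x, Real.log (A *ᵥ u x ⬝ᵥ A *ᵥ u x) - (n : ℝ) / k * Real.log (A.det ^ 2)
  -- nonvanishing of `A u_x` for invertible `A`
  have hAune : ∀ A : Matrix (Fin k) (Fin k) ℝ, A.det ≠ 0 → ∀ x, A *ᵥ u x ≠ 0 := by
    intro A hA x h
    have hinj := Matrix.mulVec_injective_iff_isUnit.mpr
      ((Matrix.isUnit_iff_isUnit_det A).mpr (isUnit_iff_ne_zero.mpr hA))
    exact hu0 x (hinj (h.trans (Matrix.mulVec_zero A).symm))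
  -- quantitative general position and coercivity
  obtain ⟨δ₀, hδ₀, hδu, hGPq⟩ := exists_quantGP hk1 u hGP
  set C₀ : ℝ := (n : ℝ) * Real.log δ₀ - ((n : ℝ) - k) / k * Real.log k with hC₀
  set κ : ℝ := ((n : ℝ) - k) / k ^ 2 with hκ
  have hκpos : 0 < κ := by
    rw [hκ]; apply div_pos _ (by positivity)
    rw [sub_pos]; exact_mod_cast hlt
  have hcoer : ∀ A : Matrix (Fin k) (Fin k) ℝ, ∑ i, ∑ j, A i j ^ 2 = 1 → A.det ≠ 0 →
      C₀ + κ * Real.log (1 / A.det ^ 2) ≤ Φ A := fun A hA1 hAd =>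
    coercive_bound u hk1 hkX hδ₀ hδu hGPq A hA1 hAd
  -- the base point `A₁ = k^{-1/2} I`
  set A₁ : Matrix (Fin k) (Fin k) ℝ := (Real.sqrt k)⁻¹ • (1 : Matrix (Fin k) (Fin k) ℝ) with hA₁
  have hsk : 0 < Real.sqrt k := Real.sqrt_pos.mpr (by exact_mod_cast hkpos)
  have hA₁norm : ∑ i, ∑ j, A₁ i j ^ 2 = 1 := by
    simp only [hA₁, Matrix.smul_apply, Matrix.one_apply, smul_eq_mul, mul_ite, mul_one, mul_zero]
    have : ∀ i : Fin k, ∑ j : Fin k, (if i = j then (Real.sqrt k)⁻¹ else 0) ^ 2 = ((Real.sqrt k)⁻¹) ^ 2 := by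
      intro i
      rw [Finset.sum_eq_single i (fun j _ hji => by rw [if_neg (Ne.symm hji)]; ring) (by simp)]
      rw [if_pos rfl]
    rw [Finset.sum_congr rfl fun i _ => this i, Finset.sum_const, Finset.card_univ, Fintype.card_fin,
      nsmul_eq_mul, inv_pow, Real.sq_sqrt (by positivity)]
    field_simp
  have hA₁det : A₁.det ≠ 0 := by
    rw [hA₁, Matrix.det_smul, Matrix.det_one, mul_one]
    exact pow_ne_zero _ (inv_ne_zero hsk.ne')
  -- the threshold `η`
  set η₀ : ℝ := Real.exp (-(Φ A₁ - C₀ + 1) / κ) with hη₀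
  set η : ℝ := min η₀ (A₁.det ^ 2) with hη
  have hηpos : 0 < η := lt_min (Real.exp_pos _) (by positivity)
  -- below the threshold, `Φ` exceeds `Φ A₁`
  have hbelow : ∀ A : Matrix (Fin k) (Fin k) ℝ, ∑ i, ∑ j, A i j ^ 2 = 1 → A.det ≠ 0 →
      A.det ^ 2 < η → Φ A₁ < Φ A := by
    intro A hA1 hAd hlt'
    have h1 := hcoer A hA1 hAd
    have hd2 : 0 < A.det ^ 2 := by positivity
    have hlt0 : A.det ^ 2 < η₀ := lt_of_lt_of_le hlt' (min_le_left _ _)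
    -- `log(1/det²) > (Φ A₁ - C₀ + 1)/κ`
    have hlog : (Φ A₁ - C₀ + 1) / κ < Real.log (1 / A.det ^ 2) := by
      rw [one_div, Real.log_inv]
      have := Real.log_lt_log hd2 hlt0
      rw [hη₀, Real.log_exp] at this
      have h3 : Real.log (A.det ^ 2) < -(Φ A₁ - C₀ + 1) / κ := this
      have h5 : -(Φ A₁ - C₀ + 1) / κ = -((Φ A₁ - C₀ + 1) / κ) := neg_div κ (Φ A₁ - C₀ + 1)
      linarith [h3, h5]
    have h4 : Φ A₁ - C₀ + 1 < κ * Real.log (1 / A.det ^ 2) := by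
      rwa [div_lt_iff₀ hκpos, mul_comm] at hlog
    linarith
  -- the compact set
  set K : Set (Matrix (Fin k) (Fin k) ℝ) :=
    {A | ∑ i, ∑ j, A i j ^ 2 = 1 ∧ η ≤ A.det ^ 2} with hK
  have hA₁K : A₁ ∈ K := ⟨hA₁norm, min_le_right _ _⟩
  have hKdet : ∀ A ∈ K, A.det ≠ 0 := by
    intro A hA h0
    have := hA.2; rw [h0] at this; simp at this; linarith
  have hcontF : Continuous fun A : Matrix (Fin k) (Fin k) ℝ => ∑ i, ∑ j, A i j ^ 2 :=
    continuous_finsetSum _ fun i _ => continuous_finsetSum _ fun j _ =>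
      (continuous_id.matrix_elem i j).pow 2
  have hcontdet : Continuous fun A : Matrix (Fin k) (Fin k) ℝ => A.det := continuous_id.matrix_det
  have hKclosed : IsClosed K := by
    rw [hK, Set.setOf_and]
    exact (isClosed_eq hcontF continuous_const).inter (isClosed_le continuous_const (hcontdet.pow 2))
  have hKcpt : IsCompact K := by
    have hbox : IsCompact (Set.pi Set.univ fun _ : Fin k => Set.pi Set.univ fun _ : Fin k =>
        Set.Icc (-1 : ℝ) 1 : Set (Matrix (Fin k) (Fin k) ℝ)) :=
      isCompact_univ_pi fun _ => isCompact_univ_pi fun _ => isCompact_Icc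
    refine hbox.of_isClosed_subset hKclosed ?_
    intro A hA
    simp only [Set.mem_pi, Set.mem_univ, true_implies, Set.mem_Icc]
    intro i j
    have hsq : A i j ^ 2 ≤ 1 := by
      rw [← hA.1]
      calc A i j ^ 2 ≤ ∑ j', A i j' ^ 2 :=
            Finset.single_le_sum (f := fun j' => A i j' ^ 2) (fun _ _ => sq_nonneg _) (Finset.mem_univ j)
        _ ≤ ∑ i', ∑ j', A i' j' ^ 2 :=
            Finset.single_le_sum (f := fun i' => ∑ j', A i' j' ^ 2)
              (fun _ _ => Finset.sum_nonneg fun _ _ => sq_nonneg _) (Finset.mem_univ i)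
    constructor <;> nlinarith [sq_nonneg (A i j)]
  -- continuity of `Φ` on `K`
  have hΦcont : ContinuousOn Φ K := by
    have h1 : ∀ x, ContinuousOn (fun A : Matrix (Fin k) (Fin k) ℝ =>
        Real.log (A *ᵥ u x ⬝ᵥ A *ᵥ u x)) K := by
      intro x
      have hc : Continuous fun A : Matrix (Fin k) (Fin k) ℝ => A *ᵥ u x ⬝ᵥ A *ᵥ u x :=
        (continuous_id.matrix_mulVec continuous_const).dotProduct
          (continuous_id.matrix_mulVec continuous_const)
      refine hc.continuousOn.log fun A hA => ?_
      have hne := hAune A (hKdet A hA) x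
      exact (lt_of_le_of_ne (Finset.sum_nonneg fun l _ => mul_self_nonneg _)
        (fun h => hne (dotProduct_self_eq_zero.mp h.symm))).ne'
    have h2 : ContinuousOn (fun A : Matrix (Fin k) (Fin k) ℝ => Real.log (A.det ^ 2)) K := by
      refine (hcontdet.pow 2).continuousOn.log fun A hA => ?_
      exact pow_ne_zero 2 (hKdet A hA)
    exact (continuousOn_finsetSum _ fun x _ => h1 x).sub (continuousOn_const.mul h2)
  -- a minimizer on `K`
  obtain ⟨A₀, hA₀K, hA₀min⟩ := hKcpt.exists_isMinOn ⟨A₁, hA₁K⟩ hΦcont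
  have hA₀det : A₀.det ≠ 0 := hKdet A₀ hA₀K
  -- `A₀` is a global minimizer over invertible matrices
  have hglob : ∀ A : Matrix (Fin k) (Fin k) ℝ, IsUnit A.det → Φ A₀ ≤ Φ A := by
    intro A hAunit
    have hAd : A.det ≠ 0 := hAunit.ne_zero
    set s : ℝ := Real.sqrt (∑ i, ∑ j, A i j ^ 2) with hs
    have hF0 : 0 < ∑ i, ∑ j, A i j ^ 2 := by
      by_contra hle
      have hzero : ∑ i, ∑ j, A i j ^ 2 = 0 := le_antisymm (not_lt.mp hle)
        (Finset.sum_nonneg fun _ _ => Finset.sum_nonneg fun _ _ => sq_nonneg _)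
      have hA0 : A = 0 := by
        ext i j
        have h1 := (Finset.sum_eq_zero_iff_of_nonneg (fun _ _ =>
          Finset.sum_nonneg fun _ _ => sq_nonneg _)).mp hzero i (Finset.mem_univ _)
        have h2 := (Finset.sum_eq_zero_iff_of_nonneg (fun _ _ => sq_nonneg _)).mp h1 j
          (Finset.mem_univ _)
        exact pow_eq_zero_iff (n := 2) (by norm_num) |>.mp h2
      apply hAd
      rw [hA0]
      haveI : Nonempty (Fin k) := ⟨⟨0, hkpos⟩⟩
      exact Matrix.det_zero
    have hspos : 0 < s := Real.sqrt_pos.mpr hF0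
    set A' : Matrix (Fin k) (Fin k) ℝ := s⁻¹ • A with hA'
    have hA'norm : ∑ i, ∑ j, A' i j ^ 2 = 1 := by
      have happ : ∀ i j, A' i j = s⁻¹ * A i j := fun i j => rfl
      calc ∑ i, ∑ j, A' i j ^ 2 = ∑ i, ∑ j, (s⁻¹) ^ 2 * A i j ^ 2 :=
            Finset.sum_congr rfl fun i _ => Finset.sum_congr rfl fun j _ => by rw [happ, mul_pow]
        _ = (s⁻¹) ^ 2 * ∑ i, ∑ j, A i j ^ 2 := by
            rw [Finset.mul_sum]
            exact Finset.sum_congr rfl fun i _ => by rw [Finset.mul_sum]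
        _ = 1 := by rw [inv_pow, hs, Real.sq_sqrt hF0.le, inv_mul_cancel₀ hF0.ne']
    have hA'det : A'.det ≠ 0 := by
      rw [hA', Matrix.det_smul]
      exact mul_ne_zero (pow_ne_zero _ (inv_ne_zero hspos.ne')) hAd
    have hΦeq : Φ A' = Φ A := phi_smul u A (hAune A hAd) hAd (inv_ne_zero hspos.ne')
    rw [← hΦeq]
    by_cases hcase : η ≤ A'.det ^ 2
    · exact hA₀min ⟨hA'norm, hcase⟩
    · have h := hbelow A' hA'norm hA'det (not_le.mp hcase)
      exact (hA₀min hA₁K).trans h.le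
  -- the first-order condition
  refine ⟨A₀, isUnit_iff_ne_zero.mpr hA₀det, ?_⟩
  have h := isotropic_of_isMinOn u A₀ (isUnit_iff_ne_zero.mpr hA₀det) (hAune A₀ hA₀det) hglob
  simpa [hndef] using h

/-- **Discharge of the named fact** `Literature.Computability.Complexity.ForsterIsotropicPosition`
(Forster 2002, Theorem 4.1): it holds, by `exists_isotropic`. [cite: Forster2002, Theorem 4.1] -/
theorem forsterIsotropicPosition_holds :
    Literature.Computability.Complexity.ForsterIsotropicPosition := by
  intro X _ k u hk hGP
  exact exists_isotropic X k u hk hGP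

/-- **Forster's Theorem 2.2 (unconditional).**  If a `±1` matrix `M` on `X × Y` is realized by an
arrangement of homogeneous half spaces in `ℝ^ι` (`M_{xy}·⟨u_x,v_y⟩ > 0`) and `B ≥ 0` bounds the
bilinear form `|aᵀMb| ≤ B‖a‖‖b‖` (e.g. `B = ‖M‖`), then `√(|X|·|Y|) ≤ B·|ι|`
(`halfspaceBound_of_isotropicPosition` with `forsterIsotropicPosition_holds`).
[cite: Forster2002, Theorem 2.2] -/
theorem forster_halfspaceBound :
    ∀ (X Y ι : Type) [Fintype X] [Fintype Y] [Fintype ι]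
      (M : X → Y → ℝ) (u : X → ι → ℝ) (v : Y → ι → ℝ) (B : ℝ),
      0 ≤ B →
      (∀ x y, M x y = 1 ∨ M x y = -1) →
      (∀ x y, 0 < M x y * ∑ l, u x l * v y l) →
      (∀ (a : X → ℝ) (b : Y → ℝ),
        |∑ x, ∑ y, a x * M x y * b y| ≤ B * Real.sqrt (∑ x, a x ^ 2) * Real.sqrt (∑ y, b y ^ 2)) →
      Real.sqrt ((Fintype.card X : ℝ) * (Fintype.card Y : ℝ)) ≤ B * (Fintype.card ι : ℝ) :=
  halfspaceBound_of_isotropicPosition forsterIsotropicPosition_holds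


/-! ## Part V — the weighted form (Barthe; Hopkins–Kane–Lovett–Mahajan; Diakonikolas–Kane–Tzamos):
exact radial isotropic position of a finitely supported mass distribution under the strict
subspace-mass inequality

(Written directly in Literature, 2026-08-28, for the psd-rank cell `PneNP/ChebyshevTracialDesign`,
literature memo LIT-33 §4(a).)

THE STATEMENT [DiakonikolasKaneTzamos2021, Theorem 2.1 ("Generalized Forster Transform"), attributed
there to Hopkins–Kane–Lovett–Mahajan (FOCS 2020) refining Forster 2002 / Barthe 1998]: «Let `X` be a
distribution with finite support on an inner product space `V`.  Then, unless there is a proper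
subspace `W` of `V` so that `Pr[X ∈ W] ≥ dim(W)/dim(V)`, there exists an invertible linear
transformation `A : V → V` such that `E[f_A(X) f_A(X)ᵀ] = (1/dim V)·I`», `f_A(x) = Ax/‖Ax‖₂`
(their Definition 1.3, on `V ∖ {0}`; so the support consists of nonzero vectors and `W` ranges over
NONZERO proper subspaces).  Below: `V = ℝ^k`, the distribution is a family `u : X → ℝ^k` of nonzero
vectors with positive weights `μ` of total mass `M` (probability weights are the case `M = 1`; equal
vectors may repeat), the hypothesis is `k·μ{x : u_x ∈ W} < dim W · M` for every nonzero proper `W`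
(stated over finite subfamilies `T` with `u(T) ⊆ W`, which avoids deciding membership in `W`), and
the conclusion is the quadratic-form identity `∑_x μ_x ⟨Au_x,w⟩²/‖Au_x‖² = (M/k)‖w‖²`
(`exists_isotropic_w`; matrix entries by `entries_of_quadForm_w`).

THE PROOF re-runs Parts I–IV with weights: the functional is
`Φ_μ(A) = ∑_x μ_x log ‖Au_x‖² − (M/k) log (det A)²`; the first-order condition
(`isotropic_of_isMinOn_w`) and scale invariance are verbatim; COERCIVITY (`coercive_bound_w`, via
the weighted layer cake `layer_cake_w`) now comes from a slack `s > 0` in the subspace-mass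
inequalities instead of quantitative general position, and `exists_slack` produces that slack in
the quantitative form the layer cake consumes: the quantity `d·M − k·μ(T)` (`T ⊆ X`, `d ≤ k`) takes
finitely many values, so the strict inequalities `k·μ(T) < dim W · M` (`u(T) ⊆ W`) hold with a
uniform margin `s₁`; for an orthonormal frame `e` and nonempty `U ⊊ [k]` the vectors orthogonal to
`e_U` span a subspace of dimension `k − |U|` (`exists_orthSubmodule`), so a set `T` of points
orthogonal to `e_U` has mass `≤ (M/k)(k − |U|) − s₁/k`; compactness of the frame set then gives
`δ₀ > 0` such that the points ALMOST orthogonal to `e_U` (`⟨e_i,u_x⟩² < δ₀`, `i ∈ U`) obey the same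
bound (as in `exists_quantGP`).  With `s > 0` the functional is coercive on the unit Frobenius
sphere for every `|X|` (no separate basis case: a basis with any weights violates the strict
inequality), and the assembly of Part IV goes through unchanged (`exists_isotropic_w`).
-/

/-! ### V.1 The weighted first-order condition -/

/-- Weighted polarisation: if `∑_x μ_x w_{x,i} w_{x,j}/‖w_x‖² = c·δ_{ij}` for all `i, j`, then
`∑_x μ_x ⟨w_x, v⟩²/‖w_x‖² = c‖v‖²` for all `v`. [folklore] -/
private theorem quadForm_of_entries_w {X : Type*} [Fintype X] {k : ℕ} (μ : X → ℝ)
    (w : X → Fin k → ℝ) (c : ℝ)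
    (h : ∀ i j : Fin k, ∑ x, μ x * (w x i * w x j / (w x ⬝ᵥ w x)) = c * (if i = j then 1 else 0))
    (v : Fin k → ℝ) : ∑ x, μ x * ((w x ⬝ᵥ v) ^ 2 / (w x ⬝ᵥ w x)) = c * (v ⬝ᵥ v) := by
  have hexp : ∀ x, μ x * ((w x ⬝ᵥ v) ^ 2 / (w x ⬝ᵥ w x)) =
      ∑ i, ∑ j, v i * v j * (μ x * (w x i * w x j / (w x ⬝ᵥ w x))) := by
    intro x
    rw [sq, dotProduct, Finset.sum_mul_sum, Finset.sum_div, Finset.mul_sum]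
    refine Finset.sum_congr rfl fun i _ => ?_
    rw [Finset.sum_div, Finset.mul_sum]
    refine Finset.sum_congr rfl fun j _ => ?_
    ring
  rw [Finset.sum_congr rfl fun x _ => hexp x, Finset.sum_comm]
  rw [Finset.sum_congr rfl fun i _ => Finset.sum_comm]
  simp_rw [← Finset.mul_sum, h]
  rw [dotProduct, Finset.mul_sum]
  refine Finset.sum_congr rfl fun i _ => ?_
  rw [Finset.sum_eq_single i]
  · rw [if_pos rfl]; ring
  · intro j _ hji; rw [if_neg (Ne.symm hji)]; ring
  · intro hi; exact absurd (Finset.mem_univ i) hi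

/-- **Weighted first-order condition.**  Let `u : X → ℝ^k`, weights `μ : X → ℝ`, a real `M`, and let
the invertible `A₀` minimize `Φ_μ(A) = ∑_x μ_x log ‖A u_x‖² − (M/k) log (det A)²` over all invertible
`A`, with all `A₀ u_x ≠ 0`.  Then `∑_x μ_x ⟨A₀u_x, w⟩²/‖A₀u_x‖² = (M/k)‖w‖²` for every `w`
(perturb `A₀ ↦ (1 + tE_{ij})A₀` and differentiate at `t = 0`, exactly as in `isotropic_of_isMinOn`).
[cite: Forster2002, Theorem 4.1 (proof); DiakonikolasKaneTzamos2021, Theorem 2.1] -/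
theorem isotropic_of_isMinOn_w {X : Type*} [Fintype X] {k : ℕ} (u : X → Fin k → ℝ) (μ : X → ℝ)
    (M : ℝ) (A₀ : Matrix (Fin k) (Fin k) ℝ) (hA₀ : IsUnit A₀.det) (hne : ∀ x, A₀ *ᵥ u x ≠ 0)
    (hmin : ∀ A : Matrix (Fin k) (Fin k) ℝ, IsUnit A.det →
      ∑ x, μ x * Real.log (A₀ *ᵥ u x ⬝ᵥ A₀ *ᵥ u x) - M / k * Real.log (A₀.det ^ 2) ≤
        ∑ x, μ x * Real.log (A *ᵥ u x ⬝ᵥ A *ᵥ u x) - M / k * Real.log (A.det ^ 2)) :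
    ∀ w : Fin k → ℝ, ∑ x, μ x * ((A₀ *ᵥ u x ⬝ᵥ w) ^ 2 / (A₀ *ᵥ u x ⬝ᵥ A₀ *ᵥ u x)) =
      M / k * (w ⬝ᵥ w) := by
  set W : X → Fin k → ℝ := fun x => A₀ *ᵥ u x with hWdef
  set nX : ℝ := M / k with hnX
  have hWpos : ∀ x, 0 < W x ⬝ᵥ W x := fun x =>
    lt_of_le_of_ne (Finset.sum_nonneg fun l _ => mul_self_nonneg _)
      (fun h => hne x (dotProduct_self_eq_zero.mp h.symm))
  have hd0 : A₀.det ≠ 0 := hA₀.ne_zero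
  refine quadForm_of_entries_w μ W nX (fun i j => ?_)
  -- the one-parameter family `t ↦ (1 + t E_{ij}) A₀`
  obtain ⟨c, hc⟩ := det_one_add_smul_single i j
  set δ : ℝ := if i = j then 1 else 0 with hδ
  set P : ℝ → ℝ := fun t => 1 + δ * t + c.eval t * t ^ 2 with hPdef
  have hP0 : P 0 = 1 := by simp [hPdef]
  -- the explicit function
  set f : ℝ → ℝ := fun t =>
    ∑ x, μ x * Real.log (W x ⬝ᵥ W x + 2 * t * (W x i * W x j) + t ^ 2 * W x j ^ 2)
    - nX * Real.log ((P t * A₀.det) ^ 2) with hfdef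
  -- `f t = Φ_μ((1 + tE) A₀)` and `f 0 = Φ_μ(A₀)`
  have hft : ∀ t, f t = ∑ x, μ x * Real.log (((1 + t • Matrix.single i j (1 : ℝ)) * A₀) *ᵥ u x ⬝ᵥ
      ((1 + t • Matrix.single i j (1 : ℝ)) * A₀) *ᵥ u x) -
      nX * Real.log (((1 + t • Matrix.single i j (1 : ℝ)) * A₀).det ^ 2) := by
    intro t
    simp only [hfdef]
    congr 1
    · refine Finset.sum_congr rfl fun x _ => ?_
      rw [← Matrix.mulVec_mulVec, one_add_smul_single_mulVec, dotProduct_self_perturb]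
    · rw [Matrix.det_mul, hc t]
  have hf0 : f 0 = ∑ x, μ x * Real.log (W x ⬝ᵥ W x) - nX * Real.log (A₀.det ^ 2) := by
    simp [hfdef, hP0]
  -- local minimality at `0`
  have hPcont : Continuous P := by
    simp only [hPdef]
    exact (continuous_const.add (continuous_const.mul continuous_id)).add
      ((Polynomial.continuous c).mul (continuous_id.pow 2))
  have hPne : ∀ᶠ t in nhds (0 : ℝ), P t ≠ 0 := by
    have hopen : IsOpen {t : ℝ | P t ≠ 0} := isOpen_ne_fun hPcont continuous_const
    exact hopen.mem_nhds (by simp [hP0])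
  have hlocal : IsLocalMin f 0 := by
    filter_upwards [hPne] with t ht
    rw [hf0, hft t]
    have hunit : IsUnit ((1 + t • Matrix.single i j (1 : ℝ)) * A₀).det := by
      rw [Matrix.det_mul, hc t]
      exact (isUnit_iff_ne_zero.mpr ht).mul hA₀
    exact hmin _ hunit
  -- the derivative at `0`
  have hderiv : HasDerivAt f (∑ x, μ x * (2 * (W x i * W x j) / (W x ⬝ᵥ W x)) - nX * (2 * δ)) 0 := by
    have hq : ∀ x, HasDerivAt (fun t => W x ⬝ᵥ W x + 2 * t * (W x i * W x j) + t ^ 2 * W x j ^ 2)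
        (2 * (W x i * W x j)) 0 := by
      intro x
      have h1 : HasDerivAt (fun t : ℝ => 2 * t * (W x i * W x j)) (2 * 1 * (W x i * W x j)) 0 :=
        ((hasDerivAt_id (0 : ℝ)).const_mul 2).mul_const _
      have h2 : HasDerivAt (fun t : ℝ => t ^ 2 * W x j ^ 2)
          (((2 : ℕ) : ℝ) * (0 : ℝ) ^ (2 - 1) * W x j ^ 2) 0 :=
        (hasDerivAt_pow 2 (0 : ℝ)).mul_const _
      exact (((hasDerivAt_const (0 : ℝ) (W x ⬝ᵥ W x)).add h1).add h2).congr_deriv (by simp)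
    have hlogq : ∀ x, HasDerivAt
        (fun t => μ x * Real.log (W x ⬝ᵥ W x + 2 * t * (W x i * W x j) + t ^ 2 * W x j ^ 2))
        (μ x * (2 * (W x i * W x j) / (W x ⬝ᵥ W x))) 0 := by
      intro x
      have h0 : W x ⬝ᵥ W x + 2 * 0 * (W x i * W x j) + 0 ^ 2 * W x j ^ 2 ≠ 0 := by
        have := (hWpos x).ne'
        simpa using this
      exact (((hq x).log h0).congr_deriv (by simp)).const_mul (μ x)
    have hsum := HasDerivAt.fun_sum (u := Finset.univ) fun x _ => hlogq x
    have hPd : HasDerivAt P δ 0 := by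
      have h1 : HasDerivAt (fun t : ℝ => 1 + δ * t) (δ * 1) 0 :=
        ((hasDerivAt_id (0 : ℝ)).const_mul δ).const_add 1
      have h2 : HasDerivAt (fun t : ℝ => c.eval t * t ^ 2)
          (c.derivative.eval 0 * (0 : ℝ) ^ 2 + c.eval 0 * (((2 : ℕ) : ℝ) * (0 : ℝ) ^ (2 - 1))) 0 :=
        (c.hasDerivAt 0).mul (hasDerivAt_pow 2 (0 : ℝ))
      exact (h1.add h2).congr_deriv (by simp)
    have hg : HasDerivAt (fun t => (P t * A₀.det) ^ 2) (((2 : ℕ) : ℝ) * (P 0 * A₀.det) ^ (2 - 1) *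
        (δ * A₀.det)) 0 := (hPd.mul_const A₀.det).pow 2
    have hlogg : HasDerivAt (fun t => Real.log ((P t * A₀.det) ^ 2)) (2 * δ) 0 := by
      have hne0 : (P 0 * A₀.det) ^ 2 ≠ 0 := by rw [hP0, one_mul]; exact pow_ne_zero 2 hd0
      refine (hg.log hne0).congr_deriv ?_
      rw [hP0, one_mul]
      field_simp
      ring
    exact hsum.fun_sub (hlogg.const_mul nX)
  -- conclude
  have hzero := hlocal.hasDerivAt_eq_zero hderiv
  have h2 : ∑ x, μ x * (2 * (W x i * W x j) / (W x ⬝ᵥ W x)) =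
      2 * ∑ x, μ x * (W x i * W x j / (W x ⬝ᵥ W x)) := by
    rw [Finset.mul_sum]
    exact Finset.sum_congr rfl fun x _ => by ring
  rw [h2] at hzero
  have : ∑ x, μ x * (W x i * W x j / (W x ⬝ᵥ W x)) = nX * δ := by linarith
  rw [this]

/-- Weighted scale invariance: `Φ_μ(cA) = Φ_μ(A)` for `c ≠ 0`, when `∑ μ = M`, all `Au_x ≠ 0`,
`det A ≠ 0`. [folklore] -/
private theorem phi_smul_w {X : Type*} [Fintype X] {k : ℕ} (u : X → Fin k → ℝ) (μ : X → ℝ) (M : ℝ)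
    (hM : ∑ x, μ x = M)
    (A : Matrix (Fin k) (Fin k) ℝ) (hne : ∀ x, A *ᵥ u x ≠ 0) (hdet : A.det ≠ 0) {c : ℝ} (hc : c ≠ 0) :
    ∑ x, μ x * Real.log ((c • A) *ᵥ u x ⬝ᵥ (c • A) *ᵥ u x) - M / k * Real.log ((c • A).det ^ 2) =
      ∑ x, μ x * Real.log (A *ᵥ u x ⬝ᵥ A *ᵥ u x) - M / k * Real.log (A.det ^ 2) := by
  rcases Nat.eq_zero_or_pos k with hk0 | hkpos
  · subst hk0
    simp [Matrix.det_fin_zero]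
  have hpos : ∀ x, 0 < A *ᵥ u x ⬝ᵥ A *ᵥ u x := fun x =>
    lt_of_le_of_ne (Finset.sum_nonneg fun l _ => mul_self_nonneg _)
      (fun h => hne x (dotProduct_self_eq_zero.mp h.symm))
  have hc2 : 0 < c ^ 2 := by positivity
  have hterm : ∀ x, μ x * Real.log ((c • A) *ᵥ u x ⬝ᵥ (c • A) *ᵥ u x) =
      μ x * Real.log (c ^ 2) + μ x * Real.log (A *ᵥ u x ⬝ᵥ A *ᵥ u x) := by
    intro x
    rw [Matrix.smul_mulVec, smul_dotProduct, dotProduct_smul, smul_eq_mul, smul_eq_mul,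
      ← mul_assoc, ← sq, Real.log_mul hc2.ne' (hpos x).ne', mul_add]
  have hdet' : Real.log ((c • A).det ^ 2) = k * Real.log (c ^ 2) + Real.log (A.det ^ 2) := by
    rw [Matrix.det_smul, Fintype.card_fin, mul_pow, ← pow_mul, mul_comm k 2, pow_mul,
      Real.log_mul (pow_ne_zero _ hc2.ne') (pow_ne_zero _ hdet), Real.log_pow]
  simp_rw [hterm]
  rw [Finset.sum_add_distrib, ← Finset.sum_mul, hM, hdet']
  have hk' : (k : ℝ) ≠ 0 := by exact_mod_cast hkpos.ne'
  field_simp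
  ring


/-! ### V.2 Weighted layer cake and coercivity -/

/-- **Weighted layer-cake (Abel summation) inequality.**  Let `λ : [k] → ℝ_{>0}` (`k ≥ 1`),
`f : X → [k]`, weights `μ ≥ 0` of total mass `M`, and `s ≥ 0`, such that for every threshold `t`
whose upper set `U_t = {j : t ≤ λ_j}` is a nonempty proper subset, the points `x` with `λ_{f(x)} < t`
have mass at most `(M/k)(k − |U_t|) − s`.  Then for all `j_M, j_m`:
`s·(log λ_{j_M} − log λ_{j_m}) ≤ ∑_x μ_x log λ_{f(x)} − (M/k) ∑_j log λ_j`.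
(Sort the `λ_j`; telescope `log` along the sorted order; at every level with a positive gap the
weighted count falls short of the proportional count by at least `s`.) [folklore] -/
private theorem layer_cake_w {X : Type*} [Fintype X] {k : ℕ} (hk : 1 ≤ k)
    (μ : X → ℝ) (hμ : ∀ x, 0 ≤ μ x) (M : ℝ) (hM : ∑ x, μ x = M) {s : ℝ} (hs : 0 ≤ s)
    (lam : Fin k → ℝ) (hpos : ∀ j, 0 < lam j) (f : X → Fin k)
    (hcount : ∀ t : ℝ, (Finset.univ.filter fun j => t ≤ lam j).Nonempty →
      (Finset.univ.filter fun j => t ≤ lam j).card < k →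
      ∑ x ∈ Finset.univ.filter (fun x => lam (f x) < t), μ x ≤
        M / k * ((k : ℝ) - (Finset.univ.filter fun j => t ≤ lam j).card) - s)
    (jM jm : Fin k) :
    s * (Real.log (lam jM) - Real.log (lam jm)) ≤
      ∑ x, μ x * Real.log (lam (f x)) - M / k * ∑ j, Real.log (lam j) := by
  classical
  -- sort the eigenvalues
  set σ : Equiv.Perm (Fin k) := Tuple.sort lam with hσ
  have hmono : Monotone (lam ∘ σ) := Tuple.monotone_sort lam
  -- positions as naturals, values by position
  let idx : ℕ → Fin k := fun m => ⟨min m (k - 1), by omega⟩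
  have hidx : ∀ m, m < k → (idx m : ℕ) = m := fun m hm => by simp [idx]; omega
  have hidx_mono : Monotone idx := fun a b hab => by
    show min a (k - 1) ≤ min b (k - 1)
    exact min_le_min_right _ hab
  let ν : ℕ → ℝ := fun m => Real.log (lam (σ (idx m)))
  have hνmono : Monotone ν := fun a b hab =>
    Real.log_le_log (hpos _) (hmono (hidx_mono hab))
  set g : ℕ → ℝ := fun l => ν (l + 1) - ν l with hgdef
  have hg0 : ∀ l, 0 ≤ g l := fun l => sub_nonneg.mpr (hνmono (Nat.le_succ l))
  let p : X → ℕ := fun x => (σ.symm (f x) : ℕ)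
  have hplt : ∀ x, p x < k := fun x => (σ.symm (f x)).isLt
  have hidxp : ∀ x, idx (p x) = σ.symm (f x) := fun x => Fin.ext (hidx _ (hplt x))
  have hνp : ∀ x, ν (p x) = Real.log (lam (f x)) := by
    intro x; simp only [ν, hidxp, Equiv.apply_symm_apply]
  -- telescoping
  have htel : ∀ m, ν m = ν 0 + ∑ l ∈ Finset.range m, g l := by
    intro m
    rw [Finset.sum_range_sub (f := ν), add_sub_cancel]
  have htel' : ∀ m, m ≤ k - 1 →
      ν m = ν 0 + ∑ l ∈ Finset.range (k - 1), (if l < m then g l else 0) := by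
    intro m hm; rw [sum_range_ite_lt _ _ hm, htel m]
  -- the two sums, level by level
  have hA : ∑ x, μ x * Real.log (lam (f x)) = M * ν 0 +
      ∑ l ∈ Finset.range (k - 1), g l * ∑ x ∈ Finset.univ.filter (fun x => l < p x), μ x := by
    calc ∑ x, μ x * Real.log (lam (f x)) = ∑ x, μ x * ν (p x) := by simp_rw [hνp]
      _ = ∑ x, (μ x * ν 0 +
            ∑ l ∈ Finset.range (k - 1), (if l < p x then μ x * g l else 0)) := by
          refine Finset.sum_congr rfl fun x _ => ?_
          rw [htel' (p x) (by have := hplt x; omega), mul_add, Finset.mul_sum]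
          congr 1
          exact Finset.sum_congr rfl fun l _ => by rw [mul_ite, mul_zero]
      _ = M * ν 0 + ∑ x, ∑ l ∈ Finset.range (k - 1), (if l < p x then μ x * g l else 0) := by
          rw [Finset.sum_add_distrib, ← Finset.sum_mul, hM]
      _ = M * ν 0 + ∑ l ∈ Finset.range (k - 1), g l *
            ∑ x ∈ Finset.univ.filter (fun x => l < p x), μ x := by
          congr 1
          rw [Finset.sum_comm]
          refine Finset.sum_congr rfl fun l _ => ?_
          rw [← Finset.sum_filter, Finset.mul_sum]
          exact Finset.sum_congr rfl fun x _ => mul_comm _ _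
  have hB : ∑ j, Real.log (lam j) = k * ν 0 +
      ∑ l ∈ Finset.range (k - 1), g l * ((k : ℝ) - 1 - l) := by
    have h1 : ∑ j, Real.log (lam j) = ∑ i : Fin k, ν i := by
      rw [← Equiv.sum_comp σ (fun j => Real.log (lam j))]
      refine Finset.sum_congr rfl fun i _ => ?_
      simp only [ν]
      exact congrArg (fun j => Real.log (lam (σ j))) (Fin.ext (hidx i i.isLt)).symm
    rw [h1, Fin.sum_univ_eq_sum_range (fun m => ν m) k]
    calc ∑ m ∈ Finset.range k, ν m
        = ∑ m ∈ Finset.range k, (ν 0 + ∑ l ∈ Finset.range (k - 1), (if l < m then g l else 0)) :=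
          Finset.sum_congr rfl fun m hm => htel' m (by have := Finset.mem_range.mp hm; omega)
      _ = k * ν 0 + ∑ m ∈ Finset.range k, ∑ l ∈ Finset.range (k - 1),
            (if l < m then g l else 0) := by
          rw [Finset.sum_add_distrib, Finset.sum_const, Finset.card_range, nsmul_eq_mul]
      _ = k * ν 0 + ∑ l ∈ Finset.range (k - 1), g l * ((k : ℝ) - 1 - l) := by
          congr 1
          rw [Finset.sum_comm]
          refine Finset.sum_congr rfl fun l hl => ?_
          rw [← Finset.sum_filter, Finset.sum_const, nsmul_eq_mul, mul_comm]
          congr 1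
          have hl' := Finset.mem_range.mp hl
          have : (Finset.range k).filter (fun m => l < m) = Finset.Ico (l + 1) k := by
            ext m; simp [Finset.mem_filter, Finset.mem_range, Finset.mem_Ico]; omega
          rw [this, Nat.card_Ico]
          have : l + 1 ≤ k := by omega
          rw [Nat.cast_sub this]
          push_cast
          ring
  -- nonnegativity of `M / k`
  have hkpos : (0 : ℝ) < k := by exact_mod_cast hk
  have hM0 : 0 ≤ M := by rw [← hM]; exact Finset.sum_nonneg fun x _ => hμ x
  have hMk : 0 ≤ M / k := div_nonneg hM0 hkpos.le
  -- complement masses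
  have hcompl : ∀ l, ∑ x ∈ Finset.univ.filter (fun x => l < p x), μ x =
      M - ∑ x ∈ Finset.univ.filter (fun x => ¬ l < p x), μ x := by
    intro l
    have := Finset.sum_filter_add_sum_filter_not (Finset.univ : Finset X) (fun x => l < p x) μ
    rw [hM] at this
    linarith
  -- the weighted count at each level with a positive gap
  have hN : ∀ l, l < k - 1 → g l * s ≤
      g l * (∑ x ∈ Finset.univ.filter (fun x => l < p x), μ x - M / k * ((k : ℝ) - 1 - l)) := by
    intro l hl
    rcases eq_or_lt_of_le (hg0 l) with h0 | hpos'
    · rw [← h0]; simp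
    refine mul_le_mul_of_nonneg_left ?_ (hg0 l)
    -- threshold `t = λ_{σ(l+1)}`
    have hl1 : l + 1 < k := by omega
    set t : ℝ := lam (σ ⟨l + 1, hl1⟩) with ht
    have hgap : lam (σ ⟨l, by omega⟩) < t := by
      have : ν l < ν (l + 1) := by
        have := hpos'; simp only [hgdef] at this; linarith
      simp only [ν] at this
      have e1 : idx l = ⟨l, by omega⟩ := Fin.ext (hidx l (by omega))
      have e2 : idx (l + 1) = ⟨l + 1, hl1⟩ := Fin.ext (hidx (l + 1) hl1)
      rw [e1, e2] at this
      exact (Real.log_lt_log_iff (hpos _) (hpos _)).mp this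
    set Ut := Finset.univ.filter fun j => t ≤ lam j with hUt
    have hUt_ne : Ut.Nonempty := ⟨σ ⟨l + 1, hl1⟩, by simp [hUt, ht]⟩
    have hUt_lt : Ut.card < k := by
      have : σ ⟨l, by omega⟩ ∉ Ut := by simp [hUt, not_le.mpr hgap]
      calc Ut.card < (Finset.univ : Finset (Fin k)).card :=
            Finset.card_lt_card (Finset.ssubset_iff_subset_ne.mpr ⟨Finset.subset_univ _,
              fun h => this (h ▸ Finset.mem_univ _)⟩)
        _ = k := by simp
    have hUt_ge : k - (l + 1) ≤ Ut.card := by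
      have hsub : (Finset.univ.filter fun m : Fin k => l + 1 ≤ (m : ℕ)).image σ ⊆ Ut := by
        intro j hj
        obtain ⟨m, hm, rfl⟩ := Finset.mem_image.mp hj
        simp only [Finset.mem_filter, Finset.mem_univ, true_and] at hm
        simp only [hUt, Finset.mem_filter, Finset.mem_univ, true_and, ht]
        exact hmono (show (⟨l + 1, hl1⟩ : Fin k) ≤ m from hm)
      calc k - (l + 1) = (Finset.Ici (⟨l + 1, hl1⟩ : Fin k)).card := by rw [Fin.card_Ici]
        _ = ((Finset.univ.filter fun m : Fin k => l + 1 ≤ (m : ℕ))).card := by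
            congr 1; ext m; simp [Finset.mem_Ici, Fin.le_def]
        _ = ((Finset.univ.filter fun m : Fin k => l + 1 ≤ (m : ℕ)).image σ).card :=
            (Finset.card_image_of_injective _ σ.injective).symm
        _ ≤ Ut.card := Finset.card_le_card hsub
    have hc := hcount t hUt_ne hUt_lt
    -- `{x : p x ≤ l} ⊆ {x : λ_{f x} < t}`
    have hsub2 : (Finset.univ.filter fun x => ¬ l < p x) ⊆
        (Finset.univ.filter fun x => lam (f x) < t) := by
      intro x hx
      simp only [Finset.mem_filter, Finset.mem_univ, true_and, not_lt] at hx ⊢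
      have h1 : lam (f x) = (lam ∘ σ) (σ.symm (f x)) := by simp
      rw [h1]
      calc (lam ∘ σ) (σ.symm (f x)) ≤ (lam ∘ σ) ⟨l, by omega⟩ := hmono (show _ ≤ _ from by
              change (σ.symm (f x) : ℕ) ≤ l; exact hx)
        _ < t := hgap
    have h3 : ∑ x ∈ Finset.univ.filter (fun x => ¬ l < p x), μ x ≤
        M / k * ((k : ℝ) - Ut.card) - s :=
      (Finset.sum_le_sum_of_subset_of_nonneg hsub2 fun x _ _ => hμ x).trans hc
    have h4 : (k : ℝ) ≤ Ut.card + (l + 1) := by exact_mod_cast (by omega : k ≤ Ut.card + (l + 1))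
    have h5 : M / k * ((k : ℝ) - Ut.card) ≤ M / k * ((l : ℝ) + 1) :=
      mul_le_mul_of_nonneg_left (by linarith) hMk
    have h6 : M / k * ((k : ℝ) - 1 - l) = M - M / k * ((l : ℝ) + 1) := by
      field_simp
      ring
    rw [hcompl l]
    linarith
  -- assemble
  have hD : ∑ x, μ x * Real.log (lam (f x)) - M / k * ∑ j, Real.log (lam j) =
      ∑ l ∈ Finset.range (k - 1), g l *
        (∑ x ∈ Finset.univ.filter (fun x => l < p x), μ x - M / k * ((k : ℝ) - 1 - l)) := by
    rw [hA, hB, mul_add, Finset.mul_sum]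
    have : M / k * (k * ν 0) = M * ν 0 := by field_simp
    rw [this]
    rw [show M * ν 0 + ∑ l ∈ Finset.range (k - 1), g l *
          ∑ x ∈ Finset.univ.filter (fun x => l < p x), μ x -
        (M * ν 0 + ∑ l ∈ Finset.range (k - 1), M / k * (g l * ((k : ℝ) - 1 - l))) =
        ∑ l ∈ Finset.range (k - 1), g l * ∑ x ∈ Finset.univ.filter (fun x => l < p x), μ x -
        ∑ l ∈ Finset.range (k - 1), M / k * (g l * ((k : ℝ) - 1 - l)) by ring]
    rw [← Finset.sum_sub_distrib]
    exact Finset.sum_congr rfl fun l _ => by ring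
  have hlow : ∑ l ∈ Finset.range (k - 1), g l * s ≤
      ∑ l ∈ Finset.range (k - 1), g l *
        (∑ x ∈ Finset.univ.filter (fun x => l < p x), μ x - M / k * ((k : ℝ) - 1 - l)) :=
    Finset.sum_le_sum fun l hl => hN l (Finset.mem_range.mp hl)
  have hsumg : ∑ l ∈ Finset.range (k - 1), g l = ν (k - 1) - ν 0 := Finset.sum_range_sub ν (k - 1)
  have hends : Real.log (lam jM) - Real.log (lam jm) ≤ ν (k - 1) - ν 0 := by
    have hM' : Real.log (lam jM) ≤ ν (k - 1) := by
      simp only [ν]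
      refine Real.log_le_log (hpos _) ?_
      have : lam jM = (lam ∘ σ) (σ.symm jM) := by simp
      rw [this]
      exact hmono (show σ.symm jM ≤ idx (k - 1) from by
        change (σ.symm jM : ℕ) ≤ min (k - 1) (k - 1); have := (σ.symm jM).isLt; omega)
    have hm : ν 0 ≤ Real.log (lam jm) := by
      simp only [ν]
      refine Real.log_le_log (hpos _) ?_
      have : lam jm = (lam ∘ σ) (σ.symm jm) := by simp
      rw [this]
      exact hmono (show idx 0 ≤ σ.symm jm from by change min 0 (k - 1) ≤ (σ.symm jm : ℕ); omega)
    linarith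
  calc s * (Real.log (lam jM) - Real.log (lam jm))
      ≤ s * (ν (k - 1) - ν 0) := mul_le_mul_of_nonneg_left hends hs
    _ = ∑ l ∈ Finset.range (k - 1), g l * s := by rw [← Finset.sum_mul, hsumg, mul_comm]
    _ ≤ _ := hlow
    _ = _ := hD.symm

/-- **Weighted coercivity of the log-volume functional on the unit Frobenius sphere.**  Let
`u : X → ℝ^k` (`k ≥ 1`) with `‖u_x‖² ≥ kδ₀` (`δ₀ > 0`), weights `μ ≥ 0` of total mass `M`, and a
slack `s ≥ 0` such that for every orthonormal basis `(e_j)` and every nonempty `U ⊊ [k]` the points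
`x` with `⟨e_i,u_x⟩² < δ₀` for all `i ∈ U` have mass at most `(M/k)(k − |U|) − s`.  Then for every
`A` with `∑ A_{ij}² = 1` and `det A ≠ 0`,
`M log δ₀ − s log k + (s/k) log(1/(det A)²) ≤ ∑_x μ_x log ‖Au_x‖² − (M/k) log (det A)²`.
[cite: Forster2002, Lemma 4.2 (compactness; weighted variational form)] -/
theorem coercive_bound_w {X : Type*} [Fintype X] {k : ℕ} (u : X → Fin k → ℝ) (hk : 1 ≤ k)
    (μ : X → ℝ) (hμ : ∀ x, 0 ≤ μ x) (M : ℝ) (hM : ∑ x, μ x = M) {s : ℝ} (hs : 0 ≤ s)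
    {δ₀ : ℝ} (hδ₀ : 0 < δ₀) (hδu : ∀ x, (k : ℝ) * δ₀ ≤ u x ⬝ᵥ u x)
    (hGP : ∀ e : Fin k → Fin k → ℝ, (∀ i j, e i ⬝ᵥ e j = if i = j then 1 else 0) →
      ∀ U : Finset (Fin k), U.Nonempty → U.card < k →
        ∑ x ∈ Finset.univ.filter (fun x => ∀ i ∈ U, (e i ⬝ᵥ u x) ^ 2 < δ₀), μ x ≤
          M / k * ((k : ℝ) - U.card) - s)
    (A : Matrix (Fin k) (Fin k) ℝ) (hA1 : ∑ i, ∑ j, A i j ^ 2 = 1) (hAdet : A.det ≠ 0) :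
    M * Real.log δ₀ - s * Real.log k + s / k * Real.log (1 / A.det ^ 2) ≤
    ∑ x, μ x * Real.log ((A *ᵥ u x) ⬝ᵥ (A *ᵥ u x)) - M / k * Real.log (A.det ^ 2) := by
  classical
  obtain ⟨lam, e, horth, hexp, hpars, htr, hdet, hnn⟩ := spectral_data A
  have hkpos : (0 : ℝ) < k := by exact_mod_cast hk
  -- positivity of the eigenvalues
  have hdet2 : 0 < A.det ^ 2 := by positivity
  have hlpos : ∀ j, 0 < lam j := by
    intro j
    rcases eq_or_lt_of_le (hnn j) with h0 | hpos
    · exfalso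
      have : ∏ i, lam i = 0 := Finset.prod_eq_zero (Finset.mem_univ j) h0.symm
      rw [hdet] at this
      exact hdet2.ne' this
    · exact hpos
  have hsum1 : ∑ j, lam j = 1 := by rw [htr, hA1]
  -- for each `x`, the largest eigenvalue among the directions that see `u_x`
  have hJ : ∀ x, ∃ j, δ₀ ≤ (e j ⬝ᵥ u x) ^ 2 ∧ ∀ j', δ₀ ≤ (e j' ⬝ᵥ u x) ^ 2 → lam j' ≤ lam j := by
    intro x
    have hne : (Finset.univ.filter fun j => δ₀ ≤ (e j ⬝ᵥ u x) ^ 2).Nonempty := by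
      by_contra hemp
      rw [Finset.not_nonempty_iff_eq_empty] at hemp
      have hall : ∀ j, (e j ⬝ᵥ u x) ^ 2 < δ₀ := by
        intro j
        by_contra hj
        have : j ∈ (Finset.univ.filter fun j => δ₀ ≤ (e j ⬝ᵥ u x) ^ 2) := by
          simp [not_lt.mp hj]
        rw [hemp] at this
        exact absurd this (Finset.notMem_empty j)
      have hlt : u x ⬝ᵥ u x < k * δ₀ := by
        rw [hpars]
        calc ∑ j, (e j ⬝ᵥ u x) ^ 2 < ∑ _j : Fin k, δ₀ :=
              Finset.sum_lt_sum_of_nonempty ⟨⟨0, hk⟩, Finset.mem_univ _⟩ fun j _ => hall j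
          _ = k * δ₀ := by rw [Finset.sum_const, Finset.card_univ, Fintype.card_fin, nsmul_eq_mul]
      linarith [hδu x]
    obtain ⟨j, hj, hmax⟩ := Finset.exists_max_image _ lam hne
    refine ⟨j, (Finset.mem_filter.mp hj).2, fun j' hj' => hmax j' ?_⟩
    simp [hj']
  choose f hf hfmax using hJ
  -- `‖A u_x‖² ≥ λ_{f x} δ₀`
  have hAu : ∀ x, lam (f x) * δ₀ ≤ (A *ᵥ u x) ⬝ᵥ (A *ᵥ u x) := by
    intro x
    rw [hexp]
    calc lam (f x) * δ₀ ≤ lam (f x) * (e (f x) ⬝ᵥ u x) ^ 2 :=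
          mul_le_mul_of_nonneg_left (hf x) (hnn _)
      _ ≤ ∑ j, lam j * (e j ⬝ᵥ u x) ^ 2 :=
          Finset.single_le_sum (f := fun j => lam j * (e j ⬝ᵥ u x) ^ 2)
            (fun j _ => mul_nonneg (hnn j) (sq_nonneg _)) (Finset.mem_univ (f x))
  have hlogAu : ∀ x, μ x * Real.log δ₀ + μ x * Real.log (lam (f x)) ≤
      μ x * Real.log ((A *ᵥ u x) ⬝ᵥ (A *ᵥ u x)) := by
    intro x
    rw [← mul_add, ← Real.log_mul hδ₀.ne' (hlpos _).ne', mul_comm δ₀]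
    exact mul_le_mul_of_nonneg_left (Real.log_le_log (mul_pos (hlpos _) hδ₀) (hAu x)) (hμ x)
  -- the counting hypothesis of the weighted layer cake
  have hcount : ∀ t : ℝ, (Finset.univ.filter fun j => t ≤ lam j).Nonempty →
      (Finset.univ.filter fun j => t ≤ lam j).card < k →
      ∑ x ∈ Finset.univ.filter (fun x => lam (f x) < t), μ x ≤
        M / k * ((k : ℝ) - (Finset.univ.filter fun j => t ≤ lam j).card) - s := by
    intro t hne hlt
    refine le_trans (Finset.sum_le_sum_of_subset_of_nonneg ?_ fun x _ _ => hμ x)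
      (hGP e horth _ hne hlt)
    intro x hx
    simp only [Finset.mem_filter, Finset.mem_univ, true_and] at hx ⊢
    intro i hi
    by_contra hge
    have := hfmax x i (not_lt.mp hge)
    linarith
  -- layer cake with `jM` = argmax, `jm` = argmin of `λ`
  obtain ⟨jM, -, hjM⟩ := Finset.exists_max_image Finset.univ lam ⟨⟨0, hk⟩, Finset.mem_univ _⟩
  obtain ⟨jm, -, hjm⟩ := Finset.exists_min_image Finset.univ lam ⟨⟨0, hk⟩, Finset.mem_univ _⟩
  have hcake := layer_cake_w hk μ hμ M hM hs lam hlpos f hcount jM jm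
  -- `λ_max ≥ 1/k`, `k log λ_min ≤ log det²`
  have hmax : 1 / (k : ℝ) ≤ lam jM := by
    have h2 : ∑ j, lam j ≤ ∑ _j : Fin k, lam jM :=
      Finset.sum_le_sum fun j _ => hjM j (Finset.mem_univ _)
    rw [Finset.sum_const, Finset.card_univ, Fintype.card_fin, nsmul_eq_mul, hsum1] at h2
    rw [div_le_iff₀ hkpos]; linarith
  have hlogdet : Real.log (A.det ^ 2) = ∑ j, Real.log (lam j) := by
    rw [← hdet, Real.log_prod (s := Finset.univ) (fun j _ => (hlpos j).ne')]
  have hmin : (k : ℝ) * Real.log (lam jm) ≤ Real.log (A.det ^ 2) := by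
    rw [hlogdet]
    calc (k : ℝ) * Real.log (lam jm) = ∑ _j : Fin k, Real.log (lam jm) := by
          rw [Finset.sum_const, Finset.card_univ, Fintype.card_fin, nsmul_eq_mul]
      _ ≤ ∑ j, Real.log (lam j) :=
          Finset.sum_le_sum fun j _ => Real.log_le_log (hlpos _) (hjm j (Finset.mem_univ _))
  rw [← hlogdet] at hcake
  -- assemble
  have hS : M * Real.log δ₀ + ∑ x, μ x * Real.log (lam (f x)) ≤
      ∑ x, μ x * Real.log ((A *ᵥ u x) ⬝ᵥ (A *ᵥ u x)) := by
    calc M * Real.log δ₀ + ∑ x, μ x * Real.log (lam (f x))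
        = ∑ x, (μ x * Real.log δ₀ + μ x * Real.log (lam (f x))) := by
          rw [Finset.sum_add_distrib, ← Finset.sum_mul, hM]
      _ ≤ _ := Finset.sum_le_sum fun x _ => hlogAu x
  have hlogk : Real.log (lam jM) ≥ -Real.log k := by
    have := Real.log_le_log (by positivity) hmax
    rw [one_div, Real.log_inv] at this
    exact this
  have hlogmin : Real.log (lam jm) ≤ (1 / k) * Real.log (A.det ^ 2) := by
    rw [one_div, le_inv_mul_iff₀ hkpos]; exact hmin
  rw [one_div, Real.log_inv]
  have h1 : s * (Real.log (lam jM) - Real.log (lam jm)) ≥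
      s * (-Real.log k - (1 / k) * Real.log (A.det ^ 2)) :=
    mul_le_mul_of_nonneg_left (by linarith) hs
  have h2 : s * (-Real.log k - (1 / k) * Real.log (A.det ^ 2)) =
      -(s * Real.log k) + s / k * (-Real.log (A.det ^ 2)) := by
    field_simp; ring
  linarith [hcake, hS, h1, h2]


/-! ### V.3 The slack of the strict subspace-mass inequality (compactness over frames) -/

/-- For an orthonormal frame `e` of `ℝ^k` and `U ⊆ [k]`, the vectors orthogonal to all `e_i`
(`i ∈ U`) form a submodule of dimension `k − |U|` (rank–nullity for `v ↦ (⟨e_i,v⟩)_{i∈U}`, which is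
onto). [folklore] -/
private theorem exists_orthSubmodule {k : ℕ} (e : Fin k → Fin k → ℝ)
    (he : ∀ i j, e i ⬝ᵥ e j = if i = j then 1 else 0) (U : Finset (Fin k)) :
    ∃ W : Submodule ℝ (Fin k → ℝ), (∀ v, v ∈ W ↔ ∀ i ∈ U, e i ⬝ᵥ v = 0) ∧
      Module.finrank ℝ W = k - U.card := by
  classical
  -- the linear map `v ↦ (⟨e_i, v⟩)_{i ∈ U}`
  let L : (Fin k → ℝ) →ₗ[ℝ] (U → ℝ) := (Matrix.of fun (i : U) (j : Fin k) => e i j).mulVecLin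
  have hL : ∀ v (i : U), L v i = e i ⬝ᵥ v := fun v i => rfl
  refine ⟨LinearMap.ker L, fun v => ?_, ?_⟩
  · rw [LinearMap.mem_ker]
    constructor
    · intro hv i hi
      have := congrFun hv ⟨i, hi⟩
      rwa [hL] at this
    · intro hv
      ext i
      rw [hL]; exact hv i i.2
  · -- `L` is onto: `L (∑_{i∈U} c_i e_i) = c`
    have hsurj : LinearMap.range L = ⊤ := by
      rw [LinearMap.range_eq_top]
      intro c
      refine ⟨∑ i : U, c i • e i, ?_⟩
      ext i
      rw [hL, dotProduct_sum]
      simp_rw [dotProduct_smul, smul_eq_mul, he]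
      rw [Finset.sum_eq_single i]
      · simp
      · intro j _ hji
        rw [if_neg (fun h => hji (Subtype.ext h).symm), mul_zero]
      · intro hi; exact absurd (Finset.mem_univ i) hi
    have hrn := LinearMap.finrank_range_add_finrank_ker L
    rw [hsurj, finrank_top, Module.finrank_fintype_fun_eq_card, Fintype.card_coe,
      Module.finrank_fin_fun] at hrn
    omega

/-- **The slack of the strict subspace-mass inequality, in quantitative form.**  Let `u : X → ℝ^k`
(`k ≥ 1`) be nonzero vectors with weights `μ > 0` of total mass `M > 0` such that every nonzero
proper subspace `W` satisfies `k·μ{x : u_x ∈ W} < dim W · M`.  Then there are `δ₀ > 0` with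
`‖u_x‖² ≥ kδ₀` and `s > 0` such that for every orthonormal basis `(e_j)` and every nonempty
`U ⊊ [k]`, the points `x` with `⟨e_i,u_x⟩² < δ₀` for all `i ∈ U` have mass at most
`(M/k)(k − |U|) − s`.  (The quantity `d·M − k·μ(T)` takes finitely many values, so the strict
inequalities have a uniform slack `s₁`; then for each heavy pair `(U, T)` the continuous function
`e ↦ ∑_{x∈T}∑_{i∈U}⟨e_i,u_x⟩²` is positive on the compact set of orthonormal frames, as in
`exists_quantGP`.) [cite: Forster2002, Lemma 4.2 (compactness); DiakonikolasKaneTzamos2021, Theorem 2.1] -/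
theorem exists_slack {X : Type*} [Fintype X] [DecidableEq X] {k : ℕ} (hk : 1 ≤ k)
    (u : X → Fin k → ℝ) (μ : X → ℝ) (hu : ∀ x, u x ≠ 0) (M : ℝ)
    (hM : ∑ x, μ x = M) (hMpos : 0 < M)
    (hB : ∀ W : Submodule ℝ (Fin k → ℝ), W ≠ ⊥ → W ≠ ⊤ → ∀ T : Finset X,
      (∀ x ∈ T, u x ∈ W) → (k : ℝ) * ∑ x ∈ T, μ x < Module.finrank ℝ W * M) :
    ∃ δ₀ s : ℝ, 0 < δ₀ ∧ 0 < s ∧ (∀ x, (k : ℝ) * δ₀ ≤ u x ⬝ᵥ u x) ∧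
      ∀ e : Fin k → Fin k → ℝ, (∀ i j, e i ⬝ᵥ e j = if i = j then 1 else 0) →
        ∀ U : Finset (Fin k), U.Nonempty → U.card < k →
          ∑ x ∈ Finset.univ.filter (fun x => ∀ i ∈ U, (e i ⬝ᵥ u x) ^ 2 < δ₀), μ x ≤
            M / k * ((k : ℝ) - U.card) - s := by
  classical
  have hkpos : (0 : ℝ) < k := by exact_mod_cast hk
  -- Step 1: the uniform slack `s₁` of the strict inequalities `k μ(T) < d M`
  set vals : Finset ℝ := ((Finset.univ : Finset (Finset X)) ×ˢ Finset.range (k + 1)).image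
    fun q => (q.2 : ℝ) * M - k * ∑ x ∈ q.1, μ x with hvals
  set pos : Finset ℝ := vals.filter fun v => 0 < v with hposdef
  have hmem : ∀ (T : Finset X) (d : ℕ), d ≤ k → (k : ℝ) * ∑ x ∈ T, μ x < d * M →
      (d : ℝ) * M - k * ∑ x ∈ T, μ x ∈ pos := by
    intro T d hd hlt
    rw [hposdef, Finset.mem_filter]
    refine ⟨?_, by linarith⟩
    rw [hvals, Finset.mem_image]
    exact ⟨(T, d), Finset.mem_product.mpr ⟨Finset.mem_univ _, Finset.mem_range.mpr (by omega)⟩,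
      rfl⟩
  have hposne : pos.Nonempty :=
    ⟨_, hmem ∅ k le_rfl (by rw [Finset.sum_empty, mul_zero]; exact mul_pos hkpos hMpos)⟩
  set s₁ : ℝ := pos.min' hposne with hs₁
  have hs₁pos : 0 < s₁ := by
    have := Finset.min'_mem pos hposne
    rw [← hs₁] at this
    exact (Finset.mem_filter.mp this).2
  have hs₁le : ∀ (T : Finset X) (d : ℕ), d ≤ k → (k : ℝ) * ∑ x ∈ T, μ x < d * M →
      s₁ ≤ d * M - k * ∑ x ∈ T, μ x := fun T d hd hlt => Finset.min'_le pos _ (hmem T d hd hlt)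
  set s : ℝ := s₁ / k with hsdef
  have hspos : 0 < s := div_pos hs₁pos hkpos
  -- Step 2: points orthogonal to `e_U` (frame `e`, nonempty proper `U`) are light
  set O := {e : Fin k → Fin k → ℝ | ∀ i j, e i ⬝ᵥ e j = if i = j then 1 else 0} with hO
  have hlight : ∀ e ∈ O, ∀ U : Finset (Fin k), U.Nonempty → U.card < k → ∀ T : Finset X,
      (∀ x ∈ T, ∀ i ∈ U, e i ⬝ᵥ u x = 0) →
      ∑ x ∈ T, μ x ≤ M / k * ((k : ℝ) - U.card) - s := by
    intro e he U hUne hUk T hT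
    obtain ⟨W, hWmem, hWdim⟩ := exists_orthSubmodule e he U
    -- `W ≠ ⊤`: `e_{i₀} ∉ W`
    obtain ⟨i₀, hi₀⟩ := hUne
    have hWtop : W ≠ ⊤ := by
      intro htop
      have : e i₀ ∈ W := by rw [htop]; exact Submodule.mem_top
      have h1 := (hWmem _).mp this i₀ hi₀
      rw [he, if_pos rfl] at h1
      exact one_ne_zero h1
    -- `W ≠ ⊥`: `e_j ∈ W` for some `j ∉ U`
    have hWbot : W ≠ ⊥ := by
      obtain ⟨j, hj⟩ : ∃ j : Fin k, j ∉ U := by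
        by_contra h
        push Not at h
        have : U = Finset.univ := Finset.eq_univ_of_forall h
        rw [this, Finset.card_univ, Fintype.card_fin] at hUk
        exact lt_irrefl _ hUk
      intro hbot
      have hjW : e j ∈ W := by
        rw [hWmem]
        intro i hi
        have hij : i ≠ j := fun h => hj (h ▸ hi)
        rw [he, if_neg hij]
      rw [hbot, Submodule.mem_bot] at hjW
      have h1 := he j j
      rw [hjW, if_pos rfl] at h1
      simp at h1
    have hTW : ∀ x ∈ T, u x ∈ W := fun x hx => (hWmem _).mpr (hT x hx)
    have hlt := hB W hWbot hWtop T hTW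
    rw [hWdim] at hlt
    have hle := hs₁le T (k - U.card) (Nat.sub_le _ _) hlt
    rw [Nat.cast_sub hUk.le] at hle
    have h2 : ∑ x ∈ T, μ x ≤ (((k : ℝ) - U.card) * M - s₁) / k := by
      rw [le_div_iff₀ hkpos]; linarith
    calc ∑ x ∈ T, μ x ≤ (((k : ℝ) - U.card) * M - s₁) / k := h2
      _ = M / k * ((k : ℝ) - U.card) - s := by rw [hsdef]; ring
  -- Step 3: compactness over orthonormal frames
  have hOc : IsCompact O := isCompact_orthonormalFrames k
  have hOne : O.Nonempty := ⟨fun i => Pi.single i 1, fun i j => by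
    show Pi.single i (1 : ℝ) ⬝ᵥ Pi.single j 1 = _
    rw [dotProduct_single, mul_one, Pi.single_apply]
    by_cases h : i = j
    · subst h; simp
    · rw [if_neg (Ne.symm h), if_neg h]⟩
  let g : Finset (Fin k) × Finset X → (Fin k → Fin k → ℝ) → ℝ :=
    fun q e => ∑ x ∈ q.2, ∑ i ∈ q.1, (e i ⬝ᵥ u x) ^ 2
  have hgcont : ∀ q, Continuous (g q) := by
    intro q
    simp only [g, dotProduct]
    fun_prop
  -- the heavy pairs and the positivity of `g` on frames
  set P : Finset (Finset (Fin k) × Finset X) := (Finset.univ ×ˢ Finset.univ).filter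
    fun q => q.1.Nonempty ∧ q.1.card < k ∧
      M / k * ((k : ℝ) - q.1.card) - s < ∑ x ∈ q.2, μ x with hP
  have hgpos : ∀ q ∈ P, ∀ e ∈ O, 0 < g q e := by
    intro q hq e he
    simp only [hP, Finset.mem_filter, Finset.mem_product, Finset.mem_univ, true_and] at hq
    obtain ⟨hUne, hUk, hheavy⟩ := hq
    have hnn : 0 ≤ g q e :=
      Finset.sum_nonneg fun x _ => Finset.sum_nonneg fun i _ => sq_nonneg _
    rcases eq_or_lt_of_le hnn with h0 | hpos
    · exfalso
      have hzero : ∀ x ∈ q.2, ∀ i ∈ q.1, e i ⬝ᵥ u x = 0 := by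
        intro x hx i hi
        have h1 : ∑ x ∈ q.2, ∑ i ∈ q.1, (e i ⬝ᵥ u x) ^ 2 = 0 := h0.symm
        have h2 := (Finset.sum_eq_zero_iff_of_nonneg (fun x _ =>
          Finset.sum_nonneg fun i _ => sq_nonneg _)).mp h1 x hx
        have h3 := (Finset.sum_eq_zero_iff_of_nonneg (fun i _ => sq_nonneg _)).mp h2 i hi
        exact pow_eq_zero_iff (n := 2) (by norm_num) |>.mp h3
      have := hlight e he q.1 hUne hUk q.2 hzero
      linarith
    · exact hpos
  have hmin : ∀ q ∈ P, ∃ m : ℝ, 0 < m ∧ ∀ e ∈ O, m ≤ g q e := by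
    intro q hq
    obtain ⟨e₀, he₀, hle⟩ := hOc.exists_isMinOn hOne (hgcont q).continuousOn
    exact ⟨g q e₀, hgpos q hq e₀ he₀, fun e he => hle he⟩
  choose! m hm0 hmle using hmin
  obtain ⟨δ₁, hδ₁, hδ₁le⟩ : ∃ δ₁ : ℝ, 0 < δ₁ ∧ ∀ q ∈ P, δ₁ ≤ m q := by
    rcases P.eq_empty_or_nonempty with hPe | hPne
    · exact ⟨1, one_pos, by simp [hPe]⟩
    · obtain ⟨q₀, hq₀, hq₀min⟩ := Finset.exists_min_image P m hPne
      exact ⟨m q₀, hm0 q₀ hq₀, hq₀min⟩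
  -- the norms of the `u_x`
  have hune : ∀ x, 0 < u x ⬝ᵥ u x := fun x =>
    lt_of_le_of_ne (Finset.sum_nonneg fun l _ => mul_self_nonneg _)
      (fun h0 => hu x (dotProduct_self_eq_zero.mp h0.symm))
  obtain ⟨c, hc, hcle⟩ : ∃ c : ℝ, 0 < c ∧ ∀ x, c ≤ u x ⬝ᵥ u x := by
    rcases (Finset.univ : Finset X).eq_empty_or_nonempty with hXe | hXne
    · refine ⟨1, one_pos, fun x => ?_⟩
      have hx := Finset.mem_univ x
      rw [hXe] at hx
      exact absurd hx (Finset.notMem_empty x)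
    · obtain ⟨x₀, -, hx₀⟩ := Finset.exists_min_image Finset.univ (fun x => u x ⬝ᵥ u x) hXne
      exact ⟨u x₀ ⬝ᵥ u x₀, hune x₀, fun x => hx₀ x (Finset.mem_univ x)⟩
  -- the constant
  set N : ℕ := Fintype.card X with hN
  refine ⟨min (δ₁ / ((N : ℝ) * k + 1)) (c / k), s, lt_min (by positivity) (by positivity), hspos,
    ?_, ?_⟩
  · intro x
    calc (k : ℝ) * min (δ₁ / ((N : ℝ) * k + 1)) (c / k) ≤ k * (c / k) :=
          mul_le_mul_of_nonneg_left (min_le_right _ _) hkpos.le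
      _ = c := by field_simp
      _ ≤ u x ⬝ᵥ u x := hcle x
  · intro e he U hUne hUk
    by_contra hbad
    rw [not_le] at hbad
    set T := Finset.univ.filter fun x => ∀ i ∈ U, (e i ⬝ᵥ u x) ^ 2 <
        min (δ₁ / ((N : ℝ) * k + 1)) (c / k) with hT
    have hq : (U, T) ∈ P := by
      simp only [hP, Finset.mem_filter, Finset.mem_product, Finset.mem_univ, true_and]
      exact ⟨hUne, hUk, hbad⟩
    have h1 : δ₁ ≤ g (U, T) e := (hδ₁le _ hq).trans (hmle _ hq e he)
    have h2 : g (U, T) e < δ₁ := by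
      have hUk' : (U.card : ℝ) ≤ k := by exact_mod_cast hUk.le
      have hTN : (T.card : ℝ) ≤ N := by exact_mod_cast Finset.card_le_univ T
      calc g (U, T) e = ∑ x ∈ T, ∑ i ∈ U, (e i ⬝ᵥ u x) ^ 2 := rfl
        _ ≤ ∑ x ∈ T, ∑ i ∈ U, δ₁ / ((N : ℝ) * k + 1) := by
            refine Finset.sum_le_sum fun x hx => Finset.sum_le_sum fun i hi => ?_
            have hx' := (Finset.mem_filter.mp hx).2 i hi
            exact (lt_of_lt_of_le hx' (min_le_left _ _)).le
        _ = T.card * (U.card * (δ₁ / ((N : ℝ) * k + 1))) := by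
            rw [Finset.sum_const, nsmul_eq_mul, Finset.sum_const, nsmul_eq_mul]
        _ ≤ N * (k * (δ₁ / ((N : ℝ) * k + 1))) := by
            have hδ' : 0 ≤ δ₁ / ((N : ℝ) * k + 1) := by positivity
            exact mul_le_mul hTN (mul_le_mul_of_nonneg_right hUk' hδ') (by positivity)
              (by positivity)
        _ < δ₁ := by
            rw [← mul_assoc, mul_div_assoc', div_lt_iff₀ (by positivity)]
            nlinarith
    linarith

/-! ### V.4 Assembly: the weighted theorem -/

/-- **Generalized Forster transform (weighted radial isotropic position; Barthe, Hopkins–Kane–Lovett–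
Mahajan, Diakonikolas–Kane–Tzamos).**  Let `u : X → ℝ^k` be finitely many nonzero vectors with
weights `μ_x > 0` of total mass `M = ∑ μ_x`, such that every nonzero proper subspace `W` carries
mass `μ{x : u_x ∈ W} < (dim W / k)·M`.  Then some nonsingular `A` puts the mass distribution in
radial isotropic position: `∑_x μ_x ⟨Au_x, w⟩²/‖Au_x‖² = (M/k)‖w‖²` for every `w`, i.e.
`∑_x μ_x (Au_x)(Au_x)ᵀ/‖Au_x‖² = (M/k)·I`.  (DKT21's Thm 2.1 is the probability-weights case
`M = 1`; Forster's Thm 4.1 is `μ ≡ 1`, `|X| > k`, general position.)  Variational proof: minimize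
`Φ_μ(A) = ∑_x μ_x log ‖Au_x‖² − (M/k) log (det A)²` on `{∑A_{ij}² = 1, det(A)² ≥ η}` using
`coercive_bound_w` with the constants of `exists_slack`; the first-order condition is
`isotropic_of_isMinOn_w`. [cite: DiakonikolasKaneTzamos2021, Theorem 2.1; Forster2002, Theorem 4.1] -/
theorem exists_isotropic_w (X : Type) [Fintype X] (k : ℕ) (u : X → Fin k → ℝ) (μ : X → ℝ)
    (hμ : ∀ x, 0 < μ x) (hu : ∀ x, u x ≠ 0)
    (hB : ∀ W : Submodule ℝ (Fin k → ℝ), W ≠ ⊥ → W ≠ ⊤ → ∀ T : Finset X,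
      (∀ x ∈ T, u x ∈ W) → (k : ℝ) * ∑ x ∈ T, μ x < Module.finrank ℝ W * ∑ x, μ x) :
    ∃ A : Matrix (Fin k) (Fin k) ℝ, IsUnit A.det ∧ ∀ w : Fin k → ℝ,
      ∑ x, μ x * ((A *ᵥ u x ⬝ᵥ w) ^ 2 / (A *ᵥ u x ⬝ᵥ A *ᵥ u x)) =
        (∑ x, μ x) / k * (w ⬝ᵥ w) := by
  classical
  -- `k = 0`
  rcases Nat.eq_zero_or_pos k with hk0 | hkpos
  · subst hk0
    refine ⟨1, by simp, fun w => ?_⟩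
    simp [dotProduct]
  have hk1 : 1 ≤ k := hkpos
  have hkR : (0 : ℝ) < k := by exact_mod_cast hkpos
  set M : ℝ := ∑ x, μ x with hMdef
  -- `X` empty
  rcases isEmpty_or_nonempty X with hXe | hXne
  · refine ⟨1, by simp, fun w => ?_⟩
    simp [hMdef]
  have hMpos : 0 < M := by
    obtain ⟨x₀⟩ := hXne
    rw [hMdef]
    exact lt_of_lt_of_le (hμ x₀)
      (Finset.single_le_sum (f := μ) (fun x _ => (hμ x).le) (Finset.mem_univ x₀))
  -- the functional
  let Φ : Matrix (Fin k) (Fin k) ℝ → ℝ := fun A =>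
    ∑ x, μ x * Real.log (A *ᵥ u x ⬝ᵥ A *ᵥ u x) - M / k * Real.log (A.det ^ 2)
  -- nonvanishing of `A u_x` for invertible `A`
  have hAune : ∀ A : Matrix (Fin k) (Fin k) ℝ, A.det ≠ 0 → ∀ x, A *ᵥ u x ≠ 0 := by
    intro A hA x h
    have hinj := Matrix.mulVec_injective_iff_isUnit.mpr
      ((Matrix.isUnit_iff_isUnit_det A).mpr (isUnit_iff_ne_zero.mpr hA))
    exact hu x (hinj (h.trans (Matrix.mulVec_zero A).symm))
  -- slack and coercivity
  obtain ⟨δ₀, s, hδ₀, hs, hδu, hGPq⟩ := exists_slack hk1 u μ hu M hMdef.symm hMpos hB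
  set C₀ : ℝ := M * Real.log δ₀ - s * Real.log k with hC₀
  set κ : ℝ := s / k with hκ
  have hκpos : 0 < κ := div_pos hs hkR
  have hcoer : ∀ A : Matrix (Fin k) (Fin k) ℝ, ∑ i, ∑ j, A i j ^ 2 = 1 → A.det ≠ 0 →
      C₀ + κ * Real.log (1 / A.det ^ 2) ≤ Φ A := fun A hA1 hAd =>
    coercive_bound_w u hk1 μ (fun x => (hμ x).le) M hMdef.symm hs.le hδ₀ hδu hGPq A hA1 hAd
  -- the base point `A₁ = k^{-1/2} I`
  set A₁ : Matrix (Fin k) (Fin k) ℝ := (Real.sqrt k)⁻¹ • (1 : Matrix (Fin k) (Fin k) ℝ) with hA₁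
  have hsk : 0 < Real.sqrt k := Real.sqrt_pos.mpr hkR
  have hA₁norm : ∑ i, ∑ j, A₁ i j ^ 2 = 1 := by
    simp only [hA₁, Matrix.smul_apply, Matrix.one_apply, smul_eq_mul, mul_ite, mul_one, mul_zero]
    have : ∀ i : Fin k, ∑ j : Fin k, (if i = j then (Real.sqrt k)⁻¹ else 0) ^ 2 =
        ((Real.sqrt k)⁻¹) ^ 2 := by
      intro i
      rw [Finset.sum_eq_single i (fun j _ hji => by rw [if_neg (Ne.symm hji)]; ring) (by simp)]
      rw [if_pos rfl]
    rw [Finset.sum_congr rfl fun i _ => this i, Finset.sum_const, Finset.card_univ, Fintype.card_fin,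
      nsmul_eq_mul, inv_pow, Real.sq_sqrt (by positivity)]
    field_simp
  have hA₁det : A₁.det ≠ 0 := by
    rw [hA₁, Matrix.det_smul, Matrix.det_one, mul_one]
    exact pow_ne_zero _ (inv_ne_zero hsk.ne')
  -- the threshold `η`
  set η₀ : ℝ := Real.exp (-(Φ A₁ - C₀ + 1) / κ) with hη₀
  set η : ℝ := min η₀ (A₁.det ^ 2) with hη
  have hηpos : 0 < η := lt_min (Real.exp_pos _) (by positivity)
  -- below the threshold, `Φ` exceeds `Φ A₁`
  have hbelow : ∀ A : Matrix (Fin k) (Fin k) ℝ, ∑ i, ∑ j, A i j ^ 2 = 1 → A.det ≠ 0 →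
      A.det ^ 2 < η → Φ A₁ < Φ A := by
    intro A hA1 hAd hlt'
    have h1 := hcoer A hA1 hAd
    have hd2 : 0 < A.det ^ 2 := by positivity
    have hlt0 : A.det ^ 2 < η₀ := lt_of_lt_of_le hlt' (min_le_left _ _)
    have hlog : (Φ A₁ - C₀ + 1) / κ < Real.log (1 / A.det ^ 2) := by
      rw [one_div, Real.log_inv]
      have := Real.log_lt_log hd2 hlt0
      rw [hη₀, Real.log_exp] at this
      have h3 : Real.log (A.det ^ 2) < -(Φ A₁ - C₀ + 1) / κ := this
      have h5 : -(Φ A₁ - C₀ + 1) / κ = -((Φ A₁ - C₀ + 1) / κ) := neg_div κ (Φ A₁ - C₀ + 1)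
      linarith [h3, h5]
    have h4 : Φ A₁ - C₀ + 1 < κ * Real.log (1 / A.det ^ 2) := by
      rwa [div_lt_iff₀ hκpos, mul_comm] at hlog
    linarith
  -- the compact set
  set K : Set (Matrix (Fin k) (Fin k) ℝ) :=
    {A | ∑ i, ∑ j, A i j ^ 2 = 1 ∧ η ≤ A.det ^ 2} with hK
  have hA₁K : A₁ ∈ K := ⟨hA₁norm, min_le_right _ _⟩
  have hKdet : ∀ A ∈ K, A.det ≠ 0 := by
    intro A hA h0
    have := hA.2; rw [h0] at this; simp at this; linarith
  have hcontF : Continuous fun A : Matrix (Fin k) (Fin k) ℝ => ∑ i, ∑ j, A i j ^ 2 :=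
    continuous_finsetSum _ fun i _ => continuous_finsetSum _ fun j _ =>
      (continuous_id.matrix_elem i j).pow 2
  have hcontdet : Continuous fun A : Matrix (Fin k) (Fin k) ℝ => A.det := continuous_id.matrix_det
  have hKclosed : IsClosed K := by
    rw [hK, Set.setOf_and]
    exact (isClosed_eq hcontF continuous_const).inter (isClosed_le continuous_const (hcontdet.pow 2))
  have hKcpt : IsCompact K := by
    have hbox : IsCompact (Set.pi Set.univ fun _ : Fin k => Set.pi Set.univ fun _ : Fin k =>
        Set.Icc (-1 : ℝ) 1 : Set (Matrix (Fin k) (Fin k) ℝ)) :=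
      isCompact_univ_pi fun _ => isCompact_univ_pi fun _ => isCompact_Icc
    refine hbox.of_isClosed_subset hKclosed ?_
    intro A hA
    simp only [Set.mem_pi, Set.mem_univ, true_implies, Set.mem_Icc]
    intro i j
    have hsq : A i j ^ 2 ≤ 1 := by
      rw [← hA.1]
      calc A i j ^ 2 ≤ ∑ j', A i j' ^ 2 :=
            Finset.single_le_sum (f := fun j' => A i j' ^ 2) (fun _ _ => sq_nonneg _)
              (Finset.mem_univ j)
        _ ≤ ∑ i', ∑ j', A i' j' ^ 2 :=
            Finset.single_le_sum (f := fun i' => ∑ j', A i' j' ^ 2)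
              (fun _ _ => Finset.sum_nonneg fun _ _ => sq_nonneg _) (Finset.mem_univ i)
    constructor <;> nlinarith [sq_nonneg (A i j)]
  -- continuity of `Φ` on `K`
  have hΦcont : ContinuousOn Φ K := by
    have h1 : ∀ x, ContinuousOn (fun A : Matrix (Fin k) (Fin k) ℝ =>
        μ x * Real.log (A *ᵥ u x ⬝ᵥ A *ᵥ u x)) K := by
      intro x
      have hc : Continuous fun A : Matrix (Fin k) (Fin k) ℝ => A *ᵥ u x ⬝ᵥ A *ᵥ u x :=
        (continuous_id.matrix_mulVec continuous_const).dotProduct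
          (continuous_id.matrix_mulVec continuous_const)
      refine continuousOn_const.mul (hc.continuousOn.log fun A hA => ?_)
      have hne := hAune A (hKdet A hA) x
      exact (lt_of_le_of_ne (Finset.sum_nonneg fun l _ => mul_self_nonneg _)
        (fun h => hne (dotProduct_self_eq_zero.mp h.symm))).ne'
    have h2 : ContinuousOn (fun A : Matrix (Fin k) (Fin k) ℝ => Real.log (A.det ^ 2)) K := by
      refine (hcontdet.pow 2).continuousOn.log fun A hA => ?_
      exact pow_ne_zero 2 (hKdet A hA)
    exact (continuousOn_finsetSum _ fun x _ => h1 x).sub (continuousOn_const.mul h2)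
  -- a minimizer on `K`
  obtain ⟨A₀, hA₀K, hA₀min⟩ := hKcpt.exists_isMinOn ⟨A₁, hA₁K⟩ hΦcont
  have hA₀det : A₀.det ≠ 0 := hKdet A₀ hA₀K
  -- `A₀` is a global minimizer over invertible matrices
  have hglob : ∀ A : Matrix (Fin k) (Fin k) ℝ, IsUnit A.det → Φ A₀ ≤ Φ A := by
    intro A hAunit
    have hAd : A.det ≠ 0 := hAunit.ne_zero
    set sF : ℝ := Real.sqrt (∑ i, ∑ j, A i j ^ 2) with hsF
    have hF0 : 0 < ∑ i, ∑ j, A i j ^ 2 := by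
      by_contra hle
      have hzero : ∑ i, ∑ j, A i j ^ 2 = 0 := le_antisymm (not_lt.mp hle)
        (Finset.sum_nonneg fun _ _ => Finset.sum_nonneg fun _ _ => sq_nonneg _)
      have hA0 : A = 0 := by
        ext i j
        have h1 := (Finset.sum_eq_zero_iff_of_nonneg (fun _ _ =>
          Finset.sum_nonneg fun _ _ => sq_nonneg _)).mp hzero i (Finset.mem_univ _)
        have h2 := (Finset.sum_eq_zero_iff_of_nonneg (fun _ _ => sq_nonneg _)).mp h1 j
          (Finset.mem_univ _)
        exact pow_eq_zero_iff (n := 2) (by norm_num) |>.mp h2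
      apply hAd
      rw [hA0]
      haveI : Nonempty (Fin k) := ⟨⟨0, hkpos⟩⟩
      exact Matrix.det_zero
    have hspos : 0 < sF := Real.sqrt_pos.mpr hF0
    set A' : Matrix (Fin k) (Fin k) ℝ := sF⁻¹ • A with hA'
    have hA'norm : ∑ i, ∑ j, A' i j ^ 2 = 1 := by
      have happ : ∀ i j, A' i j = sF⁻¹ * A i j := fun i j => rfl
      calc ∑ i, ∑ j, A' i j ^ 2 = ∑ i, ∑ j, (sF⁻¹) ^ 2 * A i j ^ 2 :=
            Finset.sum_congr rfl fun i _ => Finset.sum_congr rfl fun j _ => by rw [happ, mul_pow]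
        _ = (sF⁻¹) ^ 2 * ∑ i, ∑ j, A i j ^ 2 := by
            rw [Finset.mul_sum]
            exact Finset.sum_congr rfl fun i _ => by rw [Finset.mul_sum]
        _ = 1 := by rw [inv_pow, hsF, Real.sq_sqrt hF0.le, inv_mul_cancel₀ hF0.ne']
    have hA'det : A'.det ≠ 0 := by
      rw [hA', Matrix.det_smul]
      exact mul_ne_zero (pow_ne_zero _ (inv_ne_zero hspos.ne')) hAd
    have hΦeq : Φ A' = Φ A :=
      phi_smul_w u μ M hMdef.symm A (hAune A hAd) hAd (inv_ne_zero hspos.ne')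
    rw [← hΦeq]
    by_cases hcase : η ≤ A'.det ^ 2
    · exact hA₀min ⟨hA'norm, hcase⟩
    · have h := hbelow A' hA'norm hA'det (not_le.mp hcase)
      exact (hA₀min hA₁K).trans h.le
  -- the first-order condition
  refine ⟨A₀, isUnit_iff_ne_zero.mpr hA₀det, ?_⟩
  exact isotropic_of_isMinOn_w u μ M A₀ (isUnit_iff_ne_zero.mpr hA₀det) (hAune A₀ hA₀det) hglob

/-- From the quadratic form to the matrix entries (polarisation): if
`∑_x μ_x ⟨v_x,w⟩²/‖v_x‖² = c‖w‖²` for all `w`, then `∑_x μ_x v_{x,i}v_{x,j}/‖v_x‖² = c·δ_{ij}`, i.e.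
`∑_x μ_x v_x v_xᵀ/‖v_x‖² = c·I` — the matrix form `Σ_A = (1/dim V)·I` in which the source prints
the conclusion of `exists_isotropic_w`. [cite: DiakonikolasKaneTzamos2021, Theorem 2.1 (matrix form)] -/
theorem entries_of_quadForm_w {X : Type*} [Fintype X] {k : ℕ} (μ : X → ℝ) (v : X → Fin k → ℝ)
    (c : ℝ) (h : ∀ w : Fin k → ℝ, ∑ x, μ x * ((v x ⬝ᵥ w) ^ 2 / (v x ⬝ᵥ v x)) = c * (w ⬝ᵥ w))
    (i j : Fin k) :
    ∑ x, μ x * (v x i * v x j / (v x ⬝ᵥ v x)) = c * (if i = j then 1 else 0) := by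
  classical
  have key : ∀ x, μ x * (v x i * v x j / (v x ⬝ᵥ v x)) =
      (μ x * ((v x ⬝ᵥ (Pi.single i 1 + Pi.single j 1)) ^ 2 / (v x ⬝ᵥ v x))
        - μ x * ((v x ⬝ᵥ Pi.single i 1) ^ 2 / (v x ⬝ᵥ v x))
        - μ x * ((v x ⬝ᵥ Pi.single j 1) ^ 2 / (v x ⬝ᵥ v x))) / 2 := by
    intro x
    rw [dotProduct_add, dotProduct_single, dotProduct_single, mul_one, mul_one]
    ring
  rw [Finset.sum_congr rfl fun x _ => key x, ← Finset.sum_div, Finset.sum_sub_distrib,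
    Finset.sum_sub_distrib, h, h, h]
  have hii : (Pi.single i (1 : ℝ) : Fin k → ℝ) ⬝ᵥ Pi.single i 1 = 1 := by simp
  have hjj : (Pi.single j (1 : ℝ) : Fin k → ℝ) ⬝ᵥ Pi.single j 1 = 1 := by simp
  have hij : (Pi.single i (1 : ℝ) : Fin k → ℝ) ⬝ᵥ Pi.single j 1 = if i = j then 1 else 0 := by
    rw [single_dotProduct, one_mul, Pi.single_apply]
  have hji : (Pi.single j (1 : ℝ) : Fin k → ℝ) ⬝ᵥ Pi.single i 1 = if i = j then 1 else 0 := by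
    rw [single_dotProduct, one_mul, Pi.single_apply]
    by_cases h' : i = j
    · rw [if_pos h', if_pos h'.symm]
    · rw [if_neg h', if_neg (Ne.symm h')]
  rw [add_dotProduct, dotProduct_add, dotProduct_add, hii, hjj, hij, hji]
  ring

open Classical in
/-- `exists_isotropic_w` with the subspace-mass hypothesis stated on the full preimages
`{x : u_x ∈ W}` (classical decidability of membership). [cite: DiakonikolasKaneTzamos2021, Theorem 2.1] -/
theorem exists_isotropic_w' (X : Type) [Fintype X] (k : ℕ) (u : X → Fin k → ℝ) (μ : X → ℝ)
    (hμ : ∀ x, 0 < μ x) (hu : ∀ x, u x ≠ 0)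
    (hB : ∀ W : Submodule ℝ (Fin k → ℝ), W ≠ ⊥ → W ≠ ⊤ →
      (k : ℝ) * ∑ x ∈ Finset.univ.filter (fun x => u x ∈ W), μ x <
        Module.finrank ℝ W * ∑ x, μ x) :
    ∃ A : Matrix (Fin k) (Fin k) ℝ, IsUnit A.det ∧ ∀ w : Fin k → ℝ,
      ∑ x, μ x * ((A *ᵥ u x ⬝ᵥ w) ^ 2 / (A *ᵥ u x ⬝ᵥ A *ᵥ u x)) =
        (∑ x, μ x) / k * (w ⬝ᵥ w) := by
  refine exists_isotropic_w X k u μ hμ hu fun W hWb hWt T hT => ?_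
  refine lt_of_le_of_lt ?_ (hB W hWb hWt)
  refine mul_le_mul_of_nonneg_left ?_ (Nat.cast_nonneg k)
  exact Finset.sum_le_sum_of_subset_of_nonneg (fun x hx => by simpa using hT x hx)
    fun x _ _ => (hμ x).le


/-- **Radial isotropic position inside a subspace.**  Let `V ≤ ℝ^k` be a subspace of dimension `r`,
`S` a finite set of indices with `u_x ∈ V ∖ {0}` and weights `μ_x > 0` (`x ∈ S`), such that every
nonzero proper subspace `W < V` satisfies the strict subspace-mass inequality RELATIVE TO `V`:
`r·μ{x ∈ S : u_x ∈ W} < dim W · μ(S)`.  Then there is a linear isomorphism `T : V → ℝ^r` (given as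
a linear map `ℝ^k → ℝ^r` together with a linear section `L : ℝ^r → V ≤ ℝ^k`, `T ∘ L = id`,
`L ∘ T = id` on `V`) putting the sub-family in radial isotropic position in `ℝ^r`:
`∑_{x∈S} μ_x ⟨Tu_x,w⟩²/‖Tu_x‖² = (μ(S)/r)‖w‖²`.  (Coordinates of `V` by any basis, then
`exists_isotropic_w` in `ℝ^r`; this is the form in which the peel / Forster decomposition uses the
theorem on each piece.) [cite: DiakonikolasKaneTzamos2021, Theorem 2.1 and Theorem 1.4] -/
theorem exists_isotropic_submodule (X : Type) [Fintype X] [DecidableEq X] (k r : ℕ)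
    (u : X → Fin k → ℝ) (μ : X → ℝ)
    (V : Submodule ℝ (Fin k → ℝ)) (hr : Module.finrank ℝ V = r)
    (S : Finset X) (hSV : ∀ x ∈ S, u x ∈ V) (hu : ∀ x ∈ S, u x ≠ 0) (hμ : ∀ x ∈ S, 0 < μ x)
    (hB : ∀ W : Submodule ℝ (Fin k → ℝ), W ≠ ⊥ → W < V → ∀ T : Finset X, T ⊆ S →
      (∀ x ∈ T, u x ∈ W) → (r : ℝ) * ∑ x ∈ T, μ x < Module.finrank ℝ W * ∑ x ∈ S, μ x) :
    ∃ (T : (Fin k → ℝ) →ₗ[ℝ] (Fin r → ℝ)) (L : (Fin r → ℝ) →ₗ[ℝ] (Fin k → ℝ)),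
      (∀ w, T (L w) = w) ∧ (∀ v ∈ V, L (T v) = v) ∧ (∀ w, L w ∈ V) ∧
      ∀ w : Fin r → ℝ, ∑ x ∈ S, μ x * ((T (u x) ⬝ᵥ w) ^ 2 / (T (u x) ⬝ᵥ T (u x))) =
        (∑ x ∈ S, μ x) / r * (w ⬝ᵥ w) := by
  classical
  -- coordinates on `V` and a projection onto `V`
  let b : Module.Basis (Fin r) ℝ V := Module.finBasisOfFinrankEq ℝ V hr
  let φ : V ≃ₗ[ℝ] (Fin r → ℝ) := b.equivFun
  obtain ⟨q, hq⟩ := V.exists_isCompl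
  let P : (Fin k → ℝ) →ₗ[ℝ] V := V.projectionOnto q hq
  have hP : ∀ v : V, P v = v := fun v => Submodule.projectionOnto_apply_left hq v
  -- the embedding `f : ℝ^r → ℝ^k` with image `V`
  let f : (Fin r → ℝ) →ₗ[ℝ] (Fin k → ℝ) := V.subtype ∘ₗ φ.symm.toLinearMap
  have hf : Function.Injective f := by
    intro a a' h
    have : φ.symm a = φ.symm a' := Subtype.ext h
    simpa using this
  have hfV : ∀ w, f w ∈ V := fun w => (φ.symm w).2
  -- the family in coordinates, indexed by `S`
  let u' : S → Fin r → ℝ := fun x => φ ⟨u x, hSV x x.2⟩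
  have hfu' : ∀ x : S, f (u' x) = u x := by
    intro x
    show ((φ.symm (φ ⟨u x, hSV x x.2⟩) : V) : Fin k → ℝ) = u x
    rw [LinearEquiv.symm_apply_apply]
  have hu' : ∀ x : S, u' x ≠ 0 := by
    intro x h0
    have h1 : f (u' x) = 0 := by rw [h0, map_zero]
    rw [hfu'] at h1
    exact hu x x.2 h1
  -- the strict subspace-mass inequality in coordinates
  have hB' : ∀ W' : Submodule ℝ (Fin r → ℝ), W' ≠ ⊥ → W' ≠ ⊤ → ∀ T' : Finset S,
      (∀ x ∈ T', u' x ∈ W') → (r : ℝ) * ∑ x ∈ T', μ x <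
        Module.finrank ℝ W' * ∑ x : S, μ x := by
    intro W' hW'b hW't T' hT'
    set W : Submodule ℝ (Fin k → ℝ) := W'.map f with hWdef
    have hWdim : Module.finrank ℝ W = Module.finrank ℝ W' :=
      (LinearEquiv.finrank_eq (Submodule.equivMapOfInjective f hf W')).symm
    have hWb : W ≠ ⊥ := by
      intro h
      apply hW'b
      rw [← Submodule.finrank_eq_zero, ← hWdim, h, finrank_bot]
    have hWV : W < V := by
      refine lt_of_le_of_ne ?_ ?_
      · rintro v ⟨w, -, rfl⟩
        exact hfV w
      · intro hWV
        have h1 : Module.finrank ℝ W' < r := by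
          have := Submodule.finrank_lt hW't
          rwa [Module.finrank_fin_fun] at this
        rw [← hWdim, hWV, hr] at h1
        exact lt_irrefl _ h1
    set T : Finset X := T'.map (Function.Embedding.subtype _) with hTdef
    have hTS : T ⊆ S := by
      intro x hx
      obtain ⟨x', -, rfl⟩ := Finset.mem_map.mp hx
      exact x'.2
    have hTW : ∀ x ∈ T, u x ∈ W := by
      intro x hx
      obtain ⟨x', hx', rfl⟩ := Finset.mem_map.mp hx
      rw [hWdef, Submodule.mem_map]
      exact ⟨u' x', hT' x' hx', hfu' x'⟩
    have h := hB W hWb hWV T hTS hTW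
    rw [hWdim] at h
    have hsumT : ∑ x ∈ T, μ x = ∑ x ∈ T', μ x := by
      rw [hTdef, Finset.sum_map]
      rfl
    have hsumS : ∑ x ∈ S, μ x = ∑ x : S, μ x := (Finset.sum_coe_sort S μ).symm
    rwa [hsumT, hsumS] at h
  -- the weighted theorem in `ℝ^r`
  obtain ⟨A, hAdet, hiso⟩ := exists_isotropic_w S r u' (fun x => μ x) (fun x => hμ x x.2) hu' hB'
  refine ⟨A.mulVecLin ∘ₗ φ.toLinearMap ∘ₗ P, f ∘ₗ (A⁻¹).mulVecLin, fun w => ?_, fun v hv => ?_,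
    fun w => hfV _, fun w => ?_⟩
  · -- `T (L w) = w`
    show A *ᵥ φ (P (f (A⁻¹ *ᵥ w))) = w
    have : P (f (A⁻¹ *ᵥ w)) = φ.symm (A⁻¹ *ᵥ w) := hP _
    rw [this, LinearEquiv.apply_symm_apply, Matrix.mulVec_mulVec, Matrix.mul_nonsing_inv A hAdet,
      Matrix.one_mulVec]
  · -- `L (T v) = v` on `V`
    show f (A⁻¹ *ᵥ (A *ᵥ φ (P v))) = v
    rw [Matrix.mulVec_mulVec, Matrix.nonsing_inv_mul A hAdet, Matrix.one_mulVec, hP ⟨v, hv⟩]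
    show ((φ.symm (φ ⟨v, hv⟩) : V) : Fin k → ℝ) = v
    rw [LinearEquiv.symm_apply_apply]
  · -- isotropy
    have hTu : ∀ x : S, (A.mulVecLin ∘ₗ φ.toLinearMap ∘ₗ P) (u x) = A *ᵥ u' x := by
      intro x
      show A *ᵥ φ (P (u x)) = A *ᵥ φ ⟨u x, hSV x x.2⟩
      rw [hP ⟨u x, hSV x x.2⟩]
    rw [← Finset.sum_coe_sort S, ← Finset.sum_coe_sort S]
    rw [Finset.sum_congr rfl fun (x : S) _ => by rw [hTu x]]
    exact hiso w


/-! ### V.6 The converse: the subspace-mass inequality is necessary -/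

open scoped RealInnerProductSpace in
/-- **The subspace-mass inequality is necessary for radial isotropic position** (exact form of the
"only if" direction of Hopkins–Kane–Lovett–Mahajan's Lemma 4.19; Diakonikolas–Kane–Tzamos p. 7: "the
trace of `Σ_A` along this subspace will be more than `dim(W)/dim(V)`"): if unit-normalised vectors
`v_x` with weights `μ_x ≥ 0` satisfy `∑_x μ_x ⟨v_x,w⟩²/‖v_x‖² = c‖w‖²` for all `w`, then every subspace
`W` carries mass `μ{x ∈ T : v_x ∈ W ∖ {0}} ≤ c · dim W`. (Take the trace of the isotropy identity
along an orthonormal basis of `W`; a unit vector inside `W` contributes `1`.)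
[cite: HopkinsEtAl2020, Lemma 4.19 (necessity)] -/
theorem mass_le_of_isotropic {X : Type*} [Fintype X] {k : ℕ} (v : X → Fin k → ℝ) (μ : X → ℝ)
    (hμ : ∀ x, 0 ≤ μ x) (c : ℝ)
    (hiso : ∀ w : Fin k → ℝ, ∑ x, μ x * ((v x ⬝ᵥ w) ^ 2 / (v x ⬝ᵥ v x)) = c * (w ⬝ᵥ w))
    (W : Submodule ℝ (Fin k → ℝ)) (T : Finset X) (hT : ∀ x ∈ T, v x ∈ W) (hv : ∀ x ∈ T, v x ≠ 0) :
    ∑ x ∈ T, μ x ≤ c * Module.finrank ℝ W := by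
  classical
  -- transport `W` to Euclidean space and pick an orthonormal basis
  set eL : (Fin k → ℝ) ≃ₗ[ℝ] EuclideanSpace ℝ (Fin k) := (WithLp.linearEquiv 2 ℝ (Fin k → ℝ)).symm
    with heL
  have heL_apply : ∀ f : Fin k → ℝ, eL f = WithLp.toLp 2 f := fun f => rfl
  set WE : Submodule ℝ (EuclideanSpace ℝ (Fin k)) := W.map (eL : (Fin k → ℝ) →ₗ[ℝ] _) with hWE
  have hdim : Module.finrank ℝ WE = Module.finrank ℝ W := LinearEquiv.finrank_map_eq eL W
  set d := Module.finrank ℝ WE with hd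
  let b : OrthonormalBasis (Fin d) ℝ WE := stdOrthonormalBasis ℝ WE
  -- the basis vectors in coordinates
  let bv : Fin d → Fin k → ℝ := fun l => WithLp.ofLp ((b l : WE) : EuclideanSpace ℝ (Fin k))
  have hinner : ∀ f g : Fin k → ℝ, ⟪WithLp.toLp 2 f, WithLp.toLp 2 g⟫ = f ⬝ᵥ g := by
    intro f g
    rw [EuclideanSpace.inner_toLp_toLp, star_trivial, dotProduct_comm]
  have hbv_inner : ∀ (l : Fin d) (f : Fin k → ℝ),
      ⟪((b l : WE) : EuclideanSpace ℝ (Fin k)), WithLp.toLp 2 f⟫ = bv l ⬝ᵥ f := by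
    intro l f
    rw [← hinner]
  -- orthonormality in coordinates
  have horth : ∀ l, bv l ⬝ᵥ bv l = 1 := by
    intro l
    have h1 := (orthonormal_iff_ite.mp b.orthonormal) l l
    rw [if_pos rfl, Submodule.coe_inner] at h1
    rw [← h1, ← hinner]
  -- Parseval inside `W`
  have hpars : ∀ f : Fin k → ℝ, f ∈ W → ∑ l, (bv l ⬝ᵥ f) ^ 2 = f ⬝ᵥ f := by
    intro f hf
    have hz : eL f ∈ WE := Submodule.mem_map_of_mem hf
    have h := b.sum_sq_inner_right ⟨eL f, hz⟩
    simp_rw [Submodule.coe_inner] at h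
    rw [Submodule.coe_norm, ← real_inner_self_eq_norm_sq] at h
    change ∑ l, ⟪((b l : WE) : EuclideanSpace ℝ (Fin k)), WithLp.toLp 2 f⟫ ^ 2 =
      ⟪WithLp.toLp 2 f, WithLp.toLp 2 f⟫ at h
    simp_rw [hbv_inner, hinner] at h
    exact h
  -- trace of the isotropy identity along the basis
  have htrace : ∑ x, μ x * ((∑ l, (v x ⬝ᵥ bv l) ^ 2) / (v x ⬝ᵥ v x)) = c * d := by
    have h1 : ∀ l, ∑ x, μ x * ((v x ⬝ᵥ bv l) ^ 2 / (v x ⬝ᵥ v x)) = c := fun l => by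
      rw [hiso (bv l), horth l, mul_one]
    calc ∑ x, μ x * ((∑ l, (v x ⬝ᵥ bv l) ^ 2) / (v x ⬝ᵥ v x))
        = ∑ x, ∑ l, μ x * ((v x ⬝ᵥ bv l) ^ 2 / (v x ⬝ᵥ v x)) := by
          refine Finset.sum_congr rfl fun x _ => ?_
          rw [Finset.sum_div, Finset.mul_sum]
      _ = ∑ l, ∑ x, μ x * ((v x ⬝ᵥ bv l) ^ 2 / (v x ⬝ᵥ v x)) := Finset.sum_comm
      _ = ∑ _l : Fin d, c := Finset.sum_congr rfl fun l _ => h1 l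
      _ = c * d := by rw [Finset.sum_const, Finset.card_univ, Fintype.card_fin, nsmul_eq_mul, mul_comm]
  -- points of `T` contribute their full weight, the others nonnegatively
  have hTterm : ∀ x ∈ T, μ x * ((∑ l, (v x ⬝ᵥ bv l) ^ 2) / (v x ⬝ᵥ v x)) = μ x := by
    intro x hx
    have hpos : 0 < v x ⬝ᵥ v x :=
      lt_of_le_of_ne (Finset.sum_nonneg fun i _ => mul_self_nonneg _)
        (fun h0 => hv x hx (dotProduct_self_eq_zero.mp h0.symm))
    have : ∑ l, (v x ⬝ᵥ bv l) ^ 2 = v x ⬝ᵥ v x := by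
      rw [← hpars (v x) (hT x hx)]
      exact Finset.sum_congr rfl fun l _ => by rw [dotProduct_comm]
    rw [this, div_self hpos.ne', mul_one]
  have hnonneg : ∀ x, 0 ≤ μ x * ((∑ l, (v x ⬝ᵥ bv l) ^ 2) / (v x ⬝ᵥ v x)) := fun x =>
    mul_nonneg (hμ x) (div_nonneg (Finset.sum_nonneg fun l _ => sq_nonneg _)
      (Finset.sum_nonneg fun i _ => mul_self_nonneg _))
  calc ∑ x ∈ T, μ x = ∑ x ∈ T, μ x * ((∑ l, (v x ⬝ᵥ bv l) ^ 2) / (v x ⬝ᵥ v x)) :=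
        (Finset.sum_congr rfl hTterm).symm
    _ ≤ ∑ x, μ x * ((∑ l, (v x ⬝ᵥ bv l) ^ 2) / (v x ⬝ᵥ v x)) :=
        Finset.sum_le_univ_sum_of_nonneg hnonneg
    _ = c * d := htrace
    _ = c * Module.finrank ℝ W := by rw [← hdim]

/-- **Necessity of the subspace-mass inequality for radial isotropic position** (the converse direction
to `exists_isotropic_w`, non-strict): if a nonsingular `A` puts `(u, μ)` (`μ ≥ 0`) in radial isotropic
position with constant `c` — `∑_x μ_x ⟨Au_x,w⟩²/‖Au_x‖² = c‖w‖²` for all `w` — then every subspace `W`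
and every finite sub-family of nonzero vectors inside `W` satisfy `μ(T) ≤ c · dim W`; with
`c = (∑μ)/k` (`exists_isotropic_w`): `k·μ{x : u_x ∈ W} ≤ dim W · ∑μ`.  So the hypothesis of
`exists_isotropic_w` is sharp up to strictness (Hopkins–Kane–Lovett–Mahajan, Lemma 4.19).
[cite: HopkinsEtAl2020, Lemma 4.19 (necessity)] -/
theorem subspaceMass_le_of_isotropicPosition {X : Type*} [Fintype X] {k : ℕ} (u : X → Fin k → ℝ)
    (μ : X → ℝ) (hμ : ∀ x, 0 ≤ μ x) (A : Matrix (Fin k) (Fin k) ℝ) (hA : IsUnit A.det) (c : ℝ)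
    (hiso : ∀ w : Fin k → ℝ,
      ∑ x, μ x * ((A *ᵥ u x ⬝ᵥ w) ^ 2 / (A *ᵥ u x ⬝ᵥ A *ᵥ u x)) = c * (w ⬝ᵥ w))
    (W : Submodule ℝ (Fin k → ℝ)) (T : Finset X) (hT : ∀ x ∈ T, u x ∈ W) (hu : ∀ x ∈ T, u x ≠ 0) :
    ∑ x ∈ T, μ x ≤ c * Module.finrank ℝ W := by
  have hinj : Function.Injective A.mulVecLin :=
    Matrix.mulVec_injective_iff_isUnit.mpr ((Matrix.isUnit_iff_isUnit_det A).mpr hA)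
  have hdim : Module.finrank ℝ (W.map A.mulVecLin) = Module.finrank ℝ W :=
    (LinearEquiv.finrank_eq (Submodule.equivMapOfInjective _ hinj W)).symm
  rw [← hdim]
  exact mass_le_of_isotropic (fun x => A *ᵥ u x) μ hμ c hiso (W.map A.mulVecLin) T
    (fun x hx => Submodule.mem_map_of_mem (f := A.mulVecLin) (hT x hx))
    (fun x hx h0 => hu x hx (hinj (h0.trans (Matrix.mulVec_zero A).symm)))


end Forster

/-- **Discharge of the named fact `ForsterIsotropicPosition`** (Forster 2002, Theorem 4.1: radial
isotropic position of a finite family in general position), by `Forster.exists_isotropic`.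
[cite: Forster2002, Theorem 4.1] -/
theorem ForsterIsotropicPosition_holds : ForsterIsotropicPosition :=
  Forster.forsterIsotropicPosition_holds

open Matrix in
/-- **Generalized Forster transform — weighted radial isotropic position under the strict
subspace-mass inequality** (Diakonikolas–Kane–Tzamos 2021, Theorem 2.1, after Hopkins–Kane–Lovett–
Mahajan 2020; Barthe 1998; Forster 2002): for nonzero vectors `u : X → ℝ^k` with weights `μ_x > 0`,
if every nonzero proper subspace `W` has `k·∑_{u_x ∈ W} μ_x < dim W · ∑_x μ_x`, then some nonsingular
`A` satisfies `∑_x μ_x ⟨Au_x,w⟩²/‖Au_x‖² = ((∑_x μ_x)/k)·‖w‖²` for all `w`.  By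
`Forster.exists_isotropic_w` (PROVED; no named fact). [cite: DiakonikolasKaneTzamos2021, Theorem 2.1] -/
theorem weightedRadialIsotropicPosition :
    ∀ (X : Type) [Fintype X] (k : ℕ) (u : X → Fin k → ℝ) (μ : X → ℝ),
      (∀ x, 0 < μ x) → (∀ x, u x ≠ 0) →
      (∀ W : Submodule ℝ (Fin k → ℝ), W ≠ ⊥ → W ≠ ⊤ → ∀ T : Finset X,
        (∀ x ∈ T, u x ∈ W) → (k : ℝ) * ∑ x ∈ T, μ x < Module.finrank ℝ W * ∑ x, μ x) →
      ∃ A : Matrix (Fin k) (Fin k) ℝ, IsUnit A.det ∧ ∀ w : Fin k → ℝ,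
        ∑ x, μ x * ((A *ᵥ u x ⬝ᵥ w) ^ 2 / (A *ᵥ u x ⬝ᵥ A *ᵥ u x)) =
          (∑ x, μ x) / k * (w ⬝ᵥ w) :=
  fun X _ k u μ hμ hu hB => Forster.exists_isotropic_w X k u μ hμ hu hB

end Literature.Computability.Complexity
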